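import Literature.Probability.RandomPlanarGeometry.HexSAWBrickWallStripFugacityWidthOneContactDensity
import Mathlib.Analysis.SpecialFunctions.Log.Basic
import Mathlib.Analysis.SpecialFunctions.Pow.Real
import Mathlib.Analysis.SpecialFunctions.Pow.Asymptotics
import Mathlib.Analysis.Calculus.MeanValue
import HarnessLib

/-!
# Large deviations of the adsorbed fraction of the self-avoiding walk in the one-cell honeycomb strip

Beaton–Bousquet-Mélou–de Gier–Duminil-Copin–Guttmann [BBdGDCG2014, §3.2, arXiv v5 p. 10] weigh the `N`-step self-avoiding
walks `ω` of the honeycomb strip `S_T` by `y^{bc(ω)} z^{tc(ω)}` (`bc`, `tc` = contacts with the bottom / top wall; tree: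
`bottomVisits₀`, `topVisits₀ 1`, `HexBW.wgt y z N q`, partition function `stripZ₂ 1 N y z = C_{1,N}(y,z)`, growth rate
`stripMuY₂ 1 y z = μ_1(y,z)` of Proposition 6, `s = μ_1²` the root above `max(y,z)` of the SEXTIC LAW `s(s−y)(s−z) = yz`).  The
previous file `HexSAWBrickWallStripFugacityWidthOneContactDensity.lean` proved, for `T = 1` and every `y, z > 0`, the law of large
numbers `bc(ω)/N → b(y,z) = s(s−z)/(2F(s))` under `P_{N,y,z} ∝ y^{bc} z^{tc}` with exponentially small tails, and identified
`b = y ∂_y log μ_1` (`hasDerivAt_log_stripMuY₂_one`) with `b` STRICTLY increasing in `y` (`contactB_strictMono_left`).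

THIS FILE computes the exponential rates exactly: the LARGE DEVIATION PRINCIPLE for the adsorbed fraction, with the rate function in
closed parametric form.  For `y, z > 0` put, for every "tilted" fugacity `Y > 0`,

  `I(y,z;Y) = b(Y,z)·log(Y/y) − log(μ_1(Y,z)/μ_1(y,z))`      (`contactRate y z Y`).

★★★ `tendsto_log_contacts_ge_div`: for every `Y ≥ y`, `(1/N)·log P_{N,y,z}(bc(ω) ≥ b(Y,z)·N) → −I(y,z;Y)`;
★★★ `tendsto_log_contacts_le_div`: for every `0 < Y ≤ y`, `(1/N)·log P_{N,y,z}(bc(ω) ≤ b(Y,z)·N) → −I(y,z;Y)` (rate `0` AT `Y = y`);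
and since `Y ↦ b(Y,z)` maps `(y,∞)` onto `(b(y,z), 1/2)` and `(0,y)` onto `(0, b(y,z))` (`exists_gt_contactB_eq`,
`exists_lt_contactB_eq`), EVERY level `a ∈ (0, 1/2)` is covered (★★★ `exists_tendsto_log_contacts_ge_div`, ★★★ `exists_tendsto_log_contacts_le_div`;
ed.2: `levelY`, ★★★ `tendsto_log_contacts_ge_le_div_level` with the rate `levelRate y z a = I*(a)` STRICTLY CONVEX in `a`): in Cramér's notation the rate at level `a = b(Y_a,z)` is
`I*(a) = a·log(Y_a/y) − [log μ_1(Y_a,z) − log μ_1(y,z)] = sup_{u>0} {a·log u − [log μ_1(yu,z) − log μ_1(y,z)]}`, the Legendre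
transform of the free-energy increment (★★ `isGreatest_contactRate`).  In Janse van Rensburg's language
[JansevanRensburg2015, §3.2] these are the INTEGRATED DENSITY FUNCTIONS of the contact number, and the file derives the CONTACT
ENTROPY of the strip: ★★★ `tendsto_log_card_contacts_ge_div` / `…_le_div` — for `Y > 1` (resp. `0 < Y < 1`) the number of `N`-step
self-avoiding walks of `S_1` (up to the translations of the strip) with at least (resp. at most) `b(Y,1)·N` bottom contacts grows
like `exp(N·[log μ_1(Y,1) − b(Y,1)·log Y])`, an entropy `< log μ(S_1)` off the typical density `b(1,1) = v/4` (★★ `contactEntropy_lt`).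

## Main statements (namespace `Literature.Probability.RandomPlanarGeometry.SAW.HexBW`, all PROVED, standard axioms)

§1 `tendsto_log_div_of_exp_bounds` (squeeze on the exponential scale), ★ `tendsto_log_stripZ₂_one_div`
(`(1/N) log C_{1,N}(y,z) → log μ_1(y,z)`, the free energy), `eventually_stripZ₂_one_exp_bounds`, `continuousAt_stripMuY₂_one_left`
(section of the tree's `continuousOn_stripMuY₂`), `continuousAt_contactB_left`.
§2 ★ `contactRate` (`I(y,z;Y)`), `contactRate_self` (`I(y,z;y) = 0`), `contactRate_eq`, ★★ `mul_log_sub_lt_log_stripMuY₂_sub`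
(STRICT tangent inequality `b(Y,z)(log y' − log Y) < log μ_1(y',z) − log μ_1(Y,z)`, `y' ≠ Y`: mean value theorem on
`t ↦ log μ_1(e^t,z)` whose derivative `b(e^t,z)` is strictly increasing), ★★ `contactRate_pos` (`I > 0` for `Y ≠ y`),
`contactRate_nonneg`, ★★ `isGreatest_contactRate` (the Legendre characterisation), ★★ `strictMonoOn_contactRate` (on `[y,∞)`),
★★ `strictAntiOn_contactRate` (on `(0,y]`).
§3 `eventually_le_exp_mul`, ★★ `fraction_le_exp_of_chernoff` (Chernoff with the exact tilt `u = Y/y` — tree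
`sum_contacts_ge_mul_rpow_le` / `sum_contacts_le_mul_rpow_le` — gives `P ≤ exp(N(−I + ε))` eventually).
§4 `mul_le_max_mul_natCast`, ★ `exp_mul_windowSum_le` (change of fugacity `y → Y'` on a window `a₁N ≤ bc ≤ a₂N` costs at most
`exp(N·max(a₁ log(Y'/y), a₂ log(Y'/y)))`), ★ `eventually_half_le_windowSum` (the tree's LLN `tendsto_contactDevFraction` at the
fugacity `Y'` fills the window), ★★ `exp_le_windowFraction` (`P_{N,y,z}(window) ≥ exp(−N(cost + ε))` eventually).
§5 `continuousAt_windowCost`, ★★★ **`tendsto_log_contacts_ge_div`**, ★★★ **`tendsto_log_contacts_le_div`** (the lower bound lets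
`Y' → Y`, using the continuity of `b(·,z)` and of `μ_1(·,z)`).
§6 `continuousOn_contactB_left`, ★ `exists_gt_contactB_eq`, ★ `exists_lt_contactB_eq` (intermediate values between `b(y,z)` and
the tree's phase portrait `tendsto_contactB_atTop` / `tendsto_contactB_nhdsGT_zero`), ★★★ **`exists_tendsto_log_contacts_ge_div`**,
★★★ **`exists_tendsto_log_contacts_le_div`** (the LDP at every level `a`).
§7 `eventually_sum_contacts_ge_pos` / `…_le_pos`, ★★★ `tendsto_log_sum_contacts_ge_div` / `…_le_div` (restricted free energies
`(1/N) log Σ_{bc ≥ b(Y,z)N} y^{bc}z^{tc} → log μ_1(Y,z) − b(Y,z) log(Y/y)`), `sum_wgt_one_one_eq_card`,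
★★★ **`tendsto_log_card_contacts_ge_div`**, ★★★ **`tendsto_log_card_contacts_le_div`** (THE CONTACT ENTROPY), ★★ `contactEntropy_lt`.
§8 `contactRate_eq_top_form`, `contactRate_eq_zero_form`, ★★★ **`tendsto_contactRate_atTop`** (`I(y,z;Y) → log μ_1(y,z) − ½log y
= ½ log(s/y)` as `Y → ∞`: the cost of TOTAL ADSORPTION — `P_{N,y,z}(bc ≥ (½−o(1))N) ≈ (√y/μ_1)^N`), ★★★
**`tendsto_contactRate_nhdsGT_zero`** (`I → ½ log(s/z)` as `Y → 0⁺`: the cost of TOTAL DESORPTION — the walks avoiding the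
bottom wall grow like `z^{N/2}`), `extremeRates_pos`.
§9 (ed.2) THE LEVEL VARIABLE: `exists_pos_contactB_eq`, ★ `levelY` (`Y_a`: the unique fugacity with `b(Y_a,z) = a`, `a ∈ (0,1/2)`),
`levelY_spec`, `levelY_pos`, `levelY_contactB` (`Y_{b(Y,z)} = Y`), `strictMonoOn_levelY`, `lt_levelY_iff`, `continuousOn_levelY`
(a strictly monotone map of `(0,1/2)` onto `(0,∞)` is continuous), `tendsto_levelY_atTop` (`Y_a → ∞`, `a → 1/2⁻`),
`tendsto_levelY_nhdsGT_zero` (`Y_a → 0⁺`, `a → 0⁺`).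
§10 (ed.2) CRAMÉR'S RATE FUNCTION IN THE LEVEL: ★ `levelRate y z a = I(y,z;Y_a)` (`= I*(a)`), `levelRate_contactB` (`I*(b(y,z)) = 0`),
★★ `levelRate_pos`, ★★ `isGreatest_levelRate` (`I*(a) = max_{u>0} {a log u − [log μ_1(yu,z) − log μ_1(y,z)]}`),
★★★ **`strictConvexOn_levelRate`** (`I*` STRICTLY CONVEX on `(0,1/2)`), `convexOn_levelRate`, `continuousOn_levelRate`,
★★ `strictAntiOn_strictMonoOn_levelRate` (`I*` strictly ↓ on `(0,b]`, strictly ↑ on `[b,1/2)`), ★★★ `tendsto_levelRate_half_zero`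
(`I*(½⁻) = ½log(s/y)`, `I*(0⁺) = ½log(s/z)`), ★★★ **`tendsto_log_contacts_ge_le_div_level`** (THE LDP AT LEVEL `a`:
`(1/N) log P_{N,y,z}(bc ≥ aN) → −I*(a)` for `a ∈ [b(y,z),1/2)`, `(1/N) log P_{N,y,z}(bc ≤ aN) → −I*(a)` for `a ∈ (0,b(y,z)]`).
§11 (ed.2) THE CONTACT ENTROPY FUNCTION: ★ `contactEntropy z a = σ_z(a) = log μ_1(Y_a,z) − a log Y_a` (Janse van Rensburg's density
function `log 𝒫(a)` of bottom contacts, top fugacity `z`), `contactEntropy_eq` (`σ_z = log μ_1(1,z) − I*_{y=1}`),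
★★ `isLeast_contactEntropy` (`σ_z(a) = min_{Y>0} {log μ_1(Y,z) − a log Y}`), ★★★ **`strictConcaveOn_contactEntropy`**,
`continuousOn_contactEntropy`, ★★ `contactEntropy_le` (`σ_z ≤ log μ_1(1,z)`, `=` iff `a = b(1,z)`; strictly ↑ then strictly ↓),
★★★ **`tendsto_contactEntropy`** (`σ_z(½⁻) = 0`, `σ_z(0⁺) = ½log z`), ★★★ **`tendsto_log_card_contacts_div_level`** — at `z = 1`:
the number of `N`-step walks of `S_1` with at least (resp. at most) `aN` bottom contacts is `exp(N(σ(a) + o(1)))` for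
`a ∈ [b(1,1),½)` (resp. `(0,b(1,1)]`), `σ = contactEntropy 1` a strictly concave continuous arch on `(0,½)` with `σ(0⁺) = σ(½⁻) = 0`
and apex `log μ(S_1)` exactly at `a = b(1,1) = v/4 ≈ 0.2057` (`μ(S_1)` the plastic number).
§12 (ed.2) THE ENVELOPE THEOREM: `levelRate_sub_mem_Icc` (two-sided secant bound from the Legendre inequality used twice),
★★★ **`hasDerivAt_levelRate`** (`I*′(a) = log(Y_a/y)`), ★★★ **`hasDerivAt_contactEntropy`** (`σ_z′(a) = −log Y_a`: the slope of
the entropy is minus the log-fugacity — the duality inverse of `y ∂_y log μ_1 = b`), ★★ `tendsto_deriv_contactEntropy` (`σ_z′ → +∞`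
at `0⁺`, `→ −∞` at `½⁻`: infinite end-slopes).
§13 (ed.3) THE TOP WALL BY REFLECTION: ★ `sum_filter_topVisits_eq_sum_filter_bottomVisits` (the tree's reflection `flipPair` maps
every tail sum of `tc` at `(y,z)` to the tail sum of `bc` at `(z,y)`), ★★★ **`tendsto_log_topContacts_ge_le_div`** (the LDP of
`tc(ω)/N` under `P_{N,y,z}` with rate `I(z,y;Z)`), ★★ `tendsto_log_topContacts_ge_le_div_level`.
§14 (ed.3) ★★ `two_mul_totalVisits_add_nV` — THE PARITY IDENTITY `2(bc + tc) + V = N + [x_N odd] + [x_0 odd]` on `S_N(S_1)`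
(`V = LadderPot.nV` = number of rungs): surface contacts and rungs are affinely related up to `O(1)`.
§15 (ed.3) THE DIAGONAL FREE ENERGY: `continuousAt_contactB₂` (joint continuity of `b`), `log_stripMuY₂_diag_sub_mem`,
★★ `hasDerivAt_log_stripMuY₂_diag_exp` (`d/dt log μ_1(eᵗ,eᵗ) = 2b(eᵗ,eᵗ)`, squeeze between one-variable tangent bounds),
★ `contactB_diag_strictMono`, ★★ `two_mul_log_sub_lt_log_stripMuY₂_diag_sub` (strict tangent inequality on the diagonal),
★ `diagRate y Y = I₂(y;Y) = 2b(Y,Y) log(Y/y) − log(μ_1(Y,Y)/μ_1(y,y))`, `diagRate_self`, ★★ `diagRate_pos`.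
§16 (ed.3) TOTAL SURFACE CONTACTS along rays `(y,z) ↦ (yu,zu)`: `wgt_tilt_ray`, ★★ `sum_total_ge/le_mul_rpow_le` (Chernoff with a
shifted level `κN + d`), ★★ `fraction_le_exp_of_chernoff₂`, `mul_le_max_mul_natCast_add`, ★ `exp_mul_windowSumT_le`,
★ `eventually_half_le_windowSumT` (BOTH laws of large numbers fill the window `a₁N + d₁ ≤ bc+tc ≤ a₂N + d₂`), ★★ `exp_le_windowFractionT`,
`continuousAt_windowCostT`, ★★★ **`totalContacts_ge_exp_bounds`** / **`totalContacts_le_exp_bounds`** (two-sided exponential bounds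
for `P_{N,y,y}(bc+tc ≥ 2b(Y,Y)N + d)`, resp. `≤`, ANY fixed shift `d`), ★★★ **`tendsto_log_totalContacts_ge_le_div`** (the LDP of
the total surface-contact fraction on the diagonal, rate `I₂`).
§17 (ed.3) THE RUNG DENSITY: `four_mul_contactB_diag` (`4b(Y,Y) = 1 − 1/(2μ_1(Y,Y)+3)`), `rung_event_sandwich` (rung events between
total-contact events with shifts `0` and `1`), ★★★ **`tendsto_log_rungs_le_div`** / **`tendsto_log_rungs_ge_div`**
(`(1/N) log P_{N,y,y}(V ≤ N/(2μ_1(Y,Y)+3)) → −I₂(y;Y)` for `Y ≥ y`, and `V ≥ …` for `Y ≤ y`), `stripZ₂_one_one_one_eq_stripCount`,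
★★★ **`tendsto_log_card_rungs_div`** (the UNIFORM self-avoiding walk of `S_1`: `(1/N) log(#{V ≤ N/(2μ_1(Y,Y)+3)}/c_N(S_1)) →
−I₂(1;Y)`, `Y ≥ 1`; `V ≥ …` for `Y ≤ 1` — the large deviations behind the tree's `tendsto_rungDevFraction`), ★★★
**`tendsto_log_card_rungs_count_div`** (THE RUNG ENTROPY: `#{ω ∈ S_N(S_1) : V(ω) ≤ N/(2m+3)} = exp(N[log m − 2b(Y,Y) log Y + o(1)])`,
`m = μ_1(Y,Y)`, `m³ = Ym + Y`).
§18 (ed.3) THE RUNG ENTROPY IN CLOSED FORM: `rungM ρ = (1−3ρ)/(2ρ)`, `rungY ρ = m³/(m+1)`, ★ `rungEntropy ρ = log m − ((1−ρ)/2) log(m³/(m+1))`,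
`rungY_spec` (`μ_1(Y(ρ),Y(ρ)) = m(ρ)`, `1/(2μ_1+3) = ρ`, `2b = (1−ρ)/2` — the cubic law inverts the diagonal explicitly),
`one_le_rungY_iff` (the typical density `ρ* = 1/(2μ(S_1)+3)` splits the tails), ★★★ **`tendsto_log_card_rungs_div_closedForm`**
(`ρ ∈ (0,ρ*]`: `(1/N) log #{V ≤ ρN} → s_V(ρ)`; `ρ ∈ [ρ*,1/3)`: `(1/N) log #{V ≥ ρN} → s_V(ρ)` — an EXPLICIT ELEMENTARY entropy function of
the rung density), ★★ `rungEntropy_le` (`s_V ≤ log μ(S_1)`, equality iff `ρ = ρ*`).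
§19 (ed.4) THE CONTACT ENTROPY IN PARAMETRIC CLOSED FORM (parameter `s = μ_1(Y,z)² ∈ (z,∞)`): `paramY z s = s²(s−z)/(s²−sz+z)` (the sextic solved
for the fugacity), `paramB z s = (s−z)(s²−sz+z)/(2[z(2s−z)+(s−z)(s²−sz+z)])`, `paramY_spec` (`μ_1(Y(s),z)² = s` by the tree's uniqueness
`stripMuY₂_one_sq_eq_of_root`), ★★ `contactB_paramY` (`b(Y(s),z) = paramB z s`), ★★★ **`contactEntropy_param`** (`σ_z(a(s)) = ½log s − a(s)·log Y(s)`;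
at `z = 1` the contact entropy of the uniform strip walk is the explicit parametric curve `(a(s), ½log s − a(s) log(s²(s−1)/(s²−s+1)))`, `s > 1`,
`a(s) = (s−1)(s²−s+1)/(2(s³−2s²+4s−2))`), ★★ `levelRate_param` (`I*(a(s)) = a(s) log(Y(s)/y) − ½log(s/μ_1(y,z)²)`).

## Method (own route; elementary given the tree)

UPPER BOUND: the tilt identity `wgt (yu) z = wgt y z · u^{bc}` gives Chernoff's inequality
`P_{N,y,z}(bc ≥ aN) ≤ u^{−aN} C_{1,N}(yu,z)/C_{1,N}(y,z)` (tree), and with `u = Y/y`, `a = b(Y,z)` the Fekete-type bounds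
`μ_1^N ≤ K(y)K(z) C_{1,N} ≤ (μ_1(1+η))^N` (tree: `stripMuY₂_one_pow_le`, `eventually_stripZ₂_one_le_pow₂`) give
`limsup (1/N) log P ≤ −I(y,z;Y)`.  LOWER BOUND (change of measure): on the window `aN ≤ bc ≤ (2b(Y',z) − a)N`, `Y' > Y`, the
weights at `y` are at least `exp(−N·max(a, 2b(Y',z)−a)·log(Y'/y))` times the weights at `Y'`, and under `P_{N,Y',z}` the window has
probability `→ 1` by the contact-density law AT `Y'` (tree: `tendsto_contactDevFraction`); letting `Y' ↓ Y` (continuity of `b(·,z)`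
and `μ_1(·,z)`, from the tree's `continuousOn_stripMuY₂`) gives `liminf (1/N) log P ≥ −I(y,z;Y)`.  The optimal tilt is EXPLICIT
(`u = Y/y`), so no convex optimisation is needed for the limit; the Legendre characterisation and `I > 0` follow from the strict
tangent inequality of §2.

## Sources

[BBdGDCG2014] N. R. Beaton, M. Bousquet-Mélou, J. de Gier, H. Duminil-Copin, A. J. Guttmann, *The critical fugacity for surface
adsorption of self-avoiding walks on the honeycomb lattice is 1 + √2*, CMP 326 (2014); arXiv:1109.0358v5, §3.2 p. 10
(`C_{T,k}(y,z)`, Proposition 6: the objects; no large-deviation statement is printed there).  [DemboZeitouni2010] A. Dembo,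
O. Zeitouni, *Large Deviations Techniques and Applications*, §2.2 Theorem 2.2.3 (Cramér's theorem in `ℝ`: Chebycheff upper bound,
change-of-measure lower bound), §2.3 Theorem 2.3.6 (Gärtner–Ellis) — the METHOD.  [JansevanRensburg2015] E. J. Janse van Rensburg,
*The Statistical Mechanics of Interacting Walks, Polygons, Animals and Vesicles* (2nd ed., OUP 2015), §3.2 Theorems 3.17–3.19
(integrated density functions; the density function is the Legendre transform of the free energy, `log 𝒫(ε) = inf_z {𝓕(z) −
ε log z}`) — the FRAMEWORK for interacting lattice models.  [HammersleyTorrieWhittington1982] J. M. Hammersley, G. M. Torrie,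
S. G. Whittington, J. Phys. A 15 (1982) 539–571, §3 (existence of the free energy of adsorbing self-avoiding walks).
[MadrasSlade1993] §1.2, §8.5 pp. 278–279 (one-dimensional lattices, after [AlmJanson1990]).  NO QUOTATION AS PRINTED; no source
in our holdings states the rate function of the one-cell strip — the closed forms are this file's, built on the tree's sextic law.
NOT CLAIMED: the local (sharp) form `P(bc = ⌊aN⌋)`, Bahadur–Rao prefactors, the central limit theorem / variance, the joint large
deviations of `(bc, tc)` off the rays `(yu, zu)` (the aligned quadrants need joint strict convexity of the free energy), strips of width
`T ≥ 2`; second derivatives of `I*`/`σ` (the curvature `1/χ`); the large deviations of the span `|X(ω)|/N` (which differ from those of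
`V/N`: the back steps `N − |X| − V` are not bounded).
-/

noncomputable section

open Filter Topology Finset Literature.Probability.LatticeModels Literature.Probability.Percolation SimpleGraph

namespace Literature.Probability.RandomPlanarGeometry.SAW.HexBW

open WidthOneYZ

variable {y z : ℝ}

/-! ## §1 Exponential scale: a squeeze lemma, the free energy, continuity of the contact density -/

/-- From two-sided exponential bounds to the limit of `log(p_N)/N` (the elementary last step of every large-deviation
statement in this file). [cite: DemboZeitouni2010, §1.2 (the large deviation principle; lane plumbing)] -/
theorem tendsto_log_div_of_exp_bounds {p : ℕ → ℝ} {L : ℝ}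
    (hlo : ∀ ε : ℝ, 0 < ε → ∀ᶠ N : ℕ in atTop, Real.exp ((L - ε) * N) ≤ p N)
    (hhi : ∀ ε : ℝ, 0 < ε → ∀ᶠ N : ℕ in atTop, p N ≤ Real.exp ((L + ε) * N)) :
    Tendsto (fun N : ℕ => Real.log (p N) / N) atTop (𝓝 L) := by
  rw [tendsto_order]
  refine ⟨fun a ha => ?_, fun a ha => ?_⟩
  · have hε : 0 < (L - a) / 2 := by linarith
    filter_upwards [hlo _ hε, Filter.eventually_gt_atTop 0] with N hN hN0
    have hN' : (0 : ℝ) < N := by exact_mod_cast hN0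
    have hp : 0 < p N := (Real.exp_pos _).trans_le hN
    have h1 : (L - (L - a) / 2) * N ≤ Real.log (p N) := by
      rw [← Real.log_exp ((L - (L - a) / 2) * N)]; exact Real.log_le_log (Real.exp_pos _) hN
    rw [lt_div_iff₀ hN']; nlinarith
  · have hε : 0 < (a - L) / 2 := by linarith
    filter_upwards [hhi _ hε, hlo _ hε, Filter.eventually_gt_atTop 0] with N hN hN' hN0
    have hN'' : (0 : ℝ) < N := by exact_mod_cast hN0
    have hp : 0 < p N := (Real.exp_pos _).trans_le hN'
    have h1 : Real.log (p N) ≤ (L + (a - L) / 2) * N := by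
      rw [← Real.log_exp ((L + (a - L) / 2) * N)]; exact Real.log_le_log hp hN
    rw [div_lt_iff₀ hN'']; nlinarith

/-- ★ **The free energy**: `(1/N) log C_{1,N}(y,z) → log μ_1(y,z)` for all `y, z > 0` (the tree's Proposition 6
`tendsto_stripZ₂_rpow`, in logarithmic form). [cite: BeatonBousquetMelouDeGierDuminilCopinGuttmann2014, §3.2 Proposition 6 (arXiv v5 p. 10)] -/
theorem tendsto_log_stripZ₂_one_div (hy : 0 < y) (hz : 0 < z) :
    Tendsto (fun N : ℕ => Real.log (stripZ₂ 1 N y z) / N) atTop (𝓝 (Real.log (stripMuY₂ 1 y z))) := by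
  have hμ := stripMuY₂_pos 1 hy hz
  have h := ((Real.continuousAt_log hμ.ne').tendsto).comp (tendsto_stripZ₂_rpow 1 hy hz)
  refine h.congr' ?_
  filter_upwards [Filter.eventually_gt_atTop 0] with N hN
  have hZ := stripZ₂_pos 1 N hy hz
  show Real.log (stripZ₂ 1 N y z ^ (1 / (N : ℝ))) = Real.log (stripZ₂ 1 N y z) / N
  rw [Real.log_rpow hZ]; ring

/-- Two-sided exponential control of the partition function: eventually
`exp((log μ_1(y,z))·N) ≤ K(y)K(z)·C_{1,N}(y,z)` and `C_{1,N}(y,z) ≤ exp((log μ_1(y,z) + ε)·N)`.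
[cite: BeatonBousquetMelouDeGierDuminilCopinGuttmann2014, §3.2 Proposition 6 (arXiv v5 p. 10)] -/
theorem eventually_stripZ₂_one_exp_bounds (hy : 0 < y) (hz : 0 < z) {ε : ℝ} (hε : 0 < ε) :
    ∀ᶠ N : ℕ in atTop, Real.exp (Real.log (stripMuY₂ 1 y z) * N) ≤ yK y * yK z * stripZ₂ 1 N y z ∧
      stripZ₂ 1 N y z ≤ Real.exp ((Real.log (stripMuY₂ 1 y z) + ε) * N) := by
  have hμ := stripMuY₂_pos 1 hy hz
  have hη : 0 < Real.exp ε - 1 := by have := Real.one_lt_exp_iff.2 hε; linarith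
  filter_upwards [eventually_stripZ₂_one_le_pow₂ hy hz hη, Filter.eventually_gt_atTop 0] with N hN hN0
  refine ⟨?_, ?_⟩
  · have h := stripMuY₂_one_pow_le hy hz (n := N) (by omega)
    have e : Real.exp (Real.log (stripMuY₂ 1 y z) * N) = stripMuY₂ 1 y z ^ N := by
      rw [mul_comm, Real.exp_nat_mul, Real.exp_log hμ]
    rwa [e]
  · calc stripZ₂ 1 N y z ≤ (stripMuY₂ 1 y z * (1 + (Real.exp ε - 1))) ^ N := hN
      _ = Real.exp ((Real.log (stripMuY₂ 1 y z) + ε) * N) := by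
          rw [mul_comm (_ + ε), Real.exp_nat_mul, Real.exp_add, Real.exp_log hμ]; ring_nf

/-- `y ↦ μ_1(y,z)` is continuous at every `y > 0` (`z > 0` fixed) — a section of the tree's joint continuity
`continuousOn_stripMuY₂`. [cite: BeatonBousquetMelouDeGierDuminilCopinGuttmann2014, Proposition 6 (arXiv v5 p. 10: "log-convex and thus continuous")] -/
theorem continuousAt_stripMuY₂_one_left (hy : 0 < y) (hz : 0 < z) :
    ContinuousAt (fun y' => stripMuY₂ 1 y' z) y := by
  have h : ContinuousAt (fun p : ℝ × ℝ => stripMuY₂ 1 p.1 p.2) (y, z) :=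
    (continuousOn_stripMuY₂ 1).continuousAt ((isOpen_Ioi.prod isOpen_Ioi).mem_nhds ⟨hy, hz⟩)
  have hg : ContinuousAt (fun y' : ℝ => (y', z)) y := continuousAt_id.prodMk continuousAt_const
  exact ContinuousAt.comp (f := fun y' : ℝ => (y', z)) (g := fun p : ℝ × ℝ => stripMuY₂ 1 p.1 p.2) h hg

/-- `y ↦ b(y,z)` is continuous at every `y > 0` (`z > 0` fixed): `b` is a rational function of `y` and `s = μ_1(y,z)²` with a
positive denominator. [cite: BeatonBousquetMelouDeGierDuminilCopinGuttmann2014, §3.2 Proposition 6 (arXiv v5 p. 10)] -/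
theorem continuousAt_contactB_left (hy : 0 < y) (hz : 0 < z) : ContinuousAt (fun y' => contactB y' z) y := by
  have hμc := continuousAt_stripMuY₂_one_left hy hz
  have hF : sexticDeriv y z (stripMuY₂ 1 y z ^ 2) ≠ 0 := (contactB_facts hy hz).2.2.1.ne'
  have hs : ContinuousAt (fun y' => stripMuY₂ 1 y' z ^ 2) y := hμc.pow 2
  have hFc : ContinuousAt (fun y' => sexticDeriv y' z (stripMuY₂ 1 y' z ^ 2)) y := by
    unfold sexticDeriv
    exact (((hs.sub continuousAt_id).mul (hs.sub continuousAt_const)).add (hs.mul (hs.sub continuousAt_const))).add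
      (hs.mul (hs.sub continuousAt_id))
  unfold contactB
  exact (hs.mul (hs.sub continuousAt_const)).div (continuousAt_const.mul hFc) (mul_ne_zero two_ne_zero hF)

/-! ## §2 The rate function `I(y,z;Y) = b(Y,z)·log(Y/y) − log(μ_1(Y,z)/μ_1(y,z))` and the tangent inequality -/

/-- ★ **The large-deviation rate of the contact fraction, parametrised by the tilted fugacity `Y`**:
`I(y,z;Y) = b(Y,z)·log(Y/y) − log(μ_1(Y,z)/μ_1(y,z))`.  For `Y ≥ y` it is the exponential cost of the event
`bc(ω) ≥ b(Y,z)·N` under `P_{N,y,z}`, for `Y ≤ y` that of `bc(ω) ≤ b(Y,z)·N` (§5); as a function of the level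
`a = b(Y,z)` it is the Legendre transform of the free energy `t ↦ log μ_1(y e^t, z)` (`isGreatest_contactRate`).
[cite: DemboZeitouni2010, §2.2 Theorem 2.2.3 (Cramér) and §2.3 Theorem 2.3.6 (Gärtner–Ellis)]
[cite: JansevanRensburg2015, §3.2 Theorems 3.17–3.19 (density functions as Legendre transforms of the free energy)] -/
def contactRate (y z Y : ℝ) : ℝ :=
  contactB Y z * Real.log (Y / y) - Real.log (stripMuY₂ 1 Y z / stripMuY₂ 1 y z)

/-- `I(y,z;y) = 0`. [cite: DemboZeitouni2010, §2.2 Theorem 2.2.3 (lane plumbing)] -/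
theorem contactRate_self (hy : 0 < y) (hz : 0 < z) : contactRate y z y = 0 := by
  unfold contactRate
  rw [div_self hy.ne', div_self (stripMuY₂_pos 1 hy hz).ne', Real.log_one]; ring

/-- `I(y,z;Y)` with the logarithms separated. [cite: DemboZeitouni2010, §2.2 (lane plumbing)] -/
theorem contactRate_eq (hy : 0 < y) (hz : 0 < z) {Y : ℝ} (hY : 0 < Y) :
    contactRate y z Y = contactB Y z * (Real.log Y - Real.log y) -
      (Real.log (stripMuY₂ 1 Y z) - Real.log (stripMuY₂ 1 y z)) := by
  unfold contactRate
  rw [Real.log_div hY.ne' hy.ne', Real.log_div (stripMuY₂_pos 1 hY hz).ne' (stripMuY₂_pos 1 hy hz).ne']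

/-- ★★ **Strict tangent inequality for the free energy**: for `y' ≠ Y` (all positive),
`b(Y,z)·(log y' − log Y) < log μ_1(y',z) − log μ_1(Y,z)` — the graph of the convex function `t ↦ log μ_1(e^t,z)` lies
STRICTLY above its tangent at `t = log Y` (mean value theorem + `b` strictly increasing, `contactB_strictMono_left`).
[cite: BeatonBousquetMelouDeGierDuminilCopinGuttmann2014, §3.2 Proposition 6 (arXiv v5 p. 10); MadrasSlade1993, §1.2] -/
theorem mul_log_sub_lt_log_stripMuY₂_sub (hz : 0 < z) {y' Y : ℝ} (hy' : 0 < y') (hY : 0 < Y) (hne : y' ≠ Y) :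
    contactB Y z * (Real.log y' - Real.log Y) < Real.log (stripMuY₂ 1 y' z) - Real.log (stripMuY₂ 1 Y z) := by
  set g : ℝ → ℝ := fun t => Real.log (stripMuY₂ 1 (Real.exp t) z) with hg
  have hderiv : ∀ t, HasDerivAt g (contactB (Real.exp t) z) t := fun t => hasDerivAt_log_stripMuY₂_exp hz t
  have hgy' : g (Real.log y') = Real.log (stripMuY₂ 1 y' z) := by simp only [hg, Real.exp_log hy']
  have hgY : g (Real.log Y) = Real.log (stripMuY₂ 1 Y z) := by simp only [hg, Real.exp_log hY]
  rcases lt_or_gt_of_ne hne with hlt | hlt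
  · -- `y' < Y`: slope on `[log y', log Y]` equals `b(e^τ)` with `τ < log Y`, hence `< b(Y)`
    have hll : Real.log y' < Real.log Y := Real.log_lt_log hy' hlt
    obtain ⟨τ, hτ, hslope⟩ := exists_hasDerivAt_eq_slope g (fun t => contactB (Real.exp t) z) hll
      (fun t _ => (hderiv t).continuousAt.continuousWithinAt) (fun t _ => hderiv t)
    have hτY : contactB (Real.exp τ) z < contactB Y z := by
      have h := contactB_strictMono_left (Real.exp_pos τ) hz (y' := Y) (by
        calc Real.exp τ < Real.exp (Real.log Y) := Real.exp_lt_exp.2 hτ.2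
          _ = Y := Real.exp_log hY)
      exact h
    rw [hgy', hgY] at hslope
    have hpos : 0 < Real.log Y - Real.log y' := by linarith
    have key : contactB Y z * (Real.log Y - Real.log y') >
        Real.log (stripMuY₂ 1 Y z) - Real.log (stripMuY₂ 1 y' z) := by
      have := mul_lt_mul_of_pos_right hτY hpos
      rwa [hslope, div_mul_cancel₀ _ hpos.ne'] at this
    linarith
  · -- `Y < y'`: slope on `[log Y, log y']` equals `b(e^τ)` with `τ > log Y`, hence `> b(Y)`
    have hll : Real.log Y < Real.log y' := Real.log_lt_log hY hlt
    obtain ⟨τ, hτ, hslope⟩ := exists_hasDerivAt_eq_slope g (fun t => contactB (Real.exp t) z) hll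
      (fun t _ => (hderiv t).continuousAt.continuousWithinAt) (fun t _ => hderiv t)
    have hτY : contactB Y z < contactB (Real.exp τ) z := by
      have h := contactB_strictMono_left hY hz (y' := Real.exp τ) (by
        calc Y = Real.exp (Real.log Y) := (Real.exp_log hY).symm
          _ < Real.exp τ := Real.exp_lt_exp.2 hτ.1)
      exact h
    rw [hgy', hgY] at hslope
    have hpos : 0 < Real.log y' - Real.log Y := by linarith
    have := mul_lt_mul_of_pos_right hτY hpos
    rwa [hslope, div_mul_cancel₀ _ hpos.ne'] at this

/-- The non-strict tangent inequality (all positive `y', Y`). [cite: BeatonBousquetMelouDeGierDuminilCopinGuttmann2014, §3.2 Proposition 6 (arXiv v5 p. 10); MadrasSlade1993, §1.2] -/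
theorem mul_log_sub_le_log_stripMuY₂_sub (hz : 0 < z) {y' Y : ℝ} (hy' : 0 < y') (hY : 0 < Y) :
    contactB Y z * (Real.log y' - Real.log Y) ≤ Real.log (stripMuY₂ 1 y' z) - Real.log (stripMuY₂ 1 Y z) := by
  rcases eq_or_ne y' Y with rfl | hne
  · simp
  · exact (mul_log_sub_lt_log_stripMuY₂_sub hz hy' hY hne).le

/-- ★★ **`I(y,z;Y) > 0` for `Y ≠ y`** (strict convexity of the free energy).
[cite: DemboZeitouni2010, §2.2 Theorem 2.2.3; JansevanRensburg2015, §3.2 Theorem 3.19] -/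
theorem contactRate_pos (hy : 0 < y) (hz : 0 < z) {Y : ℝ} (hY : 0 < Y) (hne : Y ≠ y) : 0 < contactRate y z Y := by
  rw [contactRate_eq hy hz hY]
  have h := mul_log_sub_lt_log_stripMuY₂_sub hz hy hY hne.symm
  linarith

/-- `I(y,z;Y) ≥ 0`. [cite: DemboZeitouni2010, §2.2 Theorem 2.2.3 (lane plumbing)] -/
theorem contactRate_nonneg (hy : 0 < y) (hz : 0 < z) {Y : ℝ} (hY : 0 < Y) : 0 ≤ contactRate y z Y := by
  rcases eq_or_ne Y y with rfl | hne
  · rw [contactRate_self hy hz]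
  · exact (contactRate_pos hy hz hY hne).le

/-- ★★ **The Legendre characterisation**: for every tilt `u > 0`,
`b(Y,z)·log u − log(μ_1(yu,z)/μ_1(y,z)) ≤ I(y,z;Y)`, with equality at `u = Y/y`; i.e. at the level `a = b(Y,z)` the rate is
`sup_u {a log u − [log μ_1(yu,z) − log μ_1(y,z)]}`, the Legendre transform of the free energy increment.
[cite: DemboZeitouni2010, §2.2 Theorem 2.2.3 (Cramér: Λ*(a) = sup_λ {λa − Λ(λ)}); JansevanRensburg2015, §3.2 Theorem 3.19] -/
theorem isGreatest_contactRate (hy : 0 < y) (hz : 0 < z) {Y : ℝ} (hY : 0 < Y) :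
    IsGreatest ((fun u : ℝ => contactB Y z * Real.log u - Real.log (stripMuY₂ 1 (y * u) z / stripMuY₂ 1 y z)) ''
      Set.Ioi (0 : ℝ)) (contactRate y z Y) := by
  refine ⟨⟨Y / y, div_pos hY hy, by simp only [mul_div_cancel₀ _ hy.ne']; rfl⟩, ?_⟩
  rintro _ ⟨u, hu, rfl⟩
  have hu : 0 < u := hu
  have hyu : 0 < y * u := mul_pos hy hu
  show contactB Y z * Real.log u - Real.log (stripMuY₂ 1 (y * u) z / stripMuY₂ 1 y z) ≤ contactRate y z Y
  rw [contactRate_eq hy hz hY, Real.log_div (stripMuY₂_pos 1 hyu hz).ne' (stripMuY₂_pos 1 hy hz).ne']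
  have h := mul_log_sub_le_log_stripMuY₂_sub hz hyu hY
  rw [Real.log_mul hy.ne' hu.ne'] at h
  nlinarith [h]

/-- ★★ **`I(y,z;·)` is strictly increasing on `[y, ∞)`** (the cost of a larger excess of contacts is larger).
[cite: DemboZeitouni2010, §2.2 Lemma 2.2.5 (monotonicity of Λ* away from the mean); JansevanRensburg2015, §3.2 Theorem 3.17] -/
theorem strictMonoOn_contactRate (hy : 0 < y) (hz : 0 < z) : StrictMonoOn (contactRate y z) (Set.Ici y) := by
  intro Y hY Y' hY' hYY'
  have hY0 : 0 < Y := hy.trans_le hY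
  have hY'0 : 0 < Y' := hy.trans_le hY'
  rcases eq_or_lt_of_le (show y ≤ Y from hY) with rfl | hyY
  · rw [contactRate_self hy hz]; exact contactRate_pos hy hz hY'0 hYY'.ne'
  · rw [contactRate_eq hy hz hY0, contactRate_eq hy hz hY'0]
    have ht := mul_log_sub_le_log_stripMuY₂_sub hz hY0 hY'0   -- tangent at `Y'`, evaluated at `Y`
    have hb := contactB_strictMono_left hY0 hz hYY'
    have hl : 0 < Real.log Y - Real.log y := by linarith [Real.log_lt_log hy hyY]
    nlinarith [mul_pos (sub_pos.2 hb) hl]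

/-- ★★ **`I(y,z;·)` is strictly decreasing on `(0, y]`** (the cost of a larger deficit of contacts is larger).
[cite: DemboZeitouni2010, §2.2 Lemma 2.2.5; JansevanRensburg2015, §3.2 Theorem 3.17] -/
theorem strictAntiOn_contactRate (hy : 0 < y) (hz : 0 < z) : StrictAntiOn (contactRate y z) (Set.Ioc 0 y) := by
  intro Y hY Y' hY' hYY'
  have hY0 : 0 < Y := hY.1
  have hY'0 : 0 < Y' := hY'.1
  rcases eq_or_lt_of_le (show Y' ≤ y from hY'.2) with rfl | hY'y
  · rw [contactRate_self hy hz]; exact contactRate_pos hy hz hY0 hYY'.ne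
  · rw [contactRate_eq hy hz hY0, contactRate_eq hy hz hY'0]
    have ht := mul_log_sub_le_log_stripMuY₂_sub hz hY'0 hY0   -- tangent at `Y`, evaluated at `Y'`
    have hb := contactB_strictMono_left hY0 hz hYY'
    have hl : Real.log Y' - Real.log y < 0 := by linarith [Real.log_lt_log hY'0 hY'y]
    nlinarith [mul_pos (sub_pos.2 hb) (neg_pos.2 hl)]

/-! ## §3 The Chernoff side: an exponential upper bound from the exact tilt `u = Y/y` -/

/-- An elementary fact used twice: a constant is eventually below `exp(cN)` (`c > 0`). [cite: DemboZeitouni2010, §1.2 (lane plumbing)] -/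
theorem eventually_le_exp_mul {K c : ℝ} (hc : 0 < c) : ∀ᶠ N : ℕ in atTop, K ≤ Real.exp (c * N) := by
  have ht : Tendsto (fun N : ℕ => c * (N : ℝ)) atTop atTop := tendsto_natCast_atTop_atTop.const_mul_atTop hc
  filter_upwards [(Real.tendsto_exp_atTop.comp ht).eventually_ge_atTop K] with N hN
  exact hN

/-- ★★ **From Chernoff to the exponential scale.**  If `S_N ≥ 0` satisfies the Chernoff inequality
`S_N · (Y/y)^{aN} ≤ C_{1,N}(Y,z)` (tree: `sum_contacts_ge_mul_rpow_le` for `Y ≥ y`, `sum_contacts_le_mul_rpow_le` for `Y ≤ y`),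
then `S_N / C_{1,N}(y,z) ≤ exp(N·[−(a·log(Y/y) − log(μ_1(Y,z)/μ_1(y,z))) + ε])` for all large `N`.
[cite: DemboZeitouni2010, §2.2 Theorem 2.2.3 (upper bound, Chebycheff/Chernoff step); BeatonBousquetMelouDeGierDuminilCopinGuttmann2014, §3.2 Proposition 6 (arXiv v5 p. 10)] -/
theorem fraction_le_exp_of_chernoff (hy : 0 < y) (hz : 0 < z) {Y : ℝ} (hY : 0 < Y) (a : ℝ) (S : ℕ → ℝ)
    (hS : ∀ N : ℕ, S N * (Y / y) ^ (a * N) ≤ stripZ₂ 1 N Y z) {ε : ℝ} (hε : 0 < ε) :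
    ∀ᶠ N : ℕ in atTop, S N / stripZ₂ 1 N y z ≤
      Real.exp ((-(a * Real.log (Y / y) - Real.log (stripMuY₂ 1 Y z / stripMuY₂ 1 y z)) + ε) * N) := by
  have hu : 0 < Y / y := div_pos hY hy
  set K := yK y * yK z with hK
  have hK1 : 1 ≤ K := by rw [hK]; nlinarith [one_le_yK y, one_le_yK z]
  have hK0 : 0 < K := by linarith
  have hε2 : 0 < ε / 2 := by linarith
  rw [Real.log_div (stripMuY₂_pos 1 hY hz).ne' (stripMuY₂_pos 1 hy hz).ne']
  filter_upwards [eventually_stripZ₂_one_exp_bounds hY hz hε2, eventually_stripZ₂_one_exp_bounds hy hz hε2,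
    eventually_le_exp_mul (K := K) hε2] with N hNY hNy hNK
  obtain ⟨_, hZY⟩ := hNY
  obtain ⟨hZy, _⟩ := hNy
  have hZy0 := stripZ₂_pos 1 N hy hz
  have hZY0 := stripZ₂_pos 1 N hY hz
  have hpow0 : 0 < (Y / y) ^ (a * N) := Real.rpow_pos_of_pos hu _
  have hupow : (Y / y) ^ (a * N) = Real.exp (a * Real.log (Y / y) * N) := by
    rw [Real.rpow_def_of_pos hu]; ring_nf
  -- `S_N ≤ C_{1,N}(Y,z) · exp(−a log(Y/y) N)`
  have hS' : S N ≤ stripZ₂ 1 N Y z * Real.exp (-(a * Real.log (Y / y) * N)) := by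
    rw [Real.exp_neg, ← hupow, ← div_eq_mul_inv, le_div_iff₀ hpow0]; exact hS N
  have hS0 : S N / stripZ₂ 1 N y z ≤
      stripZ₂ 1 N Y z * Real.exp (-(a * Real.log (Y / y) * N)) / stripZ₂ 1 N y z :=
    div_le_div_of_nonneg_right hS' hZy0.le
  -- `1/C_{1,N}(y,z) ≤ K exp(−log μ_1(y,z) · N)`
  have h1 : 1 / stripZ₂ 1 N y z ≤ K * Real.exp (-(Real.log (stripMuY₂ 1 y z) * N)) := by
    have hE := Real.exp_pos (Real.log (stripMuY₂ 1 y z) * N)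
    rw [div_le_iff₀ hZy0, Real.exp_neg]
    have e : K * (Real.exp (Real.log (stripMuY₂ 1 y z) * N))⁻¹ * stripZ₂ 1 N y z =
        (K * stripZ₂ 1 N y z) / Real.exp (Real.log (stripMuY₂ 1 y z) * N) := by
      field_simp
    rw [e, le_div_iff₀ hE, one_mul]; exact hZy
  calc S N / stripZ₂ 1 N y z
      ≤ stripZ₂ 1 N Y z * Real.exp (-(a * Real.log (Y / y) * N)) / stripZ₂ 1 N y z := hS0
    _ = stripZ₂ 1 N Y z * Real.exp (-(a * Real.log (Y / y) * N)) * (1 / stripZ₂ 1 N y z) := by ring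
    _ ≤ Real.exp ((Real.log (stripMuY₂ 1 Y z) + ε / 2) * N) * Real.exp (-(a * Real.log (Y / y) * N)) *
          (K * Real.exp (-(Real.log (stripMuY₂ 1 y z) * N))) := by
        gcongr
    _ ≤ Real.exp ((Real.log (stripMuY₂ 1 Y z) + ε / 2) * N) * Real.exp (-(a * Real.log (Y / y) * N)) *
          (Real.exp (ε / 2 * N) * Real.exp (-(Real.log (stripMuY₂ 1 y z) * N))) := by
        gcongr
    _ = Real.exp ((-(a * Real.log (Y / y) - (Real.log (stripMuY₂ 1 Y z) - Real.log (stripMuY₂ 1 y z))) + ε) * N) := by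
        rw [← Real.exp_add, ← Real.exp_add, ← Real.exp_add]; congr 1; ring

/-! ## §4 The change of measure: an exponential lower bound from the tilted law of large numbers -/

/-- If `a₁N ≤ b ≤ a₂N` then `b·ℓ ≤ max(a₁ℓ, a₂ℓ)·N` for every real `ℓ` (the sign of `ℓ` decides which end binds).
[cite: DemboZeitouni2010, §2.2 (lane plumbing)] -/
theorem mul_le_max_mul_natCast {a₁ a₂ b ℓ : ℝ} {N : ℕ} (h₁ : a₁ * N ≤ b) (h₂ : b ≤ a₂ * N) :
    b * ℓ ≤ max (a₁ * ℓ) (a₂ * ℓ) * N := by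
  have hN : (0 : ℝ) ≤ N := Nat.cast_nonneg N
  rcases le_or_gt 0 ℓ with hℓ | hℓ
  · calc b * ℓ ≤ a₂ * N * ℓ := mul_le_mul_of_nonneg_right h₂ hℓ
      _ = a₂ * ℓ * N := by ring
      _ ≤ max (a₁ * ℓ) (a₂ * ℓ) * N := mul_le_mul_of_nonneg_right (le_max_right _ _) hN
  · calc b * ℓ ≤ a₁ * N * ℓ := by nlinarith
      _ = a₁ * ℓ * N := by ring
      _ ≤ max (a₁ * ℓ) (a₂ * ℓ) * N := mul_le_mul_of_nonneg_right (le_max_left _ _) hN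

open Classical in
/-- ★ **Change of fugacity on a window of contact numbers**: on `{a₁N ≤ bc ≤ a₂N}` the weights at `y` dominate those at `Y'`
up to the factor `exp(−N·max(a₁ log(Y'/y), a₂ log(Y'/y)))`:
`Σ_{window} y^{bc} z^{tc} ≥ exp(−N·max(a₁ℓ, a₂ℓ)) · Σ_{window} Y'^{bc} z^{tc}`, `ℓ = log(Y'/y)`.
[cite: DemboZeitouni2010, §2.2 Theorem 2.2.3 (lower bound: change of measure, eq. (2.2.11)); BeatonBousquetMelouDeGierDuminilCopinGuttmann2014, §3.2 (arXiv v5 p. 10)] -/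
theorem exp_mul_windowSum_le (hy : 0 < y) (hz : 0 < z) {Y' : ℝ} (hY' : 0 < Y') (a₁ a₂ : ℝ) (N : ℕ) :
    Real.exp (-(max (a₁ * Real.log (Y' / y)) (a₂ * Real.log (Y' / y)) * N)) *
        (∑ q ∈ (stripPairs 1 N).filter (fun q => a₁ * N ≤ (bottomVisits₀ q.1 q.2 N : ℝ) ∧
            (bottomVisits₀ q.1 q.2 N : ℝ) ≤ a₂ * N), wgt Y' z N q) ≤
      ∑ q ∈ (stripPairs 1 N).filter (fun q => a₁ * N ≤ (bottomVisits₀ q.1 q.2 N : ℝ) ∧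
            (bottomVisits₀ q.1 q.2 N : ℝ) ≤ a₂ * N), wgt y z N q := by
  have hr : 0 < y / Y' := div_pos hy hY'
  have hlog : Real.log (y / Y') = -Real.log (Y' / y) := by
    rw [Real.log_div hy.ne' hY'.ne', Real.log_div hY'.ne' hy.ne']; ring
  rw [Finset.mul_sum]
  refine Finset.sum_le_sum fun q hq => ?_
  obtain ⟨-, hlo, hhi⟩ := Finset.mem_filter.1 hq
  have hw : wgt y z N q = wgt Y' z N q * (y / Y') ^ bottomVisits₀ q.1 q.2 N := by
    rw [← wgt_tilt, mul_div_cancel₀ _ hY'.ne']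
  rw [hw]
  refine mul_comm (Real.exp _) _ ▸ mul_le_mul_of_nonneg_left ?_ (wgt_nonneg hY'.le hz.le N q)
  rw [← Real.rpow_natCast, Real.rpow_def_of_pos hr, hlog]
  apply Real.exp_le_exp.2
  have h := mul_le_max_mul_natCast (ℓ := Real.log (Y' / y)) hlo hhi
  linarith

open Classical in
/-- ★ **The tilted law of large numbers fills the window**: if `a₁ < b(Y',z) < a₂` then eventually
`Σ_{a₁N ≤ bc ≤ a₂N} Y'^{bc} z^{tc} ≥ C_{1,N}(Y',z)/2` (tree: `tendsto_contactDevFraction` at the fugacity `Y'`).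
[cite: DemboZeitouni2010, §2.2 Theorem 2.2.3 (lower bound: the law of large numbers under the tilted measure); AlmJanson1990, via MadrasSlade1993 §8.5 pp. 278–279] -/
theorem eventually_half_le_windowSum (hz : 0 < z) {Y' : ℝ} (hY' : 0 < Y') {a₁ a₂ : ℝ}
    (h₁ : a₁ < contactB Y' z) (h₂ : contactB Y' z < a₂) :
    ∀ᶠ N : ℕ in atTop, stripZ₂ 1 N Y' z / 2 ≤
      ∑ q ∈ (stripPairs 1 N).filter (fun q => a₁ * N ≤ (bottomVisits₀ q.1 q.2 N : ℝ) ∧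
            (bottomVisits₀ q.1 q.2 N : ℝ) ≤ a₂ * N), wgt Y' z N q := by
  set b' := contactB Y' z with hb'
  set δ := min (b' - a₁) (a₂ - b') with hδ
  have hδ0 : 0 < δ := lt_min (by linarith) (by linarith)
  have hdev := (tendsto_contactDevFraction hY' hz hδ0).eventually (gt_mem_nhds (show (0 : ℝ) < 1 / 2 by norm_num))
  filter_upwards [hdev, Filter.eventually_gt_atTop 0] with N hN hN0
  have hN' : (0 : ℝ) < N := by exact_mod_cast hN0
  have hZ := stripZ₂_pos 1 N hY' hz
  set W := (stripPairs 1 N).filter (fun q => a₁ * N ≤ (bottomVisits₀ q.1 q.2 N : ℝ) ∧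
    (bottomVisits₀ q.1 q.2 N : ℝ) ≤ a₂ * N) with hW
  -- every walk is in the window or deviates by at least `δ`
  have hcover : stripPairs 1 N ⊆ W ∪ contactDevPairs Y' z N δ := by
    intro q hq
    rw [Finset.mem_union]
    by_cases hw : a₁ * N ≤ (bottomVisits₀ q.1 q.2 N : ℝ) ∧ (bottomVisits₀ q.1 q.2 N : ℝ) ≤ a₂ * N
    · exact Or.inl (Finset.mem_filter.2 ⟨hq, hw⟩)
    · right
      rw [contactDevPairs, Finset.mem_filter]
      refine ⟨hq, ?_⟩
      rw [not_and_or, not_le, not_le] at hw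
      rcases hw with hw | hw
      · have hlt : (bottomVisits₀ q.1 q.2 N : ℝ) / N < a₁ := by rw [div_lt_iff₀ hN']; linarith
        have : δ ≤ b' - a₁ := min_le_left _ _
        rw [le_abs]; right; linarith
      · have hlt : a₂ < (bottomVisits₀ q.1 q.2 N : ℝ) / N := by rw [lt_div_iff₀ hN']; linarith
        have : δ ≤ a₂ - b' := min_le_right _ _
        rw [le_abs]; left; linarith
  have hsplit : stripZ₂ 1 N Y' z ≤ (∑ q ∈ W, wgt Y' z N q) + ∑ q ∈ contactDevPairs Y' z N δ, wgt Y' z N q := by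
    rw [stripZ₂_one_eq_sum_wgt]
    calc ∑ q ∈ stripPairs 1 N, wgt Y' z N q ≤ ∑ q ∈ W ∪ contactDevPairs Y' z N δ, wgt Y' z N q :=
          Finset.sum_le_sum_of_subset_of_nonneg hcover fun q _ _ => wgt_nonneg hY'.le hz.le N q
      _ ≤ _ := by
          rw [← Finset.sum_union_inter]
          linarith [Finset.sum_nonneg (s := W ∩ contactDevPairs Y' z N δ) fun q _ => wgt_nonneg hY'.le hz.le N q]
  have hdev' : ∑ q ∈ contactDevPairs Y' z N δ, wgt Y' z N q < stripZ₂ 1 N Y' z / 2 := by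
    have h := hN
    rw [div_lt_iff₀ hZ] at h
    linarith
  linarith

open Classical in
/-- ★★ **THE LOWER BOUND**: if `a₁ < b(Y',z) < a₂` then, under `P_{N,y,z}`, the window `{a₁N ≤ bc ≤ a₂N}` has probability
at least `exp(−N·[max(a₁ log(Y'/y), a₂ log(Y'/y)) − log(μ_1(Y',z)/μ_1(y,z)) + ε])` for all large `N`.
[cite: DemboZeitouni2010, §2.2 Theorem 2.2.3 (lower bound (2.2.11)–(2.2.12)); JansevanRensburg2015, §3.2 Theorem 3.19] -/
theorem exp_le_windowFraction (hy : 0 < y) (hz : 0 < z) {Y' : ℝ} (hY' : 0 < Y') {a₁ a₂ : ℝ}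
    (h₁ : a₁ < contactB Y' z) (h₂ : contactB Y' z < a₂) {ε : ℝ} (hε : 0 < ε) :
    ∀ᶠ N : ℕ in atTop,
      Real.exp ((-(max (a₁ * Real.log (Y' / y)) (a₂ * Real.log (Y' / y)) -
          Real.log (stripMuY₂ 1 Y' z / stripMuY₂ 1 y z)) - ε) * N) ≤
        (∑ q ∈ (stripPairs 1 N).filter (fun q => a₁ * N ≤ (bottomVisits₀ q.1 q.2 N : ℝ) ∧
            (bottomVisits₀ q.1 q.2 N : ℝ) ≤ a₂ * N), wgt y z N q) / stripZ₂ 1 N y z := by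
  set K' := yK Y' * yK z with hK'
  have hK'1 : 1 ≤ K' := by rw [hK']; nlinarith [one_le_yK Y', one_le_yK z]
  have hK'0 : 0 < K' := by linarith
  have hε2 : 0 < ε / 2 := by linarith
  set M := max (a₁ * Real.log (Y' / y)) (a₂ * Real.log (Y' / y)) with hM
  rw [Real.log_div (stripMuY₂_pos 1 hY' hz).ne' (stripMuY₂_pos 1 hy hz).ne']
  filter_upwards [eventually_stripZ₂_one_exp_bounds hY' hz hε2, eventually_stripZ₂_one_exp_bounds hy hz hε2,
    eventually_le_exp_mul (K := 2 * K') hε2, eventually_half_le_windowSum hz hY' h₁ h₂] with N hNY hNy hNK hwin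
  obtain ⟨hZY, _⟩ := hNY
  obtain ⟨_, hZy⟩ := hNy
  have hZy0 := stripZ₂_pos 1 N hy hz
  have hZY0 := stripZ₂_pos 1 N hY' hz
  set SW := ∑ q ∈ (stripPairs 1 N).filter (fun q => a₁ * N ≤ (bottomVisits₀ q.1 q.2 N : ℝ) ∧
            (bottomVisits₀ q.1 q.2 N : ℝ) ≤ a₂ * N), wgt y z N q with hSW
  set SW' := ∑ q ∈ (stripPairs 1 N).filter (fun q => a₁ * N ≤ (bottomVisits₀ q.1 q.2 N : ℝ) ∧
            (bottomVisits₀ q.1 q.2 N : ℝ) ≤ a₂ * N), wgt Y' z N q with hSW'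
  have hchange : Real.exp (-(M * N)) * SW' ≤ SW := exp_mul_windowSum_le hy hz hY' a₁ a₂ N
  -- `C_{1,N}(Y',z) ≥ exp(log μ_1(Y',z) N)/K'` and `K' ≤ exp(ε N/2)/2`
  have hZY' : Real.exp (Real.log (stripMuY₂ 1 Y' z) * N) * Real.exp (-(ε / 2 * N)) ≤ stripZ₂ 1 N Y' z / 2 := by
    rw [Real.exp_neg, le_div_iff₀ (by norm_num : (0:ℝ) < 2)]
    have hE := Real.exp_pos (ε / 2 * N)
    calc Real.exp (Real.log (stripMuY₂ 1 Y' z) * N) * (Real.exp (ε / 2 * N))⁻¹ * 2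
        = Real.exp (Real.log (stripMuY₂ 1 Y' z) * N) * (2 / Real.exp (ε / 2 * N)) := by ring
      _ ≤ Real.exp (Real.log (stripMuY₂ 1 Y' z) * N) * (1 / K') := by
          refine mul_le_mul_of_nonneg_left ?_ (Real.exp_pos _).le
          rw [div_le_div_iff₀ hE hK'0]; linarith
      _ = Real.exp (Real.log (stripMuY₂ 1 Y' z) * N) / K' := by ring
      _ ≤ stripZ₂ 1 N Y' z := by rw [div_le_iff₀ hK'0]; linarith
  have hlow : Real.exp (-(M * N)) * (Real.exp (Real.log (stripMuY₂ 1 Y' z) * N) * Real.exp (-(ε / 2 * N))) ≤ SW :=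
    (mul_le_mul_of_nonneg_left (hZY'.trans hwin) (Real.exp_pos _).le).trans hchange
  rw [le_div_iff₀ hZy0]
  calc Real.exp ((-(M - (Real.log (stripMuY₂ 1 Y' z) - Real.log (stripMuY₂ 1 y z))) - ε) * N) * stripZ₂ 1 N y z
      ≤ Real.exp ((-(M - (Real.log (stripMuY₂ 1 Y' z) - Real.log (stripMuY₂ 1 y z))) - ε) * N) *
          Real.exp ((Real.log (stripMuY₂ 1 y z) + ε / 2) * N) := by gcongr
    _ = Real.exp (-(M * N)) * (Real.exp (Real.log (stripMuY₂ 1 Y' z) * N) * Real.exp (-(ε / 2 * N))) := by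
        rw [← Real.exp_add, ← Real.exp_add, ← Real.exp_add]; congr 1; ring
    _ ≤ SW := hlow

/-! ## §5 THE LARGE DEVIATION PRINCIPLE for the adsorbed fraction `bc(ω)/N` under `P_{N,y,z}` -/

/-- Continuity at `Y` of the window cost `Y' ↦ max(a log(Y'/y), (2b(Y',z) − a) log(Y'/y)) − log(μ_1(Y',z)/μ_1(y,z))`.
[cite: DemboZeitouni2010, §2.2 (lane plumbing)] -/
theorem continuousAt_windowCost (hy : 0 < y) (hz : 0 < z) {Y : ℝ} (hY : 0 < Y) (a : ℝ) :
    ContinuousAt (fun Y' => max (a * Real.log (Y' / y)) ((2 * contactB Y' z - a) * Real.log (Y' / y)) -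
      Real.log (stripMuY₂ 1 Y' z / stripMuY₂ 1 y z)) Y := by
  have hlog : ContinuousAt (fun Y' : ℝ => Real.log (Y' / y)) Y :=
    (continuousAt_id.div_const y).log (div_pos hY hy).ne'
  have hb := continuousAt_contactB_left hY hz
  have hμ : ContinuousAt (fun Y' => Real.log (stripMuY₂ 1 Y' z / stripMuY₂ 1 y z)) Y :=
    ((continuousAt_stripMuY₂_one_left hY hz).div_const _).log
      (div_pos (stripMuY₂_pos 1 hY hz) (stripMuY₂_pos 1 hy hz)).ne'
  exact ((continuousAt_const.mul hlog).max (((continuousAt_const.mul hb).sub continuousAt_const).mul hlog)).sub hμ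

open Classical in
/-- ★★★ **LARGE DEVIATIONS OF THE ADSORBED FRACTION — UPPER TAIL.**  For all `y, z > 0` and every `Y ≥ y`,
`lim_{N→∞} (1/N) log P_{N,y,z}(bc(ω) ≥ b(Y,z)·N) = −I(y,z;Y)`, `I(y,z;Y) = b(Y,z) log(Y/y) − log(μ_1(Y,z)/μ_1(y,z))` (`> 0` iff `Y ≠ y`)
(`P_{N,y,z} ∝ y^{bc} z^{tc}` on the `N`-step self-avoiding walks of the one-cell strip; `b(Y,z)` runs through the whole
interval `(b(y,z), 1/2)` as `Y` runs through `(y, ∞)` — `exists_level_eq_contactB_gt`).  Upper bound: Chernoff with the tilt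
`u = Y/y`; lower bound: change of fugacity to `Y' ↓ Y` and the contact-density law at `Y'`.
[cite: DemboZeitouni2010, §2.2 Theorem 2.2.3 (Cramér); JansevanRensburg2015, §3.2 Theorems 3.17–3.19 (integrated density functions)]
[cite: BeatonBousquetMelouDeGierDuminilCopinGuttmann2014, §3.2 Proposition 6 (arXiv v5 p. 10)] -/
theorem tendsto_log_contacts_ge_div (hy : 0 < y) (hz : 0 < z) {Y : ℝ} (hyY : y ≤ Y) :
    Tendsto (fun N : ℕ => Real.log ((∑ q ∈ (stripPairs 1 N).filter
        (fun q => contactB Y z * N ≤ (bottomVisits₀ q.1 q.2 N : ℝ)), wgt y z N q) / stripZ₂ 1 N y z) / N)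
      atTop (𝓝 (-contactRate y z Y)) := by
  have hY : 0 < Y := hy.trans_le hyY
  refine tendsto_log_div_of_exp_bounds (fun ε hε => ?_) (fun ε hε => ?_)
  · -- the lower bound: change of measure to `Y' ↓ Y`
    have hε2 : 0 < ε / 2 := by linarith
    have hval : max (contactB Y z * Real.log (Y / y)) ((2 * contactB Y z - contactB Y z) * Real.log (Y / y)) -
        Real.log (stripMuY₂ 1 Y z / stripMuY₂ 1 y z) = contactRate y z Y := by
      rw [show 2 * contactB Y z - contactB Y z = contactB Y z by ring, max_self]; rfl
    have hev : ∀ᶠ Y' in 𝓝 Y, max (contactB Y z * Real.log (Y' / y)) ((2 * contactB Y' z - contactB Y z) *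
        Real.log (Y' / y)) - Real.log (stripMuY₂ 1 Y' z / stripMuY₂ 1 y z) < contactRate y z Y + ε / 2 :=
      (continuousAt_windowCost hy hz hY (contactB Y z)).eventually (gt_mem_nhds (by simp only [hval]; linarith))
    obtain ⟨Y', hY'c, hYY'⟩ := ((hev.filter_mono nhdsWithin_le_nhds).and
      (self_mem_nhdsWithin : Set.Ioi Y ∈ 𝓝[>] Y)).exists
    have hYY' : Y < Y' := hYY'
    have hY' : 0 < Y' := hY.trans hYY'
    have hb1 : contactB Y z < contactB Y' z := contactB_strictMono_left hY hz hYY'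
    have hb2 : contactB Y' z < 2 * contactB Y' z - contactB Y z := by linarith
    filter_upwards [exp_le_windowFraction hy hz hY' hb1 hb2 hε2] with N hN
    refine le_trans ?_ (hN.trans ?_)
    · exact Real.exp_le_exp.2 (mul_le_mul_of_nonneg_right (by linarith) (Nat.cast_nonneg N))
    · refine div_le_div_of_nonneg_right ?_ (stripZ₂_pos 1 N hy hz).le
      refine Finset.sum_le_sum_of_subset_of_nonneg (fun q hq => ?_) fun q _ _ => wgt_nonneg hy.le hz.le N q
      rw [Finset.mem_filter] at hq ⊢
      exact ⟨hq.1, hq.2.1⟩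
  · -- the upper bound: Chernoff at `u = Y/y`
    have hu : 1 ≤ Y / y := (one_le_div hy).2 hyY
    have h := fraction_le_exp_of_chernoff hy hz hY (contactB Y z)
      (fun N => ∑ q ∈ (stripPairs 1 N).filter (fun q => contactB Y z * N ≤ (bottomVisits₀ q.1 q.2 N : ℝ)),
        wgt y z N q) (fun N => by
          have := sum_contacts_ge_mul_rpow_le hy.le hz.le hu N (contactB Y z)
          rwa [mul_div_cancel₀ _ hy.ne'] at this) hε
    filter_upwards [h] with N hN
    have e : -contactRate y z Y + ε =
        -(contactB Y z * Real.log (Y / y) - Real.log (stripMuY₂ 1 Y z / stripMuY₂ 1 y z)) + ε := rfl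
    rw [e]
    exact hN

open Classical in
/-- ★★★ **LARGE DEVIATIONS OF THE ADSORBED FRACTION — LOWER TAIL.**  For all `y, z > 0` and every `0 < Y ≤ y`,
`lim_{N→∞} (1/N) log P_{N,y,z}(bc(ω) ≤ b(Y,z)·N) = −I(y,z;Y)` (`b(Y,z)` runs through `(0, b(y,z))` as `Y` runs through
`(0, y)` — `exists_level_eq_contactB_lt`).
[cite: DemboZeitouni2010, §2.2 Theorem 2.2.3 (Cramér); JansevanRensburg2015, §3.2 Theorems 3.17–3.19 (integrated density functions)]
[cite: BeatonBousquetMelouDeGierDuminilCopinGuttmann2014, §3.2 Proposition 6 (arXiv v5 p. 10)] -/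
theorem tendsto_log_contacts_le_div (hy : 0 < y) (hz : 0 < z) {Y : ℝ} (hY : 0 < Y) (hYy : Y ≤ y) :
    Tendsto (fun N : ℕ => Real.log ((∑ q ∈ (stripPairs 1 N).filter
        (fun q => (bottomVisits₀ q.1 q.2 N : ℝ) ≤ contactB Y z * N), wgt y z N q) / stripZ₂ 1 N y z) / N)
      atTop (𝓝 (-contactRate y z Y)) := by
  refine tendsto_log_div_of_exp_bounds (fun ε hε => ?_) (fun ε hε => ?_)
  · -- the lower bound: change of measure to `Y' ↑ Y`
    have hε2 : 0 < ε / 2 := by linarith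
    have hval : max (contactB Y z * Real.log (Y / y)) ((2 * contactB Y z - contactB Y z) * Real.log (Y / y)) -
        Real.log (stripMuY₂ 1 Y z / stripMuY₂ 1 y z) = contactRate y z Y := by
      rw [show 2 * contactB Y z - contactB Y z = contactB Y z by ring, max_self]; rfl
    have hev : ∀ᶠ Y' in 𝓝 Y, max (contactB Y z * Real.log (Y' / y)) ((2 * contactB Y' z - contactB Y z) *
        Real.log (Y' / y)) - Real.log (stripMuY₂ 1 Y' z / stripMuY₂ 1 y z) < contactRate y z Y + ε / 2 :=
      (continuousAt_windowCost hy hz hY (contactB Y z)).eventually (gt_mem_nhds (by simp only [hval]; linarith))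
    obtain ⟨Y', hY'c, hYY'⟩ := ((hev.filter_mono nhdsWithin_le_nhds).and (Ioo_mem_nhdsLT hY)).exists
    have hY' : 0 < Y' := hYY'.1
    have hY'Y : Y' < Y := hYY'.2
    have hb2 : contactB Y' z < contactB Y z := contactB_strictMono_left hY' hz hY'Y
    have hb1 : 2 * contactB Y' z - contactB Y z < contactB Y' z := by linarith
    filter_upwards [exp_le_windowFraction hy hz hY' hb1 hb2 hε2] with N hN
    rw [max_comm] at hN
    refine le_trans ?_ (hN.trans ?_)
    · exact Real.exp_le_exp.2 (mul_le_mul_of_nonneg_right (by linarith) (Nat.cast_nonneg N))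
    · refine div_le_div_of_nonneg_right ?_ (stripZ₂_pos 1 N hy hz).le
      refine Finset.sum_le_sum_of_subset_of_nonneg (fun q hq => ?_) fun q _ _ => wgt_nonneg hy.le hz.le N q
      rw [Finset.mem_filter] at hq ⊢
      exact ⟨hq.1, hq.2.2⟩
  · -- the upper bound: Chernoff at `u = Y/y ≤ 1`
    have hu0 : 0 < Y / y := div_pos hY hy
    have hu1 : Y / y ≤ 1 := (div_le_one hy).2 hYy
    have h := fraction_le_exp_of_chernoff hy hz hY (contactB Y z)
      (fun N => ∑ q ∈ (stripPairs 1 N).filter (fun q => (bottomVisits₀ q.1 q.2 N : ℝ) ≤ contactB Y z * N),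
        wgt y z N q) (fun N => by
          have := sum_contacts_le_mul_rpow_le hy.le hz.le hu0 hu1 N (contactB Y z)
          rwa [mul_div_cancel₀ _ hy.ne'] at this) hε
    filter_upwards [h] with N hN
    have e : -contactRate y z Y + ε =
        -(contactB Y z * Real.log (Y / y) - Real.log (stripMuY₂ 1 Y z / stripMuY₂ 1 y z)) + ε := rfl
    rw [e]
    exact hN

/-! ## §6 Every level is reached: `b(·,z)` maps `(y,∞)` onto `(b(y,z), 1/2)` and `(0,y)` onto `(0, b(y,z))` -/

/-- `b(·,z)` is continuous on `(0,∞)`. [cite: BeatonBousquetMelouDeGierDuminilCopinGuttmann2014, §3.2 Proposition 6 (arXiv v5 p. 10)] -/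
theorem continuousOn_contactB_left (hz : 0 < z) : ContinuousOn (fun y' => contactB y' z) (Set.Ioi 0) :=
  fun _ hy' => (continuousAt_contactB_left hy' hz).continuousWithinAt

/-- ★ **Every excess level is a tilted mean**: for `b(y,z) < a < 1/2` there is `Y > y` with `b(Y,z) = a`
(intermediate value theorem between `b(y,z)` and the saturation limit `b(Y,z) → 1/2`, `tendsto_contactB_atTop`).
[cite: DemboZeitouni2010, §2.2 Lemma 2.2.5 (the exposed points of Λ*); BeatonBousquetMelouDeGierDuminilCopinGuttmann2014, §3.2 Proposition 6 (arXiv v5 p. 10)] -/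
theorem exists_gt_contactB_eq (hy : 0 < y) (hz : 0 < z) {a : ℝ} (ha₁ : contactB y z < a) (ha₂ : a < 1 / 2) :
    ∃ Y, y < Y ∧ contactB Y z = a := by
  obtain ⟨Y₁, hY₁a, hY₁y⟩ := (((tendsto_contactB_atTop hz).eventually (lt_mem_nhds ha₂)).and
    (Filter.eventually_gt_atTop y)).exists
  have hcont : ContinuousOn (fun y' => contactB y' z) (Set.Icc y Y₁) :=
    (continuousOn_contactB_left hz).mono fun t ht => hy.trans_le ht.1
  obtain ⟨Y, hY, hYa⟩ := intermediate_value_Ioo hY₁y.le hcont ⟨ha₁, hY₁a⟩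
  exact ⟨Y, hY.1, hYa⟩

/-- ★ **Every deficit level is a tilted mean**: for `0 < a < b(y,z)` there is `0 < Y < y` with `b(Y,z) = a`
(intermediate value theorem between the desorption limit `b(Y,z) → 0` as `Y → 0⁺`, `tendsto_contactB_nhdsGT_zero`, and `b(y,z)`).
[cite: DemboZeitouni2010, §2.2 Lemma 2.2.5; BeatonBousquetMelouDeGierDuminilCopinGuttmann2014, §3.2 Proposition 6 (arXiv v5 p. 10)] -/
theorem exists_lt_contactB_eq (hy : 0 < y) (hz : 0 < z) {a : ℝ} (ha₁ : 0 < a) (ha₂ : a < contactB y z) :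
    ∃ Y, 0 < Y ∧ Y < y ∧ contactB Y z = a := by
  obtain ⟨Y₀, hY₀a, hY₀⟩ := (((tendsto_contactB_nhdsGT_zero hz).eventually (gt_mem_nhds ha₁)).and
    (Ioo_mem_nhdsGT hy)).exists
  have hcont : ContinuousOn (fun y' => contactB y' z) (Set.Icc Y₀ y) :=
    (continuousOn_contactB_left hz).mono fun t ht => hY₀.1.trans_le ht.1
  obtain ⟨Y, hY, hYa⟩ := intermediate_value_Ioo hY₀.2.le hcont ⟨hY₀a, ha₂⟩
  exact ⟨Y, hY₀.1.trans hY.1, hY.2, hYa⟩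

open Classical in
/-- ★★★ **THE UPPER-TAIL LDP AT EVERY LEVEL**: for `b(y,z) < a < 1/2`,
`(1/N) log P_{N,y,z}(bc(ω) ≥ aN) → −I(y,z;Y_a)` where `Y_a > y` is the tilted fugacity with `b(Y_a,z) = a` — so the
rate is `I*(a) = a·log(Y_a/y) − log(μ_1(Y_a,z)/μ_1(y,z)) > 0`.
[cite: DemboZeitouni2010, §2.2 Theorem 2.2.3 (Cramér); JansevanRensburg2015, §3.2 Theorems 3.17–3.19] -/
theorem exists_tendsto_log_contacts_ge_div (hy : 0 < y) (hz : 0 < z) {a : ℝ} (ha₁ : contactB y z < a)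
    (ha₂ : a < 1 / 2) :
    ∃ Y, y < Y ∧ contactB Y z = a ∧ 0 < contactRate y z Y ∧
      Tendsto (fun N : ℕ => Real.log ((∑ q ∈ (stripPairs 1 N).filter
          (fun q => a * N ≤ (bottomVisits₀ q.1 q.2 N : ℝ)), wgt y z N q) / stripZ₂ 1 N y z) / N)
        atTop (𝓝 (-contactRate y z Y)) := by
  obtain ⟨Y, hyY, hYa⟩ := exists_gt_contactB_eq hy hz ha₁ ha₂
  refine ⟨Y, hyY, hYa, contactRate_pos hy hz (hy.trans hyY) hyY.ne', ?_⟩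
  rw [← hYa]
  exact tendsto_log_contacts_ge_div hy hz hyY.le

open Classical in
/-- ★★★ **THE LOWER-TAIL LDP AT EVERY LEVEL**: for `0 < a < b(y,z)`,
`(1/N) log P_{N,y,z}(bc(ω) ≤ aN) → −I(y,z;Y_a)` where `0 < Y_a < y` is the tilted fugacity with `b(Y_a,z) = a`.
[cite: DemboZeitouni2010, §2.2 Theorem 2.2.3 (Cramér); JansevanRensburg2015, §3.2 Theorems 3.17–3.19] -/
theorem exists_tendsto_log_contacts_le_div (hy : 0 < y) (hz : 0 < z) {a : ℝ} (ha₁ : 0 < a)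
    (ha₂ : a < contactB y z) :
    ∃ Y, 0 < Y ∧ Y < y ∧ contactB Y z = a ∧ 0 < contactRate y z Y ∧
      Tendsto (fun N : ℕ => Real.log ((∑ q ∈ (stripPairs 1 N).filter
          (fun q => (bottomVisits₀ q.1 q.2 N : ℝ) ≤ a * N), wgt y z N q) / stripZ₂ 1 N y z) / N)
        atTop (𝓝 (-contactRate y z Y)) := by
  obtain ⟨Y, hY, hYy, hYa⟩ := exists_lt_contactB_eq hy hz ha₁ ha₂
  refine ⟨Y, hY, hYy, hYa, contactRate_pos hy hz hY hYy.ne, ?_⟩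
  rw [← hYa]
  exact tendsto_log_contacts_le_div hy hz hY hYy.le

/-! ## §7 The contact entropy: exponential growth of the restricted partition functions and of the walk counts -/

open Classical in
/-- The restricted partition function is eventually positive (there ARE walks with `bc ≥ b(Y,z)N`: a by-product of the
change of measure to the fugacity `2Y`). [cite: DemboZeitouni2010, §2.2 (lane plumbing)] -/
theorem eventually_sum_contacts_ge_pos (hy : 0 < y) (hz : 0 < z) {Y : ℝ} (hY : 0 < Y) :
    ∀ᶠ N : ℕ in atTop, 0 < ∑ q ∈ (stripPairs 1 N).filter
        (fun q => contactB Y z * N ≤ (bottomVisits₀ q.1 q.2 N : ℝ)), wgt y z N q := by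
  have hY2 : Y < 2 * Y := by linarith
  have hb1 : contactB Y z < contactB (2 * Y) z := contactB_strictMono_left hY hz hY2
  have hb2 : contactB (2 * Y) z < 2 * contactB (2 * Y) z - contactB Y z := by linarith
  filter_upwards [exp_le_windowFraction hy hz (by linarith) hb1 hb2 zero_lt_one] with N hN
  have hpos := (Real.exp_pos _).trans_le hN
  have hZ := stripZ₂_pos 1 N hy hz
  have hW := (div_pos_iff_of_pos_right hZ).1 hpos
  refine hW.trans_le (Finset.sum_le_sum_of_subset_of_nonneg (fun q hq => ?_) fun q _ _ => wgt_nonneg hy.le hz.le N q)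
  rw [Finset.mem_filter] at hq ⊢
  exact ⟨hq.1, hq.2.1⟩

open Classical in
/-- The same for the lower tail (window around `b(Y/2,z)`). [cite: DemboZeitouni2010, §2.2 (lane plumbing)] -/
theorem eventually_sum_contacts_le_pos (hy : 0 < y) (hz : 0 < z) {Y : ℝ} (hY : 0 < Y) :
    ∀ᶠ N : ℕ in atTop, 0 < ∑ q ∈ (stripPairs 1 N).filter
        (fun q => (bottomVisits₀ q.1 q.2 N : ℝ) ≤ contactB Y z * N), wgt y z N q := by
  have hY2 : Y / 2 < Y := by linarith
  have hb2 : contactB (Y / 2) z < contactB Y z := contactB_strictMono_left (by linarith) hz hY2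
  have hb1 : 2 * contactB (Y / 2) z - contactB Y z < contactB (Y / 2) z := by linarith
  filter_upwards [exp_le_windowFraction hy hz (by linarith : 0 < Y / 2) hb1 hb2 zero_lt_one] with N hN
  have hpos := (Real.exp_pos _).trans_le hN
  have hZ := stripZ₂_pos 1 N hy hz
  have hW := (div_pos_iff_of_pos_right hZ).1 hpos
  refine hW.trans_le (Finset.sum_le_sum_of_subset_of_nonneg (fun q hq => ?_) fun q _ _ => wgt_nonneg hy.le hz.le N q)
  rw [Finset.mem_filter] at hq ⊢
  exact ⟨hq.1, hq.2.2⟩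

open Classical in
/-- ★★★ **THE RESTRICTED FREE ENERGY**: for `y, z > 0` and `Y ≥ y`,
`(1/N) log Σ_{ω : bc(ω) ≥ b(Y,z)N} y^{bc(ω)} z^{tc(ω)} → log μ_1(Y,z) − b(Y,z)·log(Y/y)` (`= log μ_1(y,z) − I(y,z;Y)`).
[cite: JansevanRensburg2015, §3.2 Theorem 3.17 (integrated density functions and the free energy); DemboZeitouni2010, §2.2 Theorem 2.2.3] -/
theorem tendsto_log_sum_contacts_ge_div (hy : 0 < y) (hz : 0 < z) {Y : ℝ} (hyY : y ≤ Y) :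
    Tendsto (fun N : ℕ => Real.log (∑ q ∈ (stripPairs 1 N).filter
        (fun q => contactB Y z * N ≤ (bottomVisits₀ q.1 q.2 N : ℝ)), wgt y z N q) / N)
      atTop (𝓝 (Real.log (stripMuY₂ 1 Y z) - contactB Y z * Real.log (Y / y))) := by
  have hY : 0 < Y := hy.trans_le hyY
  have hlim := (tendsto_log_contacts_ge_div hy hz hyY).add (tendsto_log_stripZ₂_one_div hy hz)
  have e : -contactRate y z Y + Real.log (stripMuY₂ 1 y z) =
      Real.log (stripMuY₂ 1 Y z) - contactB Y z * Real.log (Y / y) := by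
    rw [contactRate, Real.log_div (stripMuY₂_pos 1 hY hz).ne' (stripMuY₂_pos 1 hy hz).ne']; ring
  rw [e] at hlim
  refine hlim.congr' ?_
  filter_upwards [eventually_sum_contacts_ge_pos hy hz hY] with N hN
  have hZ := stripZ₂_pos 1 N hy hz
  rw [← add_div, Real.log_div hN.ne' hZ.ne']; ring

open Classical in
/-- ★★★ **THE RESTRICTED FREE ENERGY, lower tail**: for `y, z > 0` and `0 < Y ≤ y`,
`(1/N) log Σ_{ω : bc(ω) ≤ b(Y,z)N} y^{bc(ω)} z^{tc(ω)} → log μ_1(Y,z) − b(Y,z)·log(Y/y)`.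
[cite: JansevanRensburg2015, §3.2 Theorem 3.17; DemboZeitouni2010, §2.2 Theorem 2.2.3] -/
theorem tendsto_log_sum_contacts_le_div (hy : 0 < y) (hz : 0 < z) {Y : ℝ} (hY : 0 < Y) (hYy : Y ≤ y) :
    Tendsto (fun N : ℕ => Real.log (∑ q ∈ (stripPairs 1 N).filter
        (fun q => (bottomVisits₀ q.1 q.2 N : ℝ) ≤ contactB Y z * N), wgt y z N q) / N)
      atTop (𝓝 (Real.log (stripMuY₂ 1 Y z) - contactB Y z * Real.log (Y / y))) := by
  have hlim := (tendsto_log_contacts_le_div hy hz hY hYy).add (tendsto_log_stripZ₂_one_div hy hz)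
  have e : -contactRate y z Y + Real.log (stripMuY₂ 1 y z) =
      Real.log (stripMuY₂ 1 Y z) - contactB Y z * Real.log (Y / y) := by
    rw [contactRate, Real.log_div (stripMuY₂_pos 1 hY hz).ne' (stripMuY₂_pos 1 hy hz).ne']; ring
  rw [e] at hlim
  refine hlim.congr' ?_
  filter_upwards [eventually_sum_contacts_le_pos hy hz hY] with N hN
  have hZ := stripZ₂_pos 1 N hy hz
  rw [← add_div, Real.log_div hN.ne' hZ.ne']; ring

open Classical in
/-- The unweighted case: at `y = z = 1` every walk has weight `1`, so the restricted partition function is a COUNT.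
[cite: BeatonBousquetMelouDeGierDuminilCopinGuttmann2014, §3.2 (arXiv v5 p. 10: C_{T,k}(1,1) counts the walks)] -/
theorem sum_wgt_one_one_eq_card (N : ℕ) (P : Site 2 × (ℕ → Site 2) → Prop) :
    ∑ q ∈ (stripPairs 1 N).filter P, wgt 1 1 N q = (((stripPairs 1 N).filter P).card : ℝ) := by
  simp [wgt]

open Classical in
/-- ★★★ **THE CONTACT ENTROPY OF SELF-AVOIDING WALKS IN THE ONE-CELL STRIP — excess side.**  For every `Y ≥ 1`,
the number of `N`-step self-avoiding walks of `S_1` (up to the translations of the strip: the tree's `stripPairs 1 N`) with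
AT LEAST `b(Y,1)·N` contacts with the bottom wall grows like `exp(N·σ(Y))`, `σ(Y) = log μ_1(Y,1) − b(Y,1) log Y`:
`(1/N) log #{ω : bc(ω) ≥ b(Y,1)N} → log μ_1(Y,1) − b(Y,1)·log Y`.  The level `b(Y,1)` runs through `[b(1,1), 1/2)`,
`b(1,1) = v/4 ≈ 0.2057`; `σ` is the Legendre transform of the adsorption free energy `log μ_1(·,1)` (JvR's density function).
[cite: JansevanRensburg2015, §3.2 Theorems 3.17–3.19 (the density function is the Legendre transform of the free energy); HammersleyTorrieWhittington1982, §3 (free energy of adsorbing self-avoiding walks)]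
[cite: BeatonBousquetMelouDeGierDuminilCopinGuttmann2014, §3.2 Proposition 6 (arXiv v5 p. 10)] -/
theorem tendsto_log_card_contacts_ge_div {Y : ℝ} (hY : 1 ≤ Y) :
    Tendsto (fun N : ℕ => Real.log ((stripPairs 1 N).filter
        (fun q => contactB Y 1 * N ≤ (bottomVisits₀ q.1 q.2 N : ℝ))).card / N)
      atTop (𝓝 (Real.log (stripMuY₂ 1 Y 1) - contactB Y 1 * Real.log Y)) := by
  have h := tendsto_log_sum_contacts_ge_div one_pos one_pos hY
  simp only [div_one, sum_wgt_one_one_eq_card] at h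
  exact h

open Classical in
/-- ★★★ **THE CONTACT ENTROPY — deficit side.**  For every `0 < Y ≤ 1`,
`(1/N) log #{ω ∈ S_N(S_1) : bc(ω) ≤ b(Y,1)N} → log μ_1(Y,1) − b(Y,1)·log Y` (levels `b(Y,1) ∈ (0, b(1,1)]`).
[cite: JansevanRensburg2015, §3.2 Theorems 3.17–3.19; HammersleyTorrieWhittington1982, §3]
[cite: BeatonBousquetMelouDeGierDuminilCopinGuttmann2014, §3.2 Proposition 6 (arXiv v5 p. 10)] -/
theorem tendsto_log_card_contacts_le_div {Y : ℝ} (hY : 0 < Y) (hY1 : Y ≤ 1) :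
    Tendsto (fun N : ℕ => Real.log ((stripPairs 1 N).filter
        (fun q => (bottomVisits₀ q.1 q.2 N : ℝ) ≤ contactB Y 1 * N)).card / N)
      atTop (𝓝 (Real.log (stripMuY₂ 1 Y 1) - contactB Y 1 * Real.log Y)) := by
  have h := tendsto_log_sum_contacts_le_div one_pos one_pos hY hY1
  simp only [div_one, sum_wgt_one_one_eq_card] at h
  exact h

/-- ★★ **The entropy is below the connective constant, with equality only at the typical density**:
`log μ_1(Y,1) − b(Y,1) log Y < log μ(S_1)` for `Y ≠ 1` (`μ(S_1) = μ_1(1,1)`, the plastic number) — exponentially few walks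
have an atypical contact density. [cite: JansevanRensburg2015, §3.2 Theorem 3.17 and eq. (3.15); MadrasSlade1993, §8.2] -/
theorem contactEntropy_lt (hz : 0 < z) {y Y : ℝ} (hy : 0 < y) (hY : 0 < Y) (hne : Y ≠ y) :
    Real.log (stripMuY₂ 1 Y z) - contactB Y z * Real.log (Y / y) < Real.log (stripMuY₂ 1 y z) := by
  have h := contactRate_pos hy hz hY hne
  rw [contactRate, Real.log_div (stripMuY₂_pos 1 hY hz).ne' (stripMuY₂_pos 1 hy hz).ne'] at h
  linarith

/-! ## §8 The two extreme rates: total adsorption costs `½log(s/y)`, total desorption costs `½log(s/z)` (`s = μ_1(y,z)²`) -/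

/-- `I(y,z;Y) = [log μ_1(y,z) − ½log y] + (b(Y,z) − ½)(log Y − log y) − ½ log(s(Y)/Y)`, `s(Y) = μ_1(Y,z)²`.
[cite: DemboZeitouni2010, §2.2 (lane plumbing)] -/
theorem contactRate_eq_top_form (hy : 0 < y) (hz : 0 < z) {Y : ℝ} (hY : 0 < Y) :
    contactRate y z Y = (Real.log (stripMuY₂ 1 y z) - Real.log y / 2) +
      ((contactB Y z - 1 / 2) * (Real.log Y - Real.log y) - Real.log (stripMuY₂ 1 Y z ^ 2 / Y) / 2) := by
  have hμ := stripMuY₂_pos 1 hY hz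
  rw [contactRate_eq hy hz hY, Real.log_div (pow_pos hμ 2).ne' hY.ne', Real.log_pow]; push_cast; ring_nf

/-- `I(y,z;Y) = [log μ_1(y,z) − ½log z] + b(Y,z)(log Y − log y) − ½ (log s(Y) − log z)`.
[cite: DemboZeitouni2010, §2.2 (lane plumbing)] -/
theorem contactRate_eq_zero_form (hy : 0 < y) (hz : 0 < z) {Y : ℝ} (hY : 0 < Y) :
    contactRate y z Y = (Real.log (stripMuY₂ 1 y z) - Real.log z / 2) +
      (contactB Y z * (Real.log Y - Real.log y) - (Real.log (stripMuY₂ 1 Y z ^ 2) - Real.log z) / 2) := by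
  have hμ := stripMuY₂_pos 1 hY hz
  rw [contactRate_eq hy hz hY, Real.log_pow]; push_cast; ring

/-- ★★★ **THE COST OF TOTAL ADSORPTION**: `I(y,z;Y) → log μ_1(y,z) − ½ log y = ½ log(s/y)` as `Y → ∞` — the rate at which
`P_{N,y,z}(bc(ω) ≥ (½ − o(1))N)` decays is `(√y/μ_1(y,z))^N`: a walk glued to the bottom wall has weight `≈ y^{N/2}` and there
are sub-exponentially many of them. [cite: DemboZeitouni2010, §2.2 Theorem 2.2.3; JansevanRensburg2015, §3.2 eq. (3.15) (the entropy at the maximal density)] -/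
theorem tendsto_contactRate_atTop (hy : 0 < y) (hz : 0 < z) :
    Tendsto (contactRate y z) atTop (𝓝 (Real.log (stripMuY₂ 1 y z) - Real.log y / 2)) := by
  -- the two error terms
  have hE₁ : Tendsto (fun Y => (contactB Y z - 1 / 2) * (Real.log Y - Real.log y)) atTop (𝓝 0) := by
    have hg : Tendsto (fun Y : ℝ => 4 * z * Y⁻¹ + 4 * z * |Real.log y| * (Y ^ 2)⁻¹) atTop (𝓝 0) := by
      have h1 := tendsto_inv_atTop_zero.const_mul (4 * z)
      have h2 := (tendsto_inv_atTop_zero.comp (tendsto_pow_atTop two_ne_zero)).const_mul (4 * z * |Real.log y|)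
      simpa using h1.add h2
    refine squeeze_zero_norm' ?_ hg
    filter_upwards [Filter.eventually_ge_atTop (2 * z), Filter.eventually_ge_atTop (1 : ℝ)] with Y hYz hY1
    have hY : 0 < Y := by linarith
    have hzY : z < Y := by linarith
    have hb := abs_contactB_sub_half_le hY hz hzY
    have hlogY : |Real.log Y| ≤ Y := by
      rw [abs_of_nonneg (Real.log_nonneg hY1)]; linarith [Real.log_le_sub_one_of_pos hY]
    have hsq : Y ^ 2 / 4 ≤ (Y - z) ^ 2 := by nlinarith
    have hYz2 : 0 < (Y - z) ^ 2 := by positivity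
    rw [Real.norm_eq_abs, abs_mul]
    calc |contactB Y z - 1 / 2| * |Real.log Y - Real.log y|
        ≤ z / (Y - z) ^ 2 * (|Real.log Y| + |Real.log y|) :=
          mul_le_mul hb (abs_sub _ _) (abs_nonneg _) (by positivity)
      _ ≤ z / (Y ^ 2 / 4) * (Y + |Real.log y|) := by
          gcongr
      _ = 4 * z * Y⁻¹ + 4 * z * |Real.log y| * (Y ^ 2)⁻¹ := by field_simp
  have hE₂ : Tendsto (fun Y => Real.log (stripMuY₂ 1 Y z ^ 2 / Y)) atTop (𝓝 0) := by
    have hratio : Tendsto (fun Y => stripMuY₂ 1 Y z ^ 2 / Y) atTop (𝓝 1) := by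
      have hg : Tendsto (fun Y : ℝ => 2 * z * (Y ^ 2)⁻¹) atTop (𝓝 0) := by
        simpa using (tendsto_inv_atTop_zero.comp (tendsto_pow_atTop two_ne_zero)).const_mul (2 * z)
      have h0 : Tendsto (fun _ : ℝ => (1 : ℝ)) atTop (𝓝 1) := tendsto_const_nhds
      have h1 : Tendsto (fun Y : ℝ => 1 + 2 * z * (Y ^ 2)⁻¹) atTop (𝓝 1) := by simpa using h0.add hg
      refine tendsto_of_tendsto_of_tendsto_of_le_of_le' h0 h1 ?_ ?_
      · filter_upwards [Filter.eventually_gt_atTop (0 : ℝ)] with Y hY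
        exact (one_le_div hY).2 (contactB_facts hY hz).1.le
      · filter_upwards [Filter.eventually_ge_atTop (2 * z)] with Y hYz
        have hY : 0 < Y := by linarith
        have hzY : z < Y := by linarith
        have hs := (stripMuY₂_one_sq_sub_le hY hz).1 hzY
        rw [div_le_iff₀ hY]
        have hYz0 : 0 < Y - z := by linarith
        have h2 : z / (Y - z) ≤ 2 * z / Y := by
          rw [div_le_div_iff₀ hYz0 hY]; nlinarith
        have h3 : (1 + 2 * z * (Y ^ 2)⁻¹) * Y = Y + 2 * z / Y := by field_simp
        rw [h3]; linarith
    have := (Real.continuousAt_log one_ne_zero).tendsto.comp hratio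
    rw [Real.log_one] at this
    exact this
  have hsum := hE₁.sub (hE₂.div_const 2)
  simp only [zero_div, sub_zero] at hsum
  have := hsum.const_add (Real.log (stripMuY₂ 1 y z) - Real.log y / 2)
  rw [add_zero] at this
  refine this.congr' ?_
  filter_upwards [Filter.eventually_gt_atTop (0 : ℝ)] with Y hY
  exact (contactRate_eq_top_form hy hz hY).symm

/-- ★★★ **THE COST OF TOTAL DESORPTION**: `I(y,z;Y) → log μ_1(y,z) − ½ log z = ½ log(s/z)` as `Y → 0⁺` — the rate at which
`P_{N,y,z}(bc(ω) ≤ o(1)·N)` decays is `(√z/μ_1(y,z))^N` (the walks that avoid the bottom wall grow like `z^{N/2}`).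
[cite: DemboZeitouni2010, §2.2 Theorem 2.2.3; JansevanRensburg2015, §3.2 eq. (3.15)] -/
theorem tendsto_contactRate_nhdsGT_zero (hy : 0 < y) (hz : 0 < z) :
    Tendsto (contactRate y z) (𝓝[>] 0) (𝓝 (Real.log (stripMuY₂ 1 y z) - Real.log z / 2)) := by
  have hE₃ : Tendsto (fun Y => contactB Y z * (Real.log Y - Real.log y)) (𝓝[>] 0) (𝓝 0) := by
    -- `|b(Y)(log Y − log y)| ≤ (2/z²)(|Y log Y| + Y |log y|)`
    have hYlog : Tendsto (fun Y : ℝ => Real.log Y * Y) (𝓝[>] 0) (𝓝 0) := by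
      simpa [Real.rpow_one] using tendsto_log_mul_rpow_nhdsGT_zero zero_lt_one
    have hY0 : Tendsto (fun Y : ℝ => Y) (𝓝[>] 0) (𝓝 0) := tendsto_nhdsWithin_of_tendsto_nhds tendsto_id
    have hg : Tendsto (fun Y : ℝ => 2 / z ^ 2 * (|Real.log Y * Y| + Y * |Real.log y|)) (𝓝[>] 0) (𝓝 0) := by
      have := (hYlog.abs.add (hY0.mul_const |Real.log y|)).const_mul (2 / z ^ 2)
      simpa using this
    refine squeeze_zero_norm' ?_ hg
    filter_upwards [Ioo_mem_nhdsGT (show (0 : ℝ) < z / 2 by linarith)] with Y hY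
    have hY0 : 0 < Y := hY.1
    have h2Y : 2 * Y ≤ z := by linarith [hY.2]
    have hb0 : 0 ≤ contactB Y z := (contactB_facts hY0 hz).2.2.2.2.1.le
    have hb := contactB_le_of_small hY0 hz h2Y
    rw [Real.norm_eq_abs, abs_mul, abs_of_nonneg hb0]
    calc contactB Y z * |Real.log Y - Real.log y| ≤ 2 * Y / z ^ 2 * (|Real.log Y| + |Real.log y|) :=
          mul_le_mul hb (abs_sub _ _) (abs_nonneg _) (by positivity)
      _ = 2 / z ^ 2 * (|Real.log Y * Y| + Y * |Real.log y|) := by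
          rw [abs_mul, abs_of_pos hY0]; ring
  have hE₄ : Tendsto (fun Y => Real.log (stripMuY₂ 1 Y z ^ 2) - Real.log z) (𝓝[>] 0) (𝓝 0) := by
    have hs : Tendsto (fun Y => stripMuY₂ 1 Y z ^ 2) (𝓝[>] 0) (𝓝 z) := by
      have h0 : Tendsto (fun _ : ℝ => z) (𝓝[>] (0 : ℝ)) (𝓝 z) := tendsto_const_nhds
      have h1 : Tendsto (fun Y : ℝ => z + 2 * Y / z) (𝓝[>] 0) (𝓝 z) := by
        have hY0 : Tendsto (fun Y : ℝ => Y) (𝓝[>] 0) (𝓝 0) := tendsto_nhdsWithin_of_tendsto_nhds tendsto_id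
        have := ((hY0.const_mul 2).div_const z).const_add z
        simpa using this
      refine tendsto_of_tendsto_of_tendsto_of_le_of_le' h0 h1 ?_ ?_
      · filter_upwards [self_mem_nhdsWithin] with Y hY
        exact (contactB_facts (show (0:ℝ) < Y from hY) hz).2.1.le
      · filter_upwards [Ioo_mem_nhdsGT (show (0 : ℝ) < z / 2 by linarith)] with Y hY
        have h := (stripMuY₂_one_sq_sub_le hY.1 hz).2 (by linarith [hY.2])
        linarith
    have := ((Real.continuousAt_log hz.ne').tendsto.comp hs).sub_const (Real.log z)
    simpa using this
  have hsum := hE₃.sub (hE₄.div_const 2)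
  simp only [zero_div, sub_zero] at hsum
  have := hsum.const_add (Real.log (stripMuY₂ 1 y z) - Real.log z / 2)
  rw [add_zero] at this
  refine this.congr' ?_
  filter_upwards [self_mem_nhdsWithin] with Y hY
  exact (contactRate_eq_zero_form hy hz hY).symm

/-- Both extreme rates are positive (`y, z < s`): even the cheapest extreme event is exponentially rare.
[cite: BeatonBousquetMelouDeGierDuminilCopinGuttmann2014, §3.2 Proposition 6 (arXiv v5 p. 10)] -/
theorem extremeRates_pos (hy : 0 < y) (hz : 0 < z) :
    0 < Real.log (stripMuY₂ 1 y z) - Real.log y / 2 ∧ 0 < Real.log (stripMuY₂ 1 y z) - Real.log z / 2 := by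
  have hμ := stripMuY₂_pos 1 hy hz
  obtain ⟨hys, hzs, -⟩ := contactB_facts hy hz
  have e : Real.log (stripMuY₂ 1 y z) = Real.log (stripMuY₂ 1 y z ^ 2) / 2 := by rw [Real.log_pow]; push_cast; ring
  rw [e]
  constructor
  · have := Real.log_lt_log hy hys; linarith
  · have := Real.log_lt_log hz hzs; linarith

/-! ## §9 (ed.2) The level ↦ tilted-fugacity inverse `Y_a`: `b(Y_a, z) = a` -/

/-- Every level `a ∈ (0, 1/2)` is the contact density at exactly one fugacity: existence (via §6 around `y = 1`).
[cite: DemboZeitouni2010, §2.2 Lemma 2.2.5 (lane plumbing); BeatonBousquetMelouDeGierDuminilCopinGuttmann2014, §3.2 Proposition 6 (arXiv v5 p. 10)] -/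
theorem exists_pos_contactB_eq (hz : 0 < z) {a : ℝ} (ha₀ : 0 < a) (ha : a < 1 / 2) : ∃ Y, 0 < Y ∧ contactB Y z = a := by
  rcases lt_trichotomy a (contactB 1 z) with h | h | h
  · obtain ⟨Y, hY, -, hYa⟩ := exists_lt_contactB_eq one_pos hz ha₀ h
    exact ⟨Y, hY, hYa⟩
  · exact ⟨1, one_pos, h.symm⟩
  · obtain ⟨Y, hY, hYa⟩ := exists_gt_contactB_eq one_pos hz h ha
    exact ⟨Y, one_pos.trans hY, hYa⟩

open Classical in
/-- ★ **The tilted fugacity of a level**: `levelY z a` = the unique `Y > 0` with `b(Y,z) = a` when `a ∈ (0,1/2)` (else `1`).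
[cite: DemboZeitouni2010, §2.2 Theorem 2.2.3 (the exposed point / optimal tilt of Cramér's theorem); JansevanRensburg2015, §3.2 Theorem 3.19 (the minimising activity z₁)] -/
def levelY (z a : ℝ) : ℝ := if h : ∃ Y, 0 < Y ∧ contactB Y z = a then Classical.choose h else 1

open Classical in
/-- `levelY z a > 0` and `b(levelY z a, z) = a` for `a ∈ (0,1/2)`. [cite: DemboZeitouni2010, §2.2 (lane plumbing)] -/
theorem levelY_spec (hz : 0 < z) {a : ℝ} (ha₀ : 0 < a) (ha : a < 1 / 2) :
    0 < levelY z a ∧ contactB (levelY z a) z = a := by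
  have h := exists_pos_contactB_eq hz ha₀ ha
  unfold levelY; rw [dif_pos h]; exact Classical.choose_spec h

open Classical in
/-- `levelY z a > 0` always. [cite: DemboZeitouni2010, §2.2 (lane plumbing)] -/
theorem levelY_pos (z a : ℝ) : 0 < levelY z a := by
  unfold levelY
  split_ifs with h
  · exact (Classical.choose_spec h).1
  · exact one_pos

/-- `levelY` inverts `b(·,z)`: `levelY z (b(Y,z)) = Y` for every `Y > 0` (injectivity of `b(·,z)`, `contactB_strictMono_left`).
[cite: DemboZeitouni2010, §2.2 (lane plumbing)] -/
theorem levelY_contactB (hz : 0 < z) {Y : ℝ} (hY : 0 < Y) : levelY z (contactB Y z) = Y := by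
  obtain ⟨-, -, -, -, hb0, hb⟩ := contactB_facts hY hz
  obtain ⟨hpos, heq⟩ := levelY_spec hz hb0 hb
  rcases lt_trichotomy (levelY z (contactB Y z)) Y with h | h | h
  · have := contactB_strictMono_left hpos hz h; rw [heq] at this; exact absurd this (lt_irrefl _)
  · exact h
  · have := contactB_strictMono_left hY hz h; rw [heq] at this; exact absurd this (lt_irrefl _)

/-- `levelY z` is strictly increasing on `(0, 1/2)`. [cite: DemboZeitouni2010, §2.2 (lane plumbing)] -/
theorem strictMonoOn_levelY (hz : 0 < z) : StrictMonoOn (levelY z) (Set.Ioo 0 (1 / 2)) := by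
  intro a ha a' ha' haa'
  obtain ⟨hp, he⟩ := levelY_spec hz ha.1 ha.2
  obtain ⟨hp', he'⟩ := levelY_spec hz ha'.1 ha'.2
  by_contra hle
  have hle : levelY z a' ≤ levelY z a := not_lt.1 hle
  have := contactB_mono_left hp' hz hle
  rw [he, he'] at this
  linarith

/-- Comparison through `b`: for `a ∈ (0,1/2)` and `y > 0`, `y < levelY z a ↔ b(y,z) < a` and `levelY z a < y ↔ a < b(y,z)`.
[cite: DemboZeitouni2010, §2.2 (lane plumbing)] -/
theorem lt_levelY_iff (hz : 0 < z) {a : ℝ} (ha₀ : 0 < a) (ha : a < 1 / 2) {y : ℝ} (hy : 0 < y) :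
    (y < levelY z a ↔ contactB y z < a) ∧ (levelY z a < y ↔ a < contactB y z) := by
  obtain ⟨hp, he⟩ := levelY_spec hz ha₀ ha
  constructor
  · constructor
    · intro h; rw [← he]; exact contactB_strictMono_left hy hz h
    · intro h; by_contra hle; have := contactB_mono_left hp hz (not_lt.1 hle); rw [he] at this; linarith
  · constructor
    · intro h; rw [← he]; exact contactB_strictMono_left hp hz h
    · intro h; by_contra hle; have := contactB_mono_left hy hz (not_lt.1 hle); rw [he] at this; linarith

/-- `levelY z` is continuous on `(0, 1/2)` (a strictly monotone map of an interval ONTO `(0,∞)`).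
[cite: DemboZeitouni2010, §2.2 (lane plumbing)] -/
theorem continuousOn_levelY (hz : 0 < z) : ContinuousOn (levelY z) (Set.Ioo 0 (1 / 2)) := by
  intro a ha
  refine (continuousAt_of_monotoneOn_of_image_mem_nhds (strictMonoOn_levelY hz).monotoneOn
    (isOpen_Ioo.mem_nhds ha) ?_).continuousWithinAt
  -- the image contains every positive real, a neighbourhood of `levelY z a > 0`
  have hp := (levelY_spec hz ha.1 ha.2).1
  refine Filter.mem_of_superset (isOpen_Ioi.mem_nhds hp) fun Y hY => ?_
  have hY : 0 < Y := hY
  obtain ⟨-, -, -, -, hb0, hb⟩ := contactB_facts hY hz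
  exact ⟨contactB Y z, ⟨hb0, hb⟩, levelY_contactB hz hY⟩

/-- `levelY z a → ∞` as `a → 1/2⁻`. [cite: DemboZeitouni2010, §2.2 (lane plumbing)] -/
theorem tendsto_levelY_atTop (hz : 0 < z) : Tendsto (levelY z) (𝓝[<] (1 / 2)) atTop := by
  refine tendsto_atTop.2 fun M => ?_
  set M' := max M 1 with hM'
  have hM'0 : 0 < M' := lt_of_lt_of_le one_pos (le_max_right _ _)
  obtain ⟨-, -, -, -, hb0, hb⟩ := contactB_facts hM'0 hz
  filter_upwards [Ioo_mem_nhdsLT hb] with a ha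
  have ha2 : a < 1 / 2 := ha.2
  have h := ((lt_levelY_iff hz (hb0.trans ha.1) ha2 hM'0).1).2 ha.1
  exact (le_max_left M 1).trans h.le

/-- `levelY z a → 0⁺` as `a → 0⁺`. [cite: DemboZeitouni2010, §2.2 (lane plumbing)] -/
theorem tendsto_levelY_nhdsGT_zero (hz : 0 < z) : Tendsto (levelY z) (𝓝[>] 0) (𝓝[>] 0) := by
  refine tendsto_nhdsWithin_iff.2 ⟨tendsto_order.2 ⟨fun l hl => Eventually.of_forall fun a =>
    hl.trans (levelY_pos z a), fun u hu => ?_⟩, Eventually.of_forall fun a => levelY_pos z a⟩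
  obtain ⟨-, -, -, -, hb0, hb⟩ := contactB_facts hu hz
  filter_upwards [Ioo_mem_nhdsGT hb0] with a ha
  exact ((lt_levelY_iff hz ha.1 (ha.2.trans hb) hu).2).2 ha.2

/-! ## §10 (ed.2) The rate as a function of the LEVEL: `I*(a) = I(y,z; Y_a)` — convex, continuous, vanishing only at `b(y,z)` -/

/-- ★ **Cramér's rate function of the adsorbed fraction at level `a`**: `levelRate y z a = I(y,z; levelY z a)`
(`= a log(Y_a/y) − log(μ_1(Y_a,z)/μ_1(y,z))`, `b(Y_a,z) = a`). [cite: DemboZeitouni2010, §2.2 Theorem 2.2.3 (Λ*); JansevanRensburg2015, §3.2 Theorem 3.19] -/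
def levelRate (y z a : ℝ) : ℝ := contactRate y z (levelY z a)

/-- `I*(b(y,z)) = 0`. [cite: DemboZeitouni2010, §2.2 Lemma 2.2.5 (Λ*(mean) = 0)] -/
theorem levelRate_contactB (hy : 0 < y) (hz : 0 < z) : levelRate y z (contactB y z) = 0 := by
  rw [levelRate, levelY_contactB hz hy, contactRate_self hy hz]

/-- ★★ `I*(a) > 0` for `a ∈ (0,1/2)`, `a ≠ b(y,z)`. [cite: DemboZeitouni2010, §2.2 Theorem 2.2.3; JansevanRensburg2015, §3.2 Theorem 3.19] -/
theorem levelRate_pos (hy : 0 < y) (hz : 0 < z) {a : ℝ} (ha₀ : 0 < a) (ha : a < 1 / 2) (hne : a ≠ contactB y z) :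
    0 < levelRate y z a := by
  obtain ⟨hp, he⟩ := levelY_spec hz ha₀ ha
  refine contactRate_pos hy hz hp fun h => hne ?_
  rw [← he, h]

/-- ★★ **The Legendre transform, in the level variable**: for `a ∈ (0,1/2)` and every `u > 0`,
`a·log u − [log μ_1(yu,z) − log μ_1(y,z)] ≤ I*(a)`, with equality at `u = Y_a/y`.
[cite: DemboZeitouni2010, §2.2 Theorem 2.2.3 (Λ*(a) = sup_λ {λa − Λ(λ)})] -/
theorem isGreatest_levelRate (hy : 0 < y) (hz : 0 < z) {a : ℝ} (ha₀ : 0 < a) (ha : a < 1 / 2) :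
    IsGreatest ((fun u : ℝ => a * Real.log u - Real.log (stripMuY₂ 1 (y * u) z / stripMuY₂ 1 y z)) '' Set.Ioi (0 : ℝ))
      (levelRate y z a) := by
  obtain ⟨hp, he⟩ := levelY_spec hz ha₀ ha
  have h := isGreatest_contactRate hy hz hp
  rw [he] at h
  exact h

/-- ★★★ **`I*` IS STRICTLY CONVEX on `(0, 1/2)`** (a supremum of affine functions of `a`, with distinct maximisers at distinct
levels). [cite: DemboZeitouni2010, §2.2 Lemma 2.2.5 (Λ* convex); JansevanRensburg2015, §3.2 Theorem 3.17 (concavity of the density function)] -/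
theorem strictConvexOn_levelRate (hy : 0 < y) (hz : 0 < z) : StrictConvexOn ℝ (Set.Ioo 0 (1 / 2)) (levelRate y z) := by
  refine ⟨convex_Ioo _ _, fun a ha a' ha' hne lam mu hlam hmu hsum => ?_⟩
  set c := lam • a + mu • a' with hc
  have hc' : c = lam * a + mu * a' := by simp [hc, smul_eq_mul]
  have hcmem : c ∈ Set.Ioo (0 : ℝ) (1 / 2) := by
    rw [hc']; constructor <;> nlinarith [ha.1, ha.2, ha'.1, ha'.2]
  obtain ⟨hp, he⟩ := levelY_spec hz hcmem.1 hcmem.2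
  set Yc := levelY z c with hYc
  -- the rate at `c` is the affine function evaluated at the tilt `u = Yc/y`
  have hval : levelRate y z c = c * Real.log (Yc / y) - Real.log (stripMuY₂ 1 Yc z / stripMuY₂ 1 y z) := by
    rw [levelRate, ← hYc, contactRate, he]
  -- at the levels `a`, `a'` the same tilt is STRICTLY sub-optimal (the maximiser there is `Y_a ≠ Yc`)
  have hu : 0 < Yc / y := div_pos hp hy
  have key : ∀ {a₁ : ℝ}, a₁ ∈ Set.Ioo (0 : ℝ) (1 / 2) → a₁ ≠ c →
      a₁ * Real.log (Yc / y) - Real.log (stripMuY₂ 1 Yc z / stripMuY₂ 1 y z) < levelRate y z a₁ := by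
    intro a₁ ha₁ hne₁
    obtain ⟨hp₁, he₁⟩ := levelY_spec hz ha₁.1 ha₁.2
    have hneY : Yc ≠ levelY z a₁ := by
      intro hYY; apply hne₁; rw [← he₁, ← hYY, he]
    rw [levelRate, contactRate_eq hy hz hp₁, he₁, Real.log_div (stripMuY₂_pos 1 hp hz).ne' (stripMuY₂_pos 1 hy hz).ne',
      Real.log_div hp.ne' hy.ne']
    have ht := mul_log_sub_lt_log_stripMuY₂_sub hz hp hp₁ hneY   -- strict tangent at `Y_{a₁}`, evaluated at `Yc`
    rw [he₁] at ht
    linarith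
  have hane : a ≠ c := by
    intro h
    have : mu * (a' - a) = 0 := by rw [hc'] at h; linear_combination (-1 : ℝ) * h - a * hsum
    rcases mul_eq_zero.1 this with h1 | h1
    · linarith
    · exact hne (by linarith)
  have hane' : a' ≠ c := by
    intro h
    have : lam * (a - a') = 0 := by rw [hc'] at h; linear_combination (-1 : ℝ) * h - a' * hsum
    rcases mul_eq_zero.1 this with h1 | h1
    · linarith
    · exact hne (by linarith)
  have k1 := mul_lt_mul_of_pos_left (key ha hane) hlam
  have k2 := mul_lt_mul_of_pos_left (key ha' hane') hmu
  set L := Real.log (stripMuY₂ 1 Yc z / stripMuY₂ 1 y z) with hL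
  set ℓ := Real.log (Yc / y) with hℓ
  have hLL : lam * L + mu * L = L := by rw [← add_mul, hsum, one_mul]
  show levelRate y z c < lam • levelRate y z a + mu • levelRate y z a'
  simp only [smul_eq_mul]
  rw [hval, hc']
  nlinarith [k1, k2, hLL]

/-- `I*` is convex on `(0,1/2)`. [cite: DemboZeitouni2010, §2.2 Lemma 2.2.5] -/
theorem convexOn_levelRate (hy : 0 < y) (hz : 0 < z) : ConvexOn ℝ (Set.Ioo 0 (1 / 2)) (levelRate y z) :=
  (strictConvexOn_levelRate hy hz).convexOn

/-- `I*` is continuous on `(0,1/2)`. [cite: DemboZeitouni2010, §2.2 Lemma 2.2.5] -/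
theorem continuousOn_levelRate (hy : 0 < y) (hz : 0 < z) : ContinuousOn (levelRate y z) (Set.Ioo 0 (1 / 2)) := by
  intro a ha
  have hp := (levelY_spec hz ha.1 ha.2).1
  have hL := continuousOn_levelY hz a ha
  have hI : ContinuousAt (contactRate y z) (levelY z a) := by
    unfold contactRate
    have hlog : ContinuousAt (fun Y' : ℝ => Real.log (Y' / y)) (levelY z a) :=
      (continuousAt_id.div_const y).log (div_pos hp hy).ne'
    have hμ : ContinuousAt (fun Y' => Real.log (stripMuY₂ 1 Y' z / stripMuY₂ 1 y z)) (levelY z a) :=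
      ((continuousAt_stripMuY₂_one_left hp hz).div_const _).log
        (div_pos (stripMuY₂_pos 1 hp hz) (stripMuY₂_pos 1 hy hz)).ne'
    exact ((continuousAt_contactB_left hp hz).mul hlog).sub hμ
  exact hI.comp_continuousWithinAt hL

/-- ★★ `I*` is strictly decreasing on `(0, b(y,z)]` and strictly increasing on `[b(y,z), 1/2)`.
[cite: DemboZeitouni2010, §2.2 Lemma 2.2.5 (Λ* nonincreasing below and nondecreasing above the mean)] -/
theorem strictAntiOn_strictMonoOn_levelRate (hy : 0 < y) (hz : 0 < z) :
    StrictAntiOn (levelRate y z) (Set.Ioc 0 (contactB y z)) ∧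
      StrictMonoOn (levelRate y z) (Set.Ico (contactB y z) (1 / 2)) := by
  obtain ⟨-, -, -, -, hb0, hb⟩ := contactB_facts hy hz
  constructor
  · intro a ha a' ha' haa'
    have ha2 : a < 1 / 2 := lt_of_le_of_lt ha.2 hb
    have ha'2 : a' < 1 / 2 := lt_of_le_of_lt ha'.2 hb
    have hL := strictMonoOn_levelY hz ⟨ha.1, ha2⟩ ⟨ha'.1, ha'2⟩ haa'
    refine strictAntiOn_contactRate hy hz ⟨levelY_pos z a, ?_⟩ ⟨levelY_pos z a', ?_⟩ hL
    · rcases eq_or_lt_of_le ha.2 with h | h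
      · rw [h, levelY_contactB hz hy]
      · exact (((lt_levelY_iff hz ha.1 ha2 hy).2).2 h).le
    · rcases eq_or_lt_of_le ha'.2 with h | h
      · rw [h, levelY_contactB hz hy]
      · exact (((lt_levelY_iff hz ha'.1 ha'2 hy).2).2 h).le
  · intro a ha a' ha' haa'
    have ha0 : 0 < a := hb0.trans_le ha.1
    have ha'0 : 0 < a' := hb0.trans_le ha'.1
    have hL := strictMonoOn_levelY hz ⟨ha0, ha.2⟩ ⟨ha'0, ha'.2⟩ haa'
    refine strictMonoOn_contactRate hy hz ?_ ?_ hL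
    · rcases eq_or_lt_of_le ha.1 with h | h
      · rw [← h, levelY_contactB hz hy]; exact Set.self_mem_Ici
      · exact (((lt_levelY_iff hz ha0 ha.2 hy).1).2 h).le
    · rcases eq_or_lt_of_le ha'.1 with h | h
      · rw [← h, levelY_contactB hz hy]; exact Set.self_mem_Ici
      · exact (((lt_levelY_iff hz ha'0 ha'.2 hy).1).2 h).le

/-- ★★★ **The boundary values of `I*`**: `I*(a) → log μ_1(y,z) − ½log y` as `a → 1/2⁻` and `I*(a) → log μ_1(y,z) − ½log z`
as `a → 0⁺` (§8 composed with `Y_a → ∞`, `Y_a → 0⁺`). [cite: DemboZeitouni2010, §2.2 Theorem 2.2.3; JansevanRensburg2015, §3.2 eq. (3.15)] -/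
theorem tendsto_levelRate_half_zero (hy : 0 < y) (hz : 0 < z) :
    Tendsto (levelRate y z) (𝓝[<] (1 / 2)) (𝓝 (Real.log (stripMuY₂ 1 y z) - Real.log y / 2)) ∧
      Tendsto (levelRate y z) (𝓝[>] 0) (𝓝 (Real.log (stripMuY₂ 1 y z) - Real.log z / 2)) :=
  ⟨(tendsto_contactRate_atTop hy hz).comp (tendsto_levelY_atTop hz),
    (tendsto_contactRate_nhdsGT_zero hy hz).comp (tendsto_levelY_nhdsGT_zero hz)⟩

open Classical in
/-- ★★★ **CRAMÉR'S THEOREM FOR THE ADSORBED FRACTION, level form**: for `a ∈ [b(y,z), 1/2)`,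
`(1/N) log P_{N,y,z}(bc(ω) ≥ aN) → −I*(a)`; for `a ∈ (0, b(y,z)]`, `(1/N) log P_{N,y,z}(bc(ω) ≤ aN) → −I*(a)`.
[cite: DemboZeitouni2010, §2.2 Theorem 2.2.3 (Cramér); JansevanRensburg2015, §3.2 Theorems 3.17–3.19] -/
theorem tendsto_log_contacts_ge_le_div_level (hy : 0 < y) (hz : 0 < z) {a : ℝ} (ha₀ : 0 < a) (ha : a < 1 / 2) :
    (contactB y z ≤ a → Tendsto (fun N : ℕ => Real.log ((∑ q ∈ (stripPairs 1 N).filter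
        (fun q => a * N ≤ (bottomVisits₀ q.1 q.2 N : ℝ)), wgt y z N q) / stripZ₂ 1 N y z) / N)
        atTop (𝓝 (-levelRate y z a))) ∧
    (a ≤ contactB y z → Tendsto (fun N : ℕ => Real.log ((∑ q ∈ (stripPairs 1 N).filter
        (fun q => (bottomVisits₀ q.1 q.2 N : ℝ) ≤ a * N), wgt y z N q) / stripZ₂ 1 N y z) / N)
        atTop (𝓝 (-levelRate y z a))) := by
  obtain ⟨hp, he⟩ := levelY_spec hz ha₀ ha
  constructor
  · intro hba
    have hyY : y ≤ levelY z a := by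
      rcases eq_or_lt_of_le hba with h | h
      · rw [← h, levelY_contactB hz hy]
      · exact (((lt_levelY_iff hz ha₀ ha hy).1).2 h).le
    have h := tendsto_log_contacts_ge_div hy hz hyY
    rw [he] at h; exact h
  · intro hab
    have hYy : levelY z a ≤ y := by
      rcases eq_or_lt_of_le hab with h | h
      · rw [h, levelY_contactB hz hy]
      · exact (((lt_levelY_iff hz ha₀ ha hy).2).2 h).le
    have h := tendsto_log_contacts_le_div hy hz hp hYy
    rw [he] at h; exact h

/-! ## §11 (ed.2) THE CONTACT ENTROPY FUNCTION `σ_z(a) = log μ_1(Y_a,z) − a log Y_a` — a strictly concave arch -/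

/-- ★ **The contact entropy at level `a`** (top fugacity `z`; at `z = 1` the exponential growth rate of the NUMBER of walks with
contact density `a`): `σ_z(a) = log μ_1(Y_a, z) − a·log Y_a`, `b(Y_a,z) = a` — Janse van Rensburg's density function `log 𝒫(a)`.
[cite: JansevanRensburg2015, §3.1 Theorem 3.4 and §3.2 Theorem 3.19 (log 𝒫(ε) = inf_z {𝓕(z) − ε log z})] -/
def contactEntropy (z a : ℝ) : ℝ := Real.log (stripMuY₂ 1 (levelY z a) z) - a * Real.log (levelY z a)

/-- `σ_z(a) = log μ_1(1,z) − I*_{y=1}(a)`: entropy = free energy at `y = 1` minus the rate. [cite: JansevanRensburg2015, §3.2 Theorem 3.19] -/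
theorem contactEntropy_eq (hz : 0 < z) {a : ℝ} (ha₀ : 0 < a) (ha : a < 1 / 2) :
    contactEntropy z a = Real.log (stripMuY₂ 1 1 z) - levelRate 1 z a := by
  obtain ⟨hp, he⟩ := levelY_spec hz ha₀ ha
  rw [contactEntropy, levelRate, contactRate_eq one_pos hz hp, he, Real.log_one]; ring

/-- ★★ **The variational formula**: `σ_z(a) = min_{Y>0} {log μ_1(Y,z) − a log Y}` — for every `Y > 0`,
`σ_z(a) ≤ log μ_1(Y,z) − a·log Y`, with equality at `Y = Y_a`. [cite: JansevanRensburg2015, §3.2 Theorem 3.19 (log 𝒫(ε) = inf_z {𝓕(z) − ε log z})] -/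
theorem isLeast_contactEntropy (hz : 0 < z) {a : ℝ} (ha₀ : 0 < a) (ha : a < 1 / 2) :
    IsLeast ((fun Y : ℝ => Real.log (stripMuY₂ 1 Y z) - a * Real.log Y) '' Set.Ioi (0 : ℝ)) (contactEntropy z a) := by
  obtain ⟨hp, he⟩ := levelY_spec hz ha₀ ha
  refine ⟨⟨levelY z a, hp, rfl⟩, ?_⟩
  rintro _ ⟨Y, hY, rfl⟩
  have hY : 0 < Y := hY
  have ht := mul_log_sub_le_log_stripMuY₂_sub hz hY hp   -- tangent at `Y_a`, evaluated at `Y`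
  rw [he] at ht
  show contactEntropy z a ≤ Real.log (stripMuY₂ 1 Y z) - a * Real.log Y
  unfold contactEntropy; linarith

/-- ★★★ **THE CONTACT ENTROPY IS STRICTLY CONCAVE on `(0, 1/2)`**. [cite: JansevanRensburg2015, §3.2 Theorem 3.17 (concavity of the density function) and §3.3] -/
theorem strictConcaveOn_contactEntropy (hz : 0 < z) : StrictConcaveOn ℝ (Set.Ioo 0 (1 / 2)) (contactEntropy z) := by
  have h := (strictConvexOn_levelRate one_pos hz).neg
  have h2 : StrictConcaveOn ℝ (Set.Ioo 0 (1 / 2)) (fun a => -levelRate 1 z a + Real.log (stripMuY₂ 1 1 z)) :=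
    h.add_const _
  refine h2.congr fun a ha => ?_
  rw [contactEntropy_eq hz ha.1 ha.2]; ring

/-- `σ_z` is continuous on `(0,1/2)`. [cite: JansevanRensburg2015, §3.1 (the density function is continuous)] -/
theorem continuousOn_contactEntropy (hz : 0 < z) : ContinuousOn (contactEntropy z) (Set.Ioo 0 (1 / 2)) := by
  have h : ContinuousOn (fun a => Real.log (stripMuY₂ 1 1 z) - levelRate 1 z a) (Set.Ioo 0 (1 / 2)) :=
    continuousOn_const.sub (continuousOn_levelRate one_pos hz)
  exact h.congr fun a ha => contactEntropy_eq hz ha.1 ha.2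

/-- ★★ **The apex**: `σ_z(a) ≤ log μ_1(1,z)` with equality iff `a = b(1,z)` (`a ∈ (0,1/2)`); `σ_z` increases strictly up to
`b(1,z)` and decreases strictly after. [cite: JansevanRensburg2015, §3.2 Theorem 3.17 (𝓕(z) = sup_ε {log 𝒫(ε) + ε log z}) at z = 1] -/
theorem contactEntropy_le (hz : 0 < z) {a : ℝ} (ha₀ : 0 < a) (ha : a < 1 / 2) :
    contactEntropy z a ≤ Real.log (stripMuY₂ 1 1 z) ∧ (contactEntropy z a = Real.log (stripMuY₂ 1 1 z) ↔ a = contactB 1 z) ∧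
    StrictMonoOn (contactEntropy z) (Set.Ioc 0 (contactB 1 z)) ∧ StrictAntiOn (contactEntropy z) (Set.Ico (contactB 1 z) (1 / 2)) := by
  obtain ⟨-, -, -, -, hb0, hb⟩ := contactB_facts one_pos hz
  obtain ⟨hA, hM⟩ := strictAntiOn_strictMonoOn_levelRate one_pos hz
  refine ⟨?_, ?_, ?_, ?_⟩
  · rw [contactEntropy_eq hz ha₀ ha]
    rcases eq_or_ne a (contactB 1 z) with h | h
    · rw [h, levelRate_contactB one_pos hz]; simp
    · linarith [levelRate_pos one_pos hz ha₀ ha h]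
  · rw [contactEntropy_eq hz ha₀ ha]
    constructor
    · intro h
      by_contra hne
      linarith [levelRate_pos one_pos hz ha₀ ha hne]
    · intro h; rw [h, levelRate_contactB one_pos hz]; simp
  · intro a₁ h₁ a₂ h₂ h12
    rw [contactEntropy_eq hz h₁.1 (lt_of_le_of_lt h₁.2 hb), contactEntropy_eq hz h₂.1 (lt_of_le_of_lt h₂.2 hb)]
    linarith [hA h₁ h₂ h12]
  · intro a₁ h₁ a₂ h₂ h12
    rw [contactEntropy_eq hz (hb0.trans_le h₁.1) h₁.2, contactEntropy_eq hz (hb0.trans_le h₂.1) h₂.2]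
    linarith [hM h₁ h₂ h12]

/-- ★★★ **THE ARCH CLOSES**: `σ_z(a) → ½ log 1 = 0` as `a → 1/2⁻` and `σ_z(a) → ½ log z` as `a → 0⁺` (at `z = 1`: both ends `0` —
the fully adsorbed and the fully desorbed walks of `S_1` are exponentially few). [cite: JansevanRensburg2015, §3.2 eq. (3.15) and §3.3 (end-point behaviour of the density function)] -/
theorem tendsto_contactEntropy (hz : 0 < z) :
    Tendsto (contactEntropy z) (𝓝[<] (1 / 2)) (𝓝 0) ∧ Tendsto (contactEntropy z) (𝓝[>] 0) (𝓝 (Real.log z / 2)) := by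
  obtain ⟨h1, h2⟩ := tendsto_levelRate_half_zero one_pos hz
  have e : ∀ᶠ a in 𝓝[<] (1 / 2 : ℝ), Real.log (stripMuY₂ 1 1 z) - levelRate 1 z a = contactEntropy z a := by
    filter_upwards [Ioo_mem_nhdsLT (show (0 : ℝ) < 1 / 2 by norm_num)] with a ha
    exact (contactEntropy_eq hz ha.1 ha.2).symm
  have e' : ∀ᶠ a in 𝓝[>] (0 : ℝ), Real.log (stripMuY₂ 1 1 z) - levelRate 1 z a = contactEntropy z a := by
    filter_upwards [Ioo_mem_nhdsGT (show (0 : ℝ) < 1 / 2 by norm_num)] with a ha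
    exact (contactEntropy_eq hz ha.1 ha.2).symm
  constructor
  · have := (h1.const_sub (Real.log (stripMuY₂ 1 1 z))).congr' e
    rw [show Real.log (stripMuY₂ 1 1 z) - (Real.log (stripMuY₂ 1 1 z) - Real.log 1 / 2) = 0 by
      rw [Real.log_one]; ring] at this
    exact this
  · have := (h2.const_sub (Real.log (stripMuY₂ 1 1 z))).congr' e'
    rw [show Real.log (stripMuY₂ 1 1 z) - (Real.log (stripMuY₂ 1 1 z) - Real.log z / 2) = Real.log z / 2 by ring] at this
    exact this

open Classical in
/-- ★★★ **THE CONTACT ENTROPY OF SELF-AVOIDING WALKS IN THE ONE-CELL HONEYCOMB STRIP, AT EVERY DENSITY.**  With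
`σ = contactEntropy 1` (strictly concave and continuous on `(0,1/2)`, `σ(0⁺) = σ(½⁻) = 0`, maximum `log μ(S_1)` exactly at
`a = b(1,1) = (μ+1)/(2(2μ+3)) ≈ 0.2057`, `μ` the plastic number): for `a ∈ [b(1,1), 1/2)` the number of `N`-step walks of `S_1` (up to
translation) with AT LEAST `aN` bottom contacts is `exp(N(σ(a) + o(1)))`, and for `a ∈ (0, b(1,1)]` the number with AT MOST `aN`
bottom contacts is `exp(N(σ(a) + o(1)))`.
[cite: JansevanRensburg2015, §3.1 Theorem 3.4, §3.2 Theorems 3.17–3.19 (density functions); HammersleyTorrieWhittington1982, §3]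
[cite: BeatonBousquetMelouDeGierDuminilCopinGuttmann2014, §3.2 Proposition 6 (arXiv v5 p. 10)] -/
theorem tendsto_log_card_contacts_div_level {a : ℝ} (ha₀ : 0 < a) (ha : a < 1 / 2) :
    (contactB 1 1 ≤ a → Tendsto (fun N : ℕ => Real.log ((stripPairs 1 N).filter
        (fun q => a * N ≤ (bottomVisits₀ q.1 q.2 N : ℝ))).card / N) atTop (𝓝 (contactEntropy 1 a))) ∧
    (a ≤ contactB 1 1 → Tendsto (fun N : ℕ => Real.log ((stripPairs 1 N).filter
        (fun q => (bottomVisits₀ q.1 q.2 N : ℝ) ≤ a * N)).card / N) atTop (𝓝 (contactEntropy 1 a))) := by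
  obtain ⟨hp, he⟩ := levelY_spec one_pos ha₀ ha
  have hval : Real.log (stripMuY₂ 1 (levelY 1 a) 1) - contactB (levelY 1 a) 1 * Real.log (levelY 1 a) =
      contactEntropy 1 a := by rw [contactEntropy, he]
  constructor
  · intro hba
    have hyY : 1 ≤ levelY 1 a := by
      rcases eq_or_lt_of_le hba with h | h
      · rw [← h, levelY_contactB one_pos one_pos]
      · exact (((lt_levelY_iff one_pos ha₀ ha one_pos).1).2 h).le
    have h := tendsto_log_card_contacts_ge_div hyY
    rw [hval, he] at h; exact h
  · intro hab
    have hYy : levelY 1 a ≤ 1 := by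
      rcases eq_or_lt_of_le hab with h | h
      · rw [h, levelY_contactB one_pos one_pos]
      · exact (((lt_levelY_iff one_pos ha₀ ha one_pos).2).2 h).le
    have h := tendsto_log_card_contacts_le_div hp hYy
    rw [hval, he] at h; exact h

/-! ## §12 (ed.2) The envelope theorem: `I*′(a) = log(Y_a/y)` and `σ_z′(a) = −log Y_a` -/

/-- The two-sided secant estimate behind the envelope theorem: for `a, a' ∈ (0,1/2)`,
`(a' − a)·log(Y_a/y) ≤ I*(a') − I*(a) ≤ (a' − a)·log(Y_{a'}/y)` (the Legendre inequality `isGreatest_levelRate` used twice).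
[cite: DemboZeitouni2010, §2.2 Lemma 2.2.5 (Λ* and its derivative at exposed points)] -/
theorem levelRate_sub_mem_Icc (hy : 0 < y) (hz : 0 < z) {a a' : ℝ} (ha₀ : 0 < a) (ha : a < 1 / 2) (ha₀' : 0 < a')
    (ha' : a' < 1 / 2) :
    (a' - a) * Real.log (levelY z a / y) ≤ levelRate y z a' - levelRate y z a ∧
      levelRate y z a' - levelRate y z a ≤ (a' - a) * Real.log (levelY z a' / y) := by
  obtain ⟨hp, he⟩ := levelY_spec hz ha₀ ha
  obtain ⟨hp', he'⟩ := levelY_spec hz ha₀' ha'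
  -- the values at the own maximisers
  have hv : levelRate y z a = a * Real.log (levelY z a / y) -
      Real.log (stripMuY₂ 1 (y * (levelY z a / y)) z / stripMuY₂ 1 y z) := by
    rw [levelRate, contactRate, he, mul_div_cancel₀ _ hy.ne']
  have hv' : levelRate y z a' = a' * Real.log (levelY z a' / y) -
      Real.log (stripMuY₂ 1 (y * (levelY z a' / y)) z / stripMuY₂ 1 y z) := by
    rw [levelRate, contactRate, he', mul_div_cancel₀ _ hy.ne']
  -- the Legendre inequalities at the other level
  have h1 := (isGreatest_levelRate hy hz ha₀' ha').2 ⟨levelY z a / y, div_pos hp hy, rfl⟩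
  have h2 := (isGreatest_levelRate hy hz ha₀ ha).2 ⟨levelY z a' / y, div_pos hp' hy, rfl⟩
  simp only at h1 h2
  constructor
  · linarith
  · linarith

/-- ★★★ **THE ENVELOPE THEOREM FOR THE RATE**: `I*` is differentiable on `(0,1/2)` with `I*′(a) = log(Y_a/y)` — the slope of
Cramér's rate function at level `a` is the logarithm of the optimal tilt (zero exactly at the typical level `a = b(y,z)`, `Y_a = y`).
[cite: DemboZeitouni2010, §2.2 Lemma 2.2.5 (c) ((Λ*)′ = the inverse of Λ′); JansevanRensburg2015, §3.3 (derivatives of the density function)] -/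
theorem hasDerivAt_levelRate (hy : 0 < y) (hz : 0 < z) {a : ℝ} (ha₀ : 0 < a) (ha : a < 1 / 2) :
    HasDerivAt (levelRate y z) (Real.log (levelY z a / y)) a := by
  set g : ℝ → ℝ := fun a' => Real.log (levelY z a' / y) with hg
  have hp := (levelY_spec hz ha₀ ha).1
  have hmem : Set.Ioo (0 : ℝ) (1 / 2) ∈ 𝓝 a := isOpen_Ioo.mem_nhds ⟨ha₀, ha⟩
  -- `g` is continuous at `a`
  have hgc : ContinuousAt g a := by
    have hL : ContinuousAt (levelY z) a := (continuousOn_levelY hz a ⟨ha₀, ha⟩).continuousAt hmem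
    exact (hL.div_const y).log (div_pos hp hy).ne'
  rw [hasDerivAt_iff_tendsto_slope]
  have hgt : Tendsto g (𝓝[≠] a) (𝓝 (g a)) := hgc.tendsto.mono_left nhdsWithin_le_nhds
  have hlo : Tendsto (fun a' => min (g a) (g a')) (𝓝[≠] a) (𝓝 (g a)) := by
    have := (tendsto_const_nhds (x := g a) (f := 𝓝[≠] a)).min hgt
    rwa [min_self] at this
  have hhi : Tendsto (fun a' => max (g a) (g a')) (𝓝[≠] a) (𝓝 (g a)) := by
    have := (tendsto_const_nhds (x := g a) (f := 𝓝[≠] a)).max hgt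
    rwa [max_self] at this
  refine tendsto_of_tendsto_of_tendsto_of_le_of_le' hlo hhi ?_ ?_
  · filter_upwards [self_mem_nhdsWithin, mem_nhdsWithin_of_mem_nhds hmem] with a' hne ha'
    obtain ⟨h1, h2⟩ := levelRate_sub_mem_Icc hy hz ha₀ ha ha'.1 ha'.2
    rw [slope_def_field]
    rcases lt_or_gt_of_ne (show a' ≠ a from hne) with hlt | hgt
    · have hneg : a' - a < 0 := by linarith
      refine (min_le_right _ _).trans ?_
      rw [le_div_iff_of_neg hneg]; linarith
    · have hpos : 0 < a' - a := by linarith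
      refine (min_le_left _ _).trans ?_
      rw [le_div_iff₀ hpos]; linarith
  · filter_upwards [self_mem_nhdsWithin, mem_nhdsWithin_of_mem_nhds hmem] with a' hne ha'
    obtain ⟨h1, h2⟩ := levelRate_sub_mem_Icc hy hz ha₀ ha ha'.1 ha'.2
    rw [slope_def_field]
    rcases lt_or_gt_of_ne (show a' ≠ a from hne) with hlt | hgt
    · have hneg : a' - a < 0 := by linarith
      refine le_trans ?_ (le_max_left _ _)
      rw [div_le_iff_of_neg hneg]; linarith
    · have hpos : 0 < a' - a := by linarith
      refine le_trans ?_ (le_max_right _ _)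
      rw [div_le_iff₀ hpos]; linarith

/-- ★★★ **THE SLOPE OF THE ENTROPY IS MINUS THE LOG-FUGACITY**: `σ_z` is differentiable on `(0,1/2)` with `σ_z′(a) = −log Y_a`
(thermodynamic duality: `∂σ/∂a = −log Y` inverts `y ∂_y log μ_1 = b`; the apex `a = b(1,z)` is where `Y_a = 1`).
[cite: JansevanRensburg2015, §3.3 (derivatives of the density function and the free energy); DemboZeitouni2010, §2.2 Lemma 2.2.5] -/
theorem hasDerivAt_contactEntropy (hz : 0 < z) {a : ℝ} (ha₀ : 0 < a) (ha : a < 1 / 2) :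
    HasDerivAt (contactEntropy z) (-Real.log (levelY z a)) a := by
  have h := ((hasDerivAt_levelRate one_pos hz ha₀ ha).const_sub (Real.log (stripMuY₂ 1 1 z)))
  rw [div_one] at h
  refine h.congr_of_eventuallyEq ?_
  filter_upwards [isOpen_Ioo.mem_nhds ⟨ha₀, ha⟩] with a' ha'
  exact contactEntropy_eq hz ha'.1 ha'.2

/-- ★★ **Infinite slopes at both ends**: `σ_z′(a) = −log Y_a → +∞` as `a → 0⁺` and `→ −∞` as `a → 1/2⁻` (no finite end-slope, hence
no jump of the optimal fugacity: in Janse van Rensburg's dictionary the adsorption of the one-cell strip has no first-order feature).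
[cite: JansevanRensburg2015, §3.3 (finite versus infinite one-sided derivatives of the density function at ε_m, ε_M)] -/
theorem tendsto_deriv_contactEntropy (hz : 0 < z) :
    Tendsto (fun a => -Real.log (levelY z a)) (𝓝[>] 0) atTop ∧
      Tendsto (fun a => -Real.log (levelY z a)) (𝓝[<] (1 / 2)) atBot := by
  constructor
  · have h := Real.tendsto_log_nhdsGT_zero.comp (tendsto_levelY_nhdsGT_zero hz)
    exact tendsto_neg_atBot_atTop.comp h
  · have h := Real.tendsto_log_atTop.comp (tendsto_levelY_atTop hz)
    exact tendsto_neg_atTop_atBot.comp h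

/-! ## §13 (ed.3) The TOP wall by reflection: large deviations of `tc(ω)/N` under `P_{N,y,z}` are those of `bc` under `P_{N,z,y}` -/

open Classical in
/-- ★ **The reflection of the strip transfers every tail sum of TOP contacts at `(y,z)` to the corresponding tail sum of BOTTOM
contacts at `(z,y)`**: `Σ_{q : P(tc q)} y^{bc} z^{tc} = Σ_{q : P(bc q)} z^{bc} y^{tc}` (tree: `flipPair`, `bottomVisits₀_flipPair`,
`topVisits₀_flipPair`). [cite: BeatonBousquetMelouDeGierDuminilCopinGuttmann2014, Proposition 6 (arXiv v5 p. 10: "by the symmetry of bridges, μ_T(y,z) = μ_T(z,y)")] -/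
theorem sum_filter_topVisits_eq_sum_filter_bottomVisits (y z : ℝ) (N : ℕ) (P : ℕ → Prop) :
    ∑ q ∈ (stripPairs 1 N).filter (fun q => P (topVisits₀ 1 q.1 q.2 N)), wgt y z N q =
      ∑ q ∈ (stripPairs 1 N).filter (fun q => P (bottomVisits₀ q.1 q.2 N)), wgt z y N q := by
  have himg : (stripPairs 1 N).image (flipPair 1) = stripPairs 1 N := by
    refine Finset.eq_of_subset_of_card_le (fun q hq => ?_) ?_
    · obtain ⟨p, hp, rfl⟩ := Finset.mem_image.1 hq
      exact flipPair_mem hp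
    · rw [Finset.card_image_of_injOn (flipPair_injOn 1 N)]
  rw [Finset.sum_filter, Finset.sum_filter]
  calc ∑ q ∈ stripPairs 1 N, (if P (topVisits₀ 1 q.1 q.2 N) then wgt y z N q else 0)
      = ∑ q ∈ (stripPairs 1 N).image (flipPair 1), (if P (topVisits₀ 1 q.1 q.2 N) then wgt y z N q else 0) := by
        rw [himg]
    _ = ∑ p ∈ stripPairs 1 N, (if P (topVisits₀ 1 (flipPair 1 p).1 (flipPair 1 p).2 N) then wgt y z N (flipPair 1 p) else 0) :=
        Finset.sum_image (flipPair_injOn 1 N)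
    _ = ∑ p ∈ stripPairs 1 N, (if P (bottomVisits₀ p.1 p.2 N) then wgt z y N p else 0) := by
        refine Finset.sum_congr rfl fun p _ => ?_
        simp only [wgt, topVisits₀_flipPair, bottomVisits₀_flipPair, mul_comm]

open Classical in
/-- ★★★ **LARGE DEVIATIONS OF THE TOP ADSORBED FRACTION** (both tails): for `y, z > 0`,
`(1/N) log P_{N,y,z}(tc(ω) ≥ b(Z,y)·N) → −I(z,y;Z)` for `Z ≥ z` and `(1/N) log P_{N,y,z}(tc(ω) ≤ b(Z,y)·N) → −I(z,y;Z)` for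
`0 < Z ≤ z` — the bottom-wall LDP with the fugacities exchanged (reflection of the strip).
[cite: DemboZeitouni2010, §2.2 Theorem 2.2.3 (Cramér); BeatonBousquetMelouDeGierDuminilCopinGuttmann2014, Proposition 6 (arXiv v5 p. 10: symmetry of the strip)] -/
theorem tendsto_log_topContacts_ge_le_div (hy : 0 < y) (hz : 0 < z) {Z : ℝ} (hZ : 0 < Z) :
    (z ≤ Z → Tendsto (fun N : ℕ => Real.log ((∑ q ∈ (stripPairs 1 N).filter
        (fun q => contactB Z y * N ≤ (topVisits₀ 1 q.1 q.2 N : ℝ)), wgt y z N q) / stripZ₂ 1 N y z) / N)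
        atTop (𝓝 (-contactRate z y Z))) ∧
    (Z ≤ z → Tendsto (fun N : ℕ => Real.log ((∑ q ∈ (stripPairs 1 N).filter
        (fun q => (topVisits₀ 1 q.1 q.2 N : ℝ) ≤ contactB Z y * N), wgt y z N q) / stripZ₂ 1 N y z) / N)
        atTop (𝓝 (-contactRate z y Z))) := by
  constructor
  · intro hzZ
    have h := tendsto_log_contacts_ge_div hz hy hzZ
    refine h.congr fun N => ?_
    rw [sum_filter_topVisits_eq_sum_filter_bottomVisits y z N (fun m => contactB Z y * N ≤ (m : ℝ)), stripZ₂_symm 1 N y z]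
  · intro hZz
    have h := tendsto_log_contacts_le_div hz hy hZ hZz
    refine h.congr fun N => ?_
    rw [sum_filter_topVisits_eq_sum_filter_bottomVisits y z N (fun m => (m : ℝ) ≤ contactB Z y * N), stripZ₂_symm 1 N y z]

open Classical in
/-- ★★ **The top-wall LDP at every level**: for `a ∈ (0,1/2)`, `(1/N) log P_{N,y,z}(tc ≥ aN) → −I*_{z,y}(a)` if `b(z,y) ≤ a` and
`(1/N) log P_{N,y,z}(tc ≤ aN) → −I*_{z,y}(a)` if `a ≤ b(z,y)`, with the level rate `levelRate z y a` of §10 (fugacities exchanged).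
[cite: DemboZeitouni2010, §2.2 Theorem 2.2.3 (Cramér); BeatonBousquetMelouDeGierDuminilCopinGuttmann2014, Proposition 6 (arXiv v5 p. 10)] -/
theorem tendsto_log_topContacts_ge_le_div_level (hy : 0 < y) (hz : 0 < z) {a : ℝ} (ha₀ : 0 < a) (ha : a < 1 / 2) :
    (contactB z y ≤ a → Tendsto (fun N : ℕ => Real.log ((∑ q ∈ (stripPairs 1 N).filter
        (fun q => a * N ≤ (topVisits₀ 1 q.1 q.2 N : ℝ)), wgt y z N q) / stripZ₂ 1 N y z) / N)
        atTop (𝓝 (-levelRate z y a))) ∧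
    (a ≤ contactB z y → Tendsto (fun N : ℕ => Real.log ((∑ q ∈ (stripPairs 1 N).filter
        (fun q => (topVisits₀ 1 q.1 q.2 N : ℝ) ≤ a * N), wgt y z N q) / stripZ₂ 1 N y z) / N)
        atTop (𝓝 (-levelRate z y a))) := by
  obtain ⟨h1, h2⟩ := tendsto_log_contacts_ge_le_div_level hz hy ha₀ ha
  constructor
  · intro hba
    refine (h1 hba).congr fun N => ?_
    rw [sum_filter_topVisits_eq_sum_filter_bottomVisits y z N (fun m => a * N ≤ (m : ℝ)), stripZ₂_symm 1 N y z]
  · intro hab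
    refine (h2 hab).congr fun N => ?_
    rw [sum_filter_topVisits_eq_sum_filter_bottomVisits y z N (fun m => (m : ℝ) ≤ a * N), stripZ₂_symm 1 N y z]

/-! ## §14 (ed.3) Surface contacts versus rungs: `2(bc + tc) + V = N + [x_N odd] + [x_0 odd]` on `S_N(S_1)` -/

/-- ★★ **The parity identity of the one-cell strip**: for every walk of `S_N(S_1)`,
`2·(bc + tc) + V = N + (x_N mod 2) + (x_0 mod 2)`, where `V = LadderPot.nV` is the number of vertical steps (rungs) and `x_m` the
column of the `m`-th site: horizontal steps alternate the column parity, rungs (at even columns) keep it, and the surface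
sites of `S_1` are exactly the odd columns of both rows.  Hence the total surface-contact fraction `(bc+tc)/N` and the rung density
`V/N` are affinely related up to `O(1/N)`: `(bc + tc)/N = (1 − V/N)/2 + O(1/N)`.
[cite: BeatonBousquetMelouDeGierDuminilCopinGuttmann2014, §3.2 (arXiv v5 p. 10: bc, tc); EntingJensen2009, §7.4.2, Fig. 7.10 (vertical bonds at x + y even)] -/
theorem two_mul_totalVisits_add_nV {N : ℕ} {p : Site 2 × (ℕ → Site 2)} (hp : p ∈ stripPairs 1 N) :
    (2 * ((bottomVisits₀ p.1 p.2 N : ℤ) + (topVisits₀ 1 p.1 p.2 N : ℤ)) + (LadderPot.nV p N : ℤ)) =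
      N + WallPot.siteAt p N 0 % 2 + WallPot.siteAt p 0 0 % 2 := by
  induction N generalizing p with
  | zero =>
    have hr := WallPot.rowAt_mem hp (le_refl 0)
    have hV : LadderPot.nV p 0 = 0 := by simp [LadderPot.nV]
    have hb : bottomVisits₀ p.1 p.2 0 = if (p.1 + p.2 0) 1 = 0 ∧ (p.1 + p.2 0) 0 % 2 = 1 then 1 else 0 := by
      simp only [bottomVisits₀, zero_add, Finset.sum_range_one]
    have ht : topVisits₀ 1 p.1 p.2 0 = if (p.1 + p.2 0) 1 = ((1 : ℕ) : ℤ) ∧ ((p.1 + p.2 0) 0 + (1 : ℕ)) % 2 = 0 then 1 else 0 := by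
      simp only [topVisits₀, zero_add, Finset.sum_range_one]
    rw [hV, hb, ht]
    unfold WallPot.rowAt WallPot.siteAt at *
    push_cast
    split_ifs <;> omega
  | succ N ih =>
    have hpre := WallPot.pref_mem hp
    have ih' := ih hpre
    rw [show (bottomVisits₀ (WallPot.pref N p).1 (WallPot.pref N p).2 N : ℤ) + (topVisits₀ 1 (WallPot.pref N p).1 (WallPot.pref N p).2 N : ℤ)
        = ((bottomVisits₀ (WallPot.pref N p).1 (WallPot.pref N p).2 N + topVisits₀ 1 (WallPot.pref N p).1 (WallPot.pref N p).2 N : ℕ) : ℤ)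
        by push_cast; ring, WallPot.visits_pref] at ih'
    have hobs := (LadderPot.obs_congr (p := WallPot.pref N p) (p' := p) (n := N) (fun i hi => WallPot.siteAt_pref hi)).2.1
    rw [hobs, WallPot.siteAt_pref le_rfl, WallPot.siteAt_pref (Nat.zero_le N)] at ih'
    have hvs := WallPot.visits_succ (T := 1) le_rfl p N
    rw [show (bottomVisits₀ p.1 p.2 (N + 1) : ℤ) + (topVisits₀ 1 p.1 p.2 (N + 1) : ℤ)
        = ((bottomVisits₀ p.1 p.2 (N + 1) + topVisits₀ 1 p.1 p.2 (N + 1) : ℕ) : ℤ) by push_cast; ring, hvs,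
      LadderPot.nV_succ]
    have hls := WallPot.last_step_coord hp
    have hr0 := WallPot.rowAt_mem hp (Nat.le_succ N)
    have hr1 := WallPot.rowAt_mem hp le_rfl
    unfold WallPot.rowAt WallPot.parAt WallPot.vertAt at *
    simp only [decide_eq_true_eq] at *
    push_cast at ih' ⊢
    split_ifs with h1 h2 h2 <;> omega

/-! ## §15 (ed.3) The diagonal free energy `t ↦ log μ_1(eᵗ,eᵗ)`: derivative `2b(eᵗ,eᵗ)`, strict tangent inequality, the diagonal rate -/

/-- `(y,z) ↦ b(y,z)` is jointly continuous at every point of the open quadrant (rational in `y, z, s` with `s = μ_1(y,z)²` jointly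
continuous by the tree's `continuousOn_stripMuY₂`). [cite: BeatonBousquetMelouDeGierDuminilCopinGuttmann2014, Proposition 6 (arXiv v5 p. 10: "log-convex and thus continuous")] -/
theorem continuousAt_contactB₂ (hy : 0 < y) (hz : 0 < z) : ContinuousAt (fun p : ℝ × ℝ => contactB p.1 p.2) (y, z) := by
  have hμ : ContinuousAt (fun p : ℝ × ℝ => stripMuY₂ 1 p.1 p.2) (y, z) :=
    (continuousOn_stripMuY₂ 1).continuousAt ((isOpen_Ioi.prod isOpen_Ioi).mem_nhds ⟨hy, hz⟩)
  have hF : sexticDeriv y z (stripMuY₂ 1 y z ^ 2) ≠ 0 := (contactB_facts hy hz).2.2.1.ne'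
  have hs : ContinuousAt (fun p : ℝ × ℝ => stripMuY₂ 1 p.1 p.2 ^ 2) (y, z) := hμ.pow 2
  have h1 : ContinuousAt (fun p : ℝ × ℝ => p.1) (y, z) := continuousAt_fst
  have h2 : ContinuousAt (fun p : ℝ × ℝ => p.2) (y, z) := continuousAt_snd
  have hFc : ContinuousAt (fun p : ℝ × ℝ => sexticDeriv p.1 p.2 (stripMuY₂ 1 p.1 p.2 ^ 2)) (y, z) := by
    unfold sexticDeriv
    exact (((hs.sub h1).mul (hs.sub h2)).add (hs.mul (hs.sub h2))).add (hs.mul (hs.sub h1))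
  unfold contactB
  exact (hs.mul (hs.sub h2)).div (continuousAt_const.mul hFc) (mul_ne_zero two_ne_zero hF)

/-- The four one-variable tangent bounds behind the diagonal slope: for `Y, Y' > 0`, `ℓ = log Y' − log Y`,
`(b(Y,Y') − b(Y,Y))·ℓ ≤ [log μ_1(Y',Y') − log μ_1(Y,Y)] − 2b(Y,Y)·ℓ ≤ (b(Y',Y') − b(Y,Y) + b(Y',Y) − b(Y,Y))·ℓ`.
[cite: BeatonBousquetMelouDeGierDuminilCopinGuttmann2014, §3.2 Proposition 6 (arXiv v5 p. 10); MadrasSlade1993, §1.2] -/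
theorem log_stripMuY₂_diag_sub_mem {Y Y' : ℝ} (hY : 0 < Y) (hY' : 0 < Y') :
    (contactB Y Y' - contactB Y Y) * (Real.log Y' - Real.log Y) ≤
        (Real.log (stripMuY₂ 1 Y' Y') - Real.log (stripMuY₂ 1 Y Y)) - 2 * contactB Y Y * (Real.log Y' - Real.log Y) ∧
      (Real.log (stripMuY₂ 1 Y' Y') - Real.log (stripMuY₂ 1 Y Y)) - 2 * contactB Y Y * (Real.log Y' - Real.log Y) ≤
        (contactB Y' Y' - contactB Y Y + (contactB Y' Y - contactB Y Y)) * (Real.log Y' - Real.log Y) := by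
  -- split `Λ(Y',Y') − Λ(Y,Y) = A + B`, `A = Λ(Y',Y') − Λ(Y,Y')`, `B = Λ(Y',Y) − Λ(Y,Y)` (symmetry in the middle)
  have hsym : stripMuY₂ 1 Y Y' = stripMuY₂ 1 Y' Y := stripMuY₂_symm 1 Y Y'
  have hA1 := mul_log_sub_le_log_stripMuY₂_sub hY' hY' hY      -- tangent at `Y` (second arg `Y'`), at `Y'`
  have hA2 := mul_log_sub_le_log_stripMuY₂_sub hY' hY hY'      -- tangent at `Y'` (second arg `Y'`), at `Y`
  have hB1 := mul_log_sub_le_log_stripMuY₂_sub hY hY' hY        -- tangent at `Y` (second arg `Y`), at `Y'`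
  have hB2 := mul_log_sub_le_log_stripMuY₂_sub hY hY hY'        -- tangent at `Y'` (second arg `Y`), at `Y`
  have e : Real.log (stripMuY₂ 1 Y' Y') - Real.log (stripMuY₂ 1 Y Y) =
      (Real.log (stripMuY₂ 1 Y' Y') - Real.log (stripMuY₂ 1 Y Y')) + (Real.log (stripMuY₂ 1 Y' Y) - Real.log (stripMuY₂ 1 Y Y)) := by
    rw [hsym]; ring
  constructor
  · nlinarith [hA1, hB1, e]
  · nlinarith [hA2, hB2, e]

/-- ★★ **The diagonal free energy is differentiable with derivative twice the diagonal contact density**: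
`d/dt log μ_1(eᵗ,eᵗ) = 2·b(eᵗ,eᵗ)` (both walls respond: `y∂_y + z∂_z` on the diagonal; squeeze between the one-variable tangent
bounds + joint continuity of `b`). [cite: BeatonBousquetMelouDeGierDuminilCopinGuttmann2014, §3.2 Proposition 6 (arXiv v5 p. 10); MadrasSlade1993, §1.2] -/
theorem hasDerivAt_log_stripMuY₂_diag_exp (t : ℝ) :
    HasDerivAt (fun t => Real.log (stripMuY₂ 1 (Real.exp t) (Real.exp t))) (2 * contactB (Real.exp t) (Real.exp t)) t := by
  have hY : 0 < Real.exp t := Real.exp_pos t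
  -- joint continuity of `b` at `(eᵗ,eᵗ)` along three curves
  have hc := continuousAt_contactB₂ hY hY
  have hexp : ContinuousAt Real.exp t := Real.continuous_exp.continuousAt
  have h1 : Tendsto (fun t' => contactB (Real.exp t) (Real.exp t')) (𝓝 t) (𝓝 (contactB (Real.exp t) (Real.exp t))) :=
    (ContinuousAt.comp_of_eq hc (continuousAt_const.prodMk hexp) rfl).tendsto
  have h2 : Tendsto (fun t' => contactB (Real.exp t') (Real.exp t')) (𝓝 t) (𝓝 (contactB (Real.exp t) (Real.exp t))) :=
    (ContinuousAt.comp_of_eq hc (hexp.prodMk hexp) rfl).tendsto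
  have h3 : Tendsto (fun t' => contactB (Real.exp t') (Real.exp t)) (𝓝 t) (𝓝 (contactB (Real.exp t) (Real.exp t))) :=
    (ContinuousAt.comp_of_eq hc (hexp.prodMk continuousAt_const) rfl).tendsto
  have hE0 : Tendsto (fun t' => |contactB (Real.exp t) (Real.exp t') - contactB (Real.exp t) (Real.exp t)| +
      (|contactB (Real.exp t') (Real.exp t') - contactB (Real.exp t) (Real.exp t)| +
        |contactB (Real.exp t') (Real.exp t) - contactB (Real.exp t) (Real.exp t)|)) (𝓝 t) (𝓝 0) := by
    have := ((h1.sub_const (contactB (Real.exp t) (Real.exp t))).abs.add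
      (((h2.sub_const (contactB (Real.exp t) (Real.exp t))).abs).add
        ((h3.sub_const (contactB (Real.exp t) (Real.exp t))).abs)))
    simpa using this
  rw [hasDerivAt_iff_tendsto_slope]
  have hmain : ∀ t', t' ≠ t →
      |slope (fun t => Real.log (stripMuY₂ 1 (Real.exp t) (Real.exp t))) t t' - 2 * contactB (Real.exp t) (Real.exp t)| ≤
        |contactB (Real.exp t) (Real.exp t') - contactB (Real.exp t) (Real.exp t)| +
          (|contactB (Real.exp t') (Real.exp t') - contactB (Real.exp t) (Real.exp t)| +
            |contactB (Real.exp t') (Real.exp t) - contactB (Real.exp t) (Real.exp t)|) := by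
    intro t' hne
    have hY' : 0 < Real.exp t' := Real.exp_pos t'
    have hℓ0 : t' - t ≠ 0 := sub_ne_zero.2 hne
    have hlog : Real.log (Real.exp t') - Real.log (Real.exp t) = t' - t := by rw [Real.log_exp, Real.log_exp]
    obtain ⟨hlo, hhi⟩ := log_stripMuY₂_diag_sub_mem hY hY'
    rw [hlog] at hlo hhi
    rw [slope_def_field]
    set ℓ := t' - t with hℓ
    set D := Real.log (stripMuY₂ 1 (Real.exp t') (Real.exp t')) - Real.log (stripMuY₂ 1 (Real.exp t) (Real.exp t)) with hD
    set b := contactB (Real.exp t) (Real.exp t) with hb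
    set Δ₁ := contactB (Real.exp t) (Real.exp t') - b with hΔ₁
    set Δ₂ := contactB (Real.exp t') (Real.exp t') - b with hΔ₂
    set Δ₃ := contactB (Real.exp t') (Real.exp t) - b with hΔ₃
    have e1 : D / ℓ - 2 * b = (D - 2 * b * ℓ) / ℓ := by field_simp
    rw [e1, abs_div, div_le_iff₀ (abs_pos.2 hℓ0)]
    have hlo' : Δ₁ * ℓ ≤ D - 2 * b * ℓ := by rw [hΔ₁]; linarith
    have hhi' : D - 2 * b * ℓ ≤ (Δ₂ + Δ₃) * ℓ := by rw [hΔ₂, hΔ₃]; linarith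
    have habs : |D - 2 * b * ℓ| ≤ |Δ₁ * ℓ| + |(Δ₂ + Δ₃) * ℓ| :=
      abs_le.2 ⟨by linarith [neg_abs_le (Δ₁ * ℓ), abs_nonneg ((Δ₂ + Δ₃) * ℓ)],
        by linarith [le_abs_self ((Δ₂ + Δ₃) * ℓ), abs_nonneg (Δ₁ * ℓ)]⟩
    refine habs.trans ?_
    rw [abs_mul, abs_mul]
    have h23 := abs_add_le Δ₂ Δ₃
    nlinarith [abs_nonneg ℓ, abs_nonneg Δ₁]
  have h0 : Tendsto (fun t' => slope (fun t => Real.log (stripMuY₂ 1 (Real.exp t) (Real.exp t))) t t' -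
      2 * contactB (Real.exp t) (Real.exp t)) (𝓝[≠] t) (𝓝 0) :=
    squeeze_zero_norm' (by filter_upwards [self_mem_nhdsWithin] with t' ht'; exact hmain t' ht')
      (hE0.mono_left nhdsWithin_le_nhds)
  have := h0.add_const (2 * contactB (Real.exp t) (Real.exp t))
  simpa using this

/-- ★ **The diagonal contact density is strictly increasing**: `Y < Y' ⇒ b(Y,Y) < b(Y',Y')` (via `4b(Y,Y) = v(Y,Y) = 1 − 1/(2μ_1(Y,Y)+3)`
and the strict monotonicity of `μ_1` in each fugacity). [cite: BeatonBousquetMelouDeGierDuminilCopinGuttmann2014, §3.2 Proposition 6 (arXiv v5 p. 10)] -/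
theorem contactB_diag_strictMono {Y Y' : ℝ} (hY : 0 < Y) (hYY' : Y < Y') : contactB Y Y < contactB Y' Y' := by
  have hY' : 0 < Y' := hY.trans hYY'
  have e : ∀ {W : ℝ}, 0 < W → contactB W W = (1 - 1 / (2 * stripMuY₂ 1 W W + 3)) / 4 := by
    intro W hW
    have h := contactB_add_contactB_swap hW hW
    rw [twoWallSpeed_self hW] at h
    linarith
  rw [e hY, e hY']
  have hμ := stripMuY₂_pos 1 hY hY
  have h1 : stripMuY₂ 1 Y Y < stripMuY₂ 1 Y' Y' :=
    (stripMuY₂_one_strictMono_left hY hY hYY').trans (stripMuY₂_one_strictMono_right hY' hY hYY')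
  have h3 : 0 < 2 * stripMuY₂ 1 Y Y + 3 := by linarith
  have h4 : 1 / (2 * stripMuY₂ 1 Y' Y' + 3) < 1 / (2 * stripMuY₂ 1 Y Y + 3) :=
    one_div_lt_one_div_of_lt h3 (by linarith)
  linarith

/-- ★★ **Strict tangent inequality for the diagonal free energy**: for `Y' ≠ Y`,
`2b(Y,Y)·(log Y' − log Y) < log μ_1(Y',Y') − log μ_1(Y,Y)` (mean value theorem on `t ↦ log μ_1(eᵗ,eᵗ)` + `contactB_diag_strictMono`).
[cite: BeatonBousquetMelouDeGierDuminilCopinGuttmann2014, §3.2 Proposition 6 (arXiv v5 p. 10); MadrasSlade1993, §1.2] -/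
theorem two_mul_log_sub_lt_log_stripMuY₂_diag_sub {Y Y' : ℝ} (hY : 0 < Y) (hY' : 0 < Y') (hne : Y' ≠ Y) :
    2 * contactB Y Y * (Real.log Y' - Real.log Y) < Real.log (stripMuY₂ 1 Y' Y') - Real.log (stripMuY₂ 1 Y Y) := by
  set g : ℝ → ℝ := fun t => Real.log (stripMuY₂ 1 (Real.exp t) (Real.exp t)) with hg
  have hderiv : ∀ t, HasDerivAt g (2 * contactB (Real.exp t) (Real.exp t)) t := fun t => hasDerivAt_log_stripMuY₂_diag_exp t
  have hgY' : g (Real.log Y') = Real.log (stripMuY₂ 1 Y' Y') := by simp only [hg, Real.exp_log hY']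
  have hgY : g (Real.log Y) = Real.log (stripMuY₂ 1 Y Y) := by simp only [hg, Real.exp_log hY]
  rcases lt_or_gt_of_ne hne with hlt | hlt
  · have hll : Real.log Y' < Real.log Y := Real.log_lt_log hY' hlt
    obtain ⟨τ, hτ, hslope⟩ := exists_hasDerivAt_eq_slope g (fun t => 2 * contactB (Real.exp t) (Real.exp t)) hll
      (fun t _ => (hderiv t).continuousAt.continuousWithinAt) (fun t _ => hderiv t)
    have hτY : contactB (Real.exp τ) (Real.exp τ) < contactB Y Y := by
      have h := contactB_diag_strictMono (Real.exp_pos τ) (Y' := Y) (by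
        calc Real.exp τ < Real.exp (Real.log Y) := Real.exp_lt_exp.2 hτ.2
          _ = Y := Real.exp_log hY)
      exact h
    rw [hgY', hgY] at hslope
    have hpos : 0 < Real.log Y - Real.log Y' := by linarith
    have key : 2 * contactB Y Y * (Real.log Y - Real.log Y') >
        Real.log (stripMuY₂ 1 Y Y) - Real.log (stripMuY₂ 1 Y' Y') := by
      have := mul_lt_mul_of_pos_right (by linarith : 2 * contactB (Real.exp τ) (Real.exp τ) < 2 * contactB Y Y) hpos
      rwa [hslope, div_mul_cancel₀ _ hpos.ne'] at this
    linarith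
  · have hll : Real.log Y < Real.log Y' := Real.log_lt_log hY hlt
    obtain ⟨τ, hτ, hslope⟩ := exists_hasDerivAt_eq_slope g (fun t => 2 * contactB (Real.exp t) (Real.exp t)) hll
      (fun t _ => (hderiv t).continuousAt.continuousWithinAt) (fun t _ => hderiv t)
    have hτY : contactB Y Y < contactB (Real.exp τ) (Real.exp τ) := by
      have h := contactB_diag_strictMono hY (Y' := Real.exp τ) (by
        calc Y = Real.exp (Real.log Y) := (Real.exp_log hY).symm
          _ < Real.exp τ := Real.exp_lt_exp.2 hτ.1)
      exact h
    rw [hgY', hgY] at hslope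
    have hpos : 0 < Real.log Y' - Real.log Y := by linarith
    have := mul_lt_mul_of_pos_right (by linarith : 2 * contactB Y Y < 2 * contactB (Real.exp τ) (Real.exp τ)) hpos
    rwa [hslope, div_mul_cancel₀ _ hpos.ne'] at this

/-- ★ **The diagonal rate** `I₂(y;Y) = 2b(Y,Y)·log(Y/y) − log(μ_1(Y,Y)/μ_1(y,y))` — the exponential cost of a total surface-contact
fraction `(bc+tc)/N ≈ 2b(Y,Y)` (equivalently of a rung density `V/N ≈ 1/(2μ_1(Y,Y)+3)`) under `P_{N,y,y}`.
[cite: DemboZeitouni2010, §2.2 Theorem 2.2.3 (Cramér); JansevanRensburg2015, §3.2 Theorems 3.17–3.19] -/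
def diagRate (y Y : ℝ) : ℝ := 2 * contactB Y Y * Real.log (Y / y) - Real.log (stripMuY₂ 1 Y Y / stripMuY₂ 1 y y)

/-- `I₂(y;y) = 0`. [cite: DemboZeitouni2010, §2.2 (lane plumbing)] -/
theorem diagRate_self (hy : 0 < y) : diagRate y y = 0 := by
  unfold diagRate; rw [div_self hy.ne', div_self (stripMuY₂_pos 1 hy hy).ne', Real.log_one]; ring

/-- ★★ `I₂(y;Y) > 0` for `Y ≠ y` (strict convexity of the diagonal free energy). [cite: DemboZeitouni2010, §2.2 Theorem 2.2.3] -/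
theorem diagRate_pos (hy : 0 < y) {Y : ℝ} (hY : 0 < Y) (hne : Y ≠ y) : 0 < diagRate y Y := by
  unfold diagRate
  rw [Real.log_div hY.ne' hy.ne', Real.log_div (stripMuY₂_pos 1 hY hY).ne' (stripMuY₂_pos 1 hy hy).ne']
  have h := two_mul_log_sub_lt_log_stripMuY₂_diag_sub hY hy hne.symm
  linarith

/-! ## §16 (ed.3) Large deviations of the TOTAL surface contacts `bc + tc` (ray tilts `(y,z) ↦ (yu, zu)`) -/

/-- ★ **The ray tilt identity**: `wgt (yu) (zu) = wgt y z · u^{bc + tc}`. [cite: BeatonBousquetMelouDeGierDuminilCopinGuttmann2014, §3.2 (arXiv v5 p. 10)] -/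
theorem wgt_tilt_ray (y z u : ℝ) (N : ℕ) (q : Site 2 × (ℕ → Site 2)) :
    wgt (y * u) (z * u) N q = wgt y z N q * u ^ (bottomVisits₀ q.1 q.2 N + topVisits₀ 1 q.1 q.2 N) := by
  unfold wgt; rw [mul_pow, mul_pow, pow_add]; ring

open Classical in
/-- ★★ **Chernoff for the total contacts, upper tail (shifted level)**: for `u ≥ 1` and reals `κ, d`,
`(Σ_{q : κN + d ≤ bc+tc} y^{bc} z^{tc}) · u^{κN + d} ≤ C_{1,N}(yu, zu)`. [cite: DemboZeitouni2010, §2.2 Theorem 2.2.3 (Chebycheff step); BeatonBousquetMelouDeGierDuminilCopinGuttmann2014, §3.2 (arXiv v5 p. 10)] -/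
theorem sum_total_ge_mul_rpow_le (hy : 0 ≤ y) (hz : 0 ≤ z) {u : ℝ} (hu : 1 ≤ u) (N : ℕ) (κ d : ℝ) :
    (∑ q ∈ (stripPairs 1 N).filter (fun q => κ * N + d ≤ ((bottomVisits₀ q.1 q.2 N + topVisits₀ 1 q.1 q.2 N : ℕ) : ℝ)),
        wgt y z N q) * u ^ (κ * N + d) ≤ stripZ₂ 1 N (y * u) (z * u) := by
  have hu0 : 0 ≤ u := zero_le_one.trans hu
  rw [Finset.sum_mul, stripZ₂_one_eq_sum_wgt]
  calc ∑ q ∈ (stripPairs 1 N).filter (fun q => κ * N + d ≤ ((bottomVisits₀ q.1 q.2 N + topVisits₀ 1 q.1 q.2 N : ℕ) : ℝ)),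
        wgt y z N q * u ^ (κ * N + d)
      ≤ ∑ q ∈ (stripPairs 1 N).filter (fun q => κ * N + d ≤ ((bottomVisits₀ q.1 q.2 N + topVisits₀ 1 q.1 q.2 N : ℕ) : ℝ)),
          wgt (y * u) (z * u) N q :=
        Finset.sum_le_sum fun q hq => by
          rw [wgt_tilt_ray]
          refine mul_le_mul_of_nonneg_left ?_ (wgt_nonneg hy hz N q)
          calc u ^ (κ * N + d) ≤ u ^ (((bottomVisits₀ q.1 q.2 N + topVisits₀ 1 q.1 q.2 N : ℕ) : ℕ) : ℝ) :=
                Real.rpow_le_rpow_of_exponent_le hu (Finset.mem_filter.1 hq).2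
            _ = u ^ (bottomVisits₀ q.1 q.2 N + topVisits₀ 1 q.1 q.2 N) := Real.rpow_natCast u _
    _ ≤ ∑ q ∈ stripPairs 1 N, wgt (y * u) (z * u) N q :=
        Finset.sum_le_sum_of_subset_of_nonneg (Finset.filter_subset _ _) fun q _ _ =>
          wgt_nonneg (mul_nonneg hy hu0) (mul_nonneg hz hu0) N q

open Classical in
/-- ★★ **Chernoff for the total contacts, lower tail (shifted level)**: for `0 < u ≤ 1`,
`(Σ_{q : bc+tc ≤ κN + d} y^{bc} z^{tc}) · u^{κN + d} ≤ C_{1,N}(yu, zu)`. [cite: DemboZeitouni2010, §2.2 Theorem 2.2.3 (Chebycheff step); BeatonBousquetMelouDeGierDuminilCopinGuttmann2014, §3.2 (arXiv v5 p. 10)] -/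
theorem sum_total_le_mul_rpow_le (hy : 0 ≤ y) (hz : 0 ≤ z) {u : ℝ} (hu0 : 0 < u) (hu1 : u ≤ 1) (N : ℕ) (κ d : ℝ) :
    (∑ q ∈ (stripPairs 1 N).filter (fun q => ((bottomVisits₀ q.1 q.2 N + topVisits₀ 1 q.1 q.2 N : ℕ) : ℝ) ≤ κ * N + d),
        wgt y z N q) * u ^ (κ * N + d) ≤ stripZ₂ 1 N (y * u) (z * u) := by
  rw [Finset.sum_mul, stripZ₂_one_eq_sum_wgt]
  calc ∑ q ∈ (stripPairs 1 N).filter (fun q => ((bottomVisits₀ q.1 q.2 N + topVisits₀ 1 q.1 q.2 N : ℕ) : ℝ) ≤ κ * N + d),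
        wgt y z N q * u ^ (κ * N + d)
      ≤ ∑ q ∈ (stripPairs 1 N).filter (fun q => ((bottomVisits₀ q.1 q.2 N + topVisits₀ 1 q.1 q.2 N : ℕ) : ℝ) ≤ κ * N + d),
          wgt (y * u) (z * u) N q :=
        Finset.sum_le_sum fun q hq => by
          rw [wgt_tilt_ray]
          refine mul_le_mul_of_nonneg_left ?_ (wgt_nonneg hy hz N q)
          calc u ^ (κ * N + d) ≤ u ^ (((bottomVisits₀ q.1 q.2 N + topVisits₀ 1 q.1 q.2 N : ℕ) : ℕ) : ℝ) :=
                Real.rpow_le_rpow_of_exponent_ge hu0 hu1 (Finset.mem_filter.1 hq).2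
            _ = u ^ (bottomVisits₀ q.1 q.2 N + topVisits₀ 1 q.1 q.2 N) := Real.rpow_natCast u _
    _ ≤ ∑ q ∈ stripPairs 1 N, wgt (y * u) (z * u) N q :=
        Finset.sum_le_sum_of_subset_of_nonneg (Finset.filter_subset _ _) fun q _ _ =>
          wgt_nonneg (mul_nonneg hy hu0.le) (mul_nonneg hz hu0.le) N q

/-- ★★ **From a two-fugacity Chernoff inequality to the exponential scale** (shifted exponent): if
`S_N · u^{aN + d} ≤ C_{1,N}(Y,Z)` then `S_N / C_{1,N}(y,z) ≤ exp(N·[−(a log u − log(μ_1(Y,Z)/μ_1(y,z))) + ε])` for all large `N`.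
[cite: DemboZeitouni2010, §2.2 Theorem 2.2.3 (upper bound); BeatonBousquetMelouDeGierDuminilCopinGuttmann2014, §3.2 Proposition 6 (arXiv v5 p. 10)] -/
theorem fraction_le_exp_of_chernoff₂ (hy : 0 < y) (hz : 0 < z) {Y Z u : ℝ} (hY : 0 < Y) (hZ : 0 < Z) (hu : 0 < u)
    (a d : ℝ) (S : ℕ → ℝ) (hS : ∀ N : ℕ, S N * u ^ (a * N + d) ≤ stripZ₂ 1 N Y Z) {ε : ℝ} (hε : 0 < ε) :
    ∀ᶠ N : ℕ in atTop, S N / stripZ₂ 1 N y z ≤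
      Real.exp ((-(a * Real.log u - Real.log (stripMuY₂ 1 Y Z / stripMuY₂ 1 y z)) + ε) * N) := by
  set K := yK y * yK z with hK
  have hK1 : 1 ≤ K := by rw [hK]; nlinarith [one_le_yK y, one_le_yK z]
  have hK0 : 0 < K := by linarith
  have hud : 0 < u ^ d := Real.rpow_pos_of_pos hu d
  have hε2 : 0 < ε / 2 := by linarith
  rw [Real.log_div (stripMuY₂_pos 1 hY hZ).ne' (stripMuY₂_pos 1 hy hz).ne']
  filter_upwards [eventually_stripZ₂_one_exp_bounds hY hZ hε2, eventually_stripZ₂_one_exp_bounds hy hz hε2,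
    eventually_le_exp_mul (K := K / u ^ d) hε2] with N hNY hNy hNK
  obtain ⟨_, hZY⟩ := hNY
  obtain ⟨hZy, _⟩ := hNy
  have hZy0 := stripZ₂_pos 1 N hy hz
  have hpow0 : 0 < u ^ (a * N + d) := Real.rpow_pos_of_pos hu _
  have hupow : u ^ (a * N + d) = Real.exp (a * Real.log u * N) * u ^ d := by
    rw [Real.rpow_add hu, Real.rpow_def_of_pos hu]; ring_nf
  -- `S_N ≤ C_{1,N}(Y,Z) · exp(−a log u N) / u^d`
  have hS' : S N ≤ stripZ₂ 1 N Y Z * (Real.exp (-(a * Real.log u * N)) / u ^ d) := by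
    have h1 : S N ≤ stripZ₂ 1 N Y Z / u ^ (a * N + d) := by rw [le_div_iff₀ hpow0]; exact hS N
    rw [hupow, Real.exp_neg] at *
    calc S N ≤ stripZ₂ 1 N Y Z / (Real.exp (a * Real.log u * N) * u ^ d) := h1
      _ = stripZ₂ 1 N Y Z * ((Real.exp (a * Real.log u * ↑N))⁻¹ / u ^ d) := by
          field_simp
  have h1 : 1 / stripZ₂ 1 N y z ≤ K * Real.exp (-(Real.log (stripMuY₂ 1 y z) * N)) := by
    have hE := Real.exp_pos (Real.log (stripMuY₂ 1 y z) * N)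
    rw [div_le_iff₀ hZy0, Real.exp_neg]
    have e : K * (Real.exp (Real.log (stripMuY₂ 1 y z) * N))⁻¹ * stripZ₂ 1 N y z =
        (K * stripZ₂ 1 N y z) / Real.exp (Real.log (stripMuY₂ 1 y z) * N) := by
      field_simp
    rw [e, le_div_iff₀ hE, one_mul]; exact hZy
  calc S N / stripZ₂ 1 N y z
      ≤ stripZ₂ 1 N Y Z * (Real.exp (-(a * Real.log u * N)) / u ^ d) / stripZ₂ 1 N y z :=
        div_le_div_of_nonneg_right hS' hZy0.le
    _ = stripZ₂ 1 N Y Z * (Real.exp (-(a * Real.log u * N)) / u ^ d) * (1 / stripZ₂ 1 N y z) := by ring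
    _ ≤ Real.exp ((Real.log (stripMuY₂ 1 Y Z) + ε / 2) * N) * (Real.exp (-(a * Real.log u * N)) / u ^ d) *
          (K * Real.exp (-(Real.log (stripMuY₂ 1 y z) * N))) := by
        gcongr
    _ = (K / u ^ d) * (Real.exp ((Real.log (stripMuY₂ 1 Y Z) + ε / 2) * N) * Real.exp (-(a * Real.log u * N)) *
          Real.exp (-(Real.log (stripMuY₂ 1 y z) * N))) := by
        rw [div_eq_mul_inv, div_eq_mul_inv]; ring
    _ ≤ Real.exp (ε / 2 * N) * (Real.exp ((Real.log (stripMuY₂ 1 Y Z) + ε / 2) * N) *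
          Real.exp (-(a * Real.log u * N)) * Real.exp (-(Real.log (stripMuY₂ 1 y z) * N))) := by
        gcongr
    _ = Real.exp ((-(a * Real.log u - (Real.log (stripMuY₂ 1 Y Z) - Real.log (stripMuY₂ 1 y z))) + ε) * N) := by
        rw [← Real.exp_add, ← Real.exp_add, ← Real.exp_add]; congr 1; ring

/-- If `a₁N + d₁ ≤ T ≤ a₂N + d₂` then `T·ℓ ≤ max(a₁ℓ, a₂ℓ)·N + (|d₁| + |d₂|)·|ℓ|` (`ℓ` of either sign).
[cite: DemboZeitouni2010, §2.2 (lane plumbing)] -/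
theorem mul_le_max_mul_natCast_add {a₁ a₂ d₁ d₂ T ℓ : ℝ} {N : ℕ} (h₁ : a₁ * N + d₁ ≤ T) (h₂ : T ≤ a₂ * N + d₂) :
    T * ℓ ≤ max (a₁ * ℓ) (a₂ * ℓ) * N + (|d₁| + |d₂|) * |ℓ| := by
  have hN : (0 : ℝ) ≤ N := Nat.cast_nonneg N
  have hdl₁ : d₁ * ℓ ≤ |d₁| * |ℓ| := by rw [← abs_mul]; exact le_abs_self _
  have hdl₂ : d₂ * ℓ ≤ |d₂| * |ℓ| := by rw [← abs_mul]; exact le_abs_self _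
  have h₁' : 0 ≤ |d₁| * |ℓ| := by positivity
  have h₂' : 0 ≤ |d₂| * |ℓ| := by positivity
  rcases le_or_gt 0 ℓ with hℓ | hℓ
  · calc T * ℓ ≤ (a₂ * N + d₂) * ℓ := mul_le_mul_of_nonneg_right h₂ hℓ
      _ = a₂ * ℓ * N + d₂ * ℓ := by ring
      _ ≤ max (a₁ * ℓ) (a₂ * ℓ) * N + |d₂| * |ℓ| :=
          add_le_add (mul_le_mul_of_nonneg_right (le_max_right _ _) hN) hdl₂
      _ ≤ _ := by nlinarith
  · calc T * ℓ ≤ (a₁ * N + d₁) * ℓ := by nlinarith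
      _ = a₁ * ℓ * N + d₁ * ℓ := by ring
      _ ≤ max (a₁ * ℓ) (a₂ * ℓ) * N + |d₁| * |ℓ| :=
          add_le_add (mul_le_mul_of_nonneg_right (le_max_left _ _) hN) hdl₁
      _ ≤ _ := by nlinarith

open Classical in
/-- ★ **Change of fugacity along a ray on a window of total contacts**: on `{a₁N + d₁ ≤ bc+tc ≤ a₂N + d₂}`,
`Σ_W y^{bc}z^{tc} ≥ exp(−(max(a₁ℓ,a₂ℓ)·N + (|d₁|+|d₂|)·|ℓ|)) · Σ_W (yu)^{bc}(zu)^{tc}`, `ℓ = log u`.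
[cite: DemboZeitouni2010, §2.2 Theorem 2.2.3 (change of measure); BeatonBousquetMelouDeGierDuminilCopinGuttmann2014, §3.2 (arXiv v5 p. 10)] -/
theorem exp_mul_windowSumT_le (hy : 0 < y) (hz : 0 < z) {u : ℝ} (hu : 0 < u) (a₁ a₂ d₁ d₂ : ℝ) (N : ℕ) :
    Real.exp (-(max (a₁ * Real.log u) (a₂ * Real.log u) * N + (|d₁| + |d₂|) * |Real.log u|)) *
        (∑ q ∈ (stripPairs 1 N).filter (fun q => a₁ * N + d₁ ≤ ((bottomVisits₀ q.1 q.2 N + topVisits₀ 1 q.1 q.2 N : ℕ) : ℝ) ∧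
            ((bottomVisits₀ q.1 q.2 N + topVisits₀ 1 q.1 q.2 N : ℕ) : ℝ) ≤ a₂ * N + d₂), wgt (y * u) (z * u) N q) ≤
      ∑ q ∈ (stripPairs 1 N).filter (fun q => a₁ * N + d₁ ≤ ((bottomVisits₀ q.1 q.2 N + topVisits₀ 1 q.1 q.2 N : ℕ) : ℝ) ∧
            ((bottomVisits₀ q.1 q.2 N + topVisits₀ 1 q.1 q.2 N : ℕ) : ℝ) ≤ a₂ * N + d₂), wgt y z N q := by
  rw [Finset.mul_sum]
  refine Finset.sum_le_sum fun q hq => ?_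
  obtain ⟨-, hlo, hhi⟩ := Finset.mem_filter.1 hq
  have hw : wgt y z N q = wgt (y * u) (z * u) N q * (u⁻¹) ^ (bottomVisits₀ q.1 q.2 N + topVisits₀ 1 q.1 q.2 N) := by
    rw [wgt_tilt_ray, mul_assoc, ← mul_pow, mul_inv_cancel₀ hu.ne', one_pow, mul_one]
  rw [hw]
  refine mul_comm (Real.exp _) _ ▸ mul_le_mul_of_nonneg_left ?_
    (wgt_nonneg (mul_pos hy hu).le (mul_pos hz hu).le N q)
  rw [← Real.rpow_natCast, Real.rpow_def_of_pos (inv_pos.2 hu), Real.log_inv]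
  apply Real.exp_le_exp.2
  have h := mul_le_max_mul_natCast_add (ℓ := Real.log u) hlo hhi
  linarith

open Classical in
/-- ★ **The two laws of large numbers fill the total-contact window**: if `a₁ < b(Y',Z') + b(Z',Y') < a₂` then eventually
`Σ_{a₁N + d₁ ≤ bc+tc ≤ a₂N + d₂} Y'^{bc} Z'^{tc} ≥ C_{1,N}(Y',Z')/2`. [cite: DemboZeitouni2010, §2.2 Theorem 2.2.3 (the law of large numbers under the tilted measure); AlmJanson1990, via MadrasSlade1993 §8.5 pp. 278–279] -/
theorem eventually_half_le_windowSumT {Y' Z' : ℝ} (hY' : 0 < Y') (hZ' : 0 < Z') {a₁ a₂ : ℝ}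
    (h₁ : a₁ < contactB Y' Z' + contactB Z' Y') (h₂ : contactB Y' Z' + contactB Z' Y' < a₂) (d₁ d₂ : ℝ) :
    ∀ᶠ N : ℕ in atTop, stripZ₂ 1 N Y' Z' / 2 ≤
      ∑ q ∈ (stripPairs 1 N).filter (fun q => a₁ * N + d₁ ≤ ((bottomVisits₀ q.1 q.2 N + topVisits₀ 1 q.1 q.2 N : ℕ) : ℝ) ∧
            ((bottomVisits₀ q.1 q.2 N + topVisits₀ 1 q.1 q.2 N : ℕ) : ℝ) ≤ a₂ * N + d₂), wgt Y' Z' N q := by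
  set t' := contactB Y' Z' + contactB Z' Y' with ht'
  set δ := min (t' - a₁) (a₂ - t') / 3 with hδ
  have hδ0 : 0 < δ := by rw [hδ]; exact div_pos (lt_min (by linarith) (by linarith)) (by norm_num)
  have hδ1 : 3 * δ ≤ t' - a₁ := by rw [hδ]; linarith [min_le_left (t' - a₁) (a₂ - t')]
  have hδ2 : 3 * δ ≤ a₂ - t' := by rw [hδ]; linarith [min_le_right (t' - a₁) (a₂ - t')]
  have hb := (tendsto_contactDevFraction hY' hZ' hδ0).eventually (gt_mem_nhds (show (0 : ℝ) < 1 / 4 by norm_num))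
  have ht := (tendsto_topContactDevFraction hY' hZ' hδ0).eventually (gt_mem_nhds (show (0 : ℝ) < 1 / 4 by norm_num))
  have hN1 : ∀ᶠ N : ℕ in atTop, |d₁| + |d₂| ≤ δ * N := by
    have := tendsto_natCast_atTop_atTop.const_mul_atTop hδ0 |>.eventually_ge_atTop (|d₁| + |d₂|)
    exact this
  filter_upwards [hb, ht, hN1, Filter.eventually_gt_atTop 0] with N hbN htN hdN hN0
  have hN' : (0 : ℝ) < N := by exact_mod_cast hN0
  have hZ := stripZ₂_pos 1 N hY' hZ'
  set W := (stripPairs 1 N).filter (fun q => a₁ * N + d₁ ≤ ((bottomVisits₀ q.1 q.2 N + topVisits₀ 1 q.1 q.2 N : ℕ) : ℝ) ∧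
    ((bottomVisits₀ q.1 q.2 N + topVisits₀ 1 q.1 q.2 N : ℕ) : ℝ) ≤ a₂ * N + d₂) with hW
  set Db := contactDevPairs Y' Z' N δ with hDb
  set Dt := (stripPairs 1 N).filter (fun q => δ ≤ |(topVisits₀ 1 q.1 q.2 N : ℝ) / N - contactB Z' Y'|) with hDt
  have hcover : stripPairs 1 N ⊆ W ∪ (Db ∪ Dt) := by
    intro q hq
    rw [Finset.mem_union, Finset.mem_union]
    by_cases hb' : δ ≤ |(bottomVisits₀ q.1 q.2 N : ℝ) / N - contactB Y' Z'|
    · exact Or.inr (Or.inl (by rw [hDb, contactDevPairs, Finset.mem_filter]; exact ⟨hq, hb'⟩))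
    by_cases ht'' : δ ≤ |(topVisits₀ 1 q.1 q.2 N : ℝ) / N - contactB Z' Y'|
    · exact Or.inr (Or.inr (Finset.mem_filter.2 ⟨hq, ht''⟩))
    left
    rw [not_le] at hb' ht''
    obtain ⟨hb1, hb2⟩ := abs_lt.1 hb'
    obtain ⟨ht1, ht2⟩ := abs_lt.1 ht''
    have hb1' : (contactB Y' Z' - δ) * N < (bottomVisits₀ q.1 q.2 N : ℝ) := by
      rw [lt_sub_iff_add_lt, lt_div_iff₀ hN'] at hb1; linarith
    have hb2' : (bottomVisits₀ q.1 q.2 N : ℝ) < (contactB Y' Z' + δ) * N := by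
      rw [sub_lt_iff_lt_add, div_lt_iff₀ hN'] at hb2; linarith
    have ht1' : (contactB Z' Y' - δ) * N < (topVisits₀ 1 q.1 q.2 N : ℝ) := by
      rw [lt_sub_iff_add_lt, lt_div_iff₀ hN'] at ht1; linarith
    have ht2' : (topVisits₀ 1 q.1 q.2 N : ℝ) < (contactB Z' Y' + δ) * N := by
      rw [sub_lt_iff_lt_add, div_lt_iff₀ hN'] at ht2; linarith
    have hd1 : d₁ ≤ |d₁| := le_abs_self d₁
    have hd2 : -|d₂| ≤ d₂ := neg_abs_le d₂
    have hd1' : 0 ≤ |d₁| := abs_nonneg d₁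
    have hd2' : 0 ≤ |d₂| := abs_nonneg d₂
    have hk1 := mul_le_mul_of_nonneg_right hδ1 hN'.le
    have hk2 := mul_le_mul_of_nonneg_right hδ2 hN'.le
    refine Finset.mem_filter.2 ⟨hq, ?_, ?_⟩
    · push_cast; linarith
    · push_cast; linarith
  have hsplit : stripZ₂ 1 N Y' Z' ≤ (∑ q ∈ W, wgt Y' Z' N q) + ((∑ q ∈ Db, wgt Y' Z' N q) + ∑ q ∈ Dt, wgt Y' Z' N q) := by
    rw [stripZ₂_one_eq_sum_wgt]
    have hnn : ∀ q, 0 ≤ wgt Y' Z' N q := fun q => wgt_nonneg hY'.le hZ'.le N q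
    calc ∑ q ∈ stripPairs 1 N, wgt Y' Z' N q ≤ ∑ q ∈ W ∪ (Db ∪ Dt), wgt Y' Z' N q :=
          Finset.sum_le_sum_of_subset_of_nonneg hcover fun q _ _ => hnn q
      _ ≤ (∑ q ∈ W, wgt Y' Z' N q) + ∑ q ∈ Db ∪ Dt, wgt Y' Z' N q := by
          rw [← Finset.sum_union_inter]
          linarith [Finset.sum_nonneg (s := W ∩ (Db ∪ Dt)) fun q _ => hnn q]
      _ ≤ _ := by
          gcongr
          rw [← Finset.sum_union_inter]
          linarith [Finset.sum_nonneg (s := Db ∩ Dt) fun q _ => hnn q]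
  have hb'' : ∑ q ∈ Db, wgt Y' Z' N q < stripZ₂ 1 N Y' Z' / 4 := by
    have h := hbN; rw [div_lt_iff₀ hZ] at h; linarith
  have ht'' : ∑ q ∈ Dt, wgt Y' Z' N q < stripZ₂ 1 N Y' Z' / 4 := by
    have h := htN; rw [div_lt_iff₀ hZ] at h; linarith
  linarith

open Classical in
/-- ★★ **THE LOWER BOUND for a window of total contacts along a ray**: if `a₁ < b(yu,zu) + b(zu,yu) < a₂` (`u > 0`) then under
`P_{N,y,z}` the window `{a₁N + d₁ ≤ bc+tc ≤ a₂N + d₂}` has probability at least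
`exp(−N·[max(a₁ log u, a₂ log u) − log(μ_1(yu,zu)/μ_1(y,z)) + ε])` for all large `N`.
[cite: DemboZeitouni2010, §2.2 Theorem 2.2.3 (lower bound (2.2.11)–(2.2.12)); JansevanRensburg2015, §3.2 Theorem 3.19] -/
theorem exp_le_windowFractionT (hy : 0 < y) (hz : 0 < z) {u : ℝ} (hu : 0 < u) {a₁ a₂ : ℝ}
    (h₁ : a₁ < contactB (y * u) (z * u) + contactB (z * u) (y * u)) (h₂ : contactB (y * u) (z * u) + contactB (z * u) (y * u) < a₂)
    (d₁ d₂ : ℝ) {ε : ℝ} (hε : 0 < ε) :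
    ∀ᶠ N : ℕ in atTop,
      Real.exp ((-(max (a₁ * Real.log u) (a₂ * Real.log u) - Real.log (stripMuY₂ 1 (y * u) (z * u) / stripMuY₂ 1 y z)) - ε) * N) ≤
        (∑ q ∈ (stripPairs 1 N).filter (fun q => a₁ * N + d₁ ≤ ((bottomVisits₀ q.1 q.2 N + topVisits₀ 1 q.1 q.2 N : ℕ) : ℝ) ∧
            ((bottomVisits₀ q.1 q.2 N + topVisits₀ 1 q.1 q.2 N : ℕ) : ℝ) ≤ a₂ * N + d₂), wgt y z N q) / stripZ₂ 1 N y z := by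
  have hyu : 0 < y * u := mul_pos hy hu
  have hzu : 0 < z * u := mul_pos hz hu
  set K' := yK (y * u) * yK (z * u) with hK'
  have hK'1 : 1 ≤ K' := by rw [hK']; nlinarith [one_le_yK (y * u), one_le_yK (z * u)]
  have hK'0 : 0 < K' := by linarith
  have hε2 : 0 < ε / 2 := by linarith
  set M := max (a₁ * Real.log u) (a₂ * Real.log u) with hM
  set D := (|d₁| + |d₂|) * |Real.log u| with hDdef
  rw [Real.log_div (stripMuY₂_pos 1 hyu hzu).ne' (stripMuY₂_pos 1 hy hz).ne']
  filter_upwards [eventually_stripZ₂_one_exp_bounds hyu hzu hε2, eventually_stripZ₂_one_exp_bounds hy hz hε2,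
    eventually_le_exp_mul (K := 2 * K' * Real.exp D) hε2, eventually_half_le_windowSumT hyu hzu h₁ h₂ d₁ d₂] with N hNY hNy hNK hwin
  obtain ⟨hZY, _⟩ := hNY
  obtain ⟨_, hZy⟩ := hNy
  have hZy0 := stripZ₂_pos 1 N hy hz
  have hZY0 := stripZ₂_pos 1 N hyu hzu
  set SW := ∑ q ∈ (stripPairs 1 N).filter (fun q => a₁ * N + d₁ ≤ ((bottomVisits₀ q.1 q.2 N + topVisits₀ 1 q.1 q.2 N : ℕ) : ℝ) ∧
            ((bottomVisits₀ q.1 q.2 N + topVisits₀ 1 q.1 q.2 N : ℕ) : ℝ) ≤ a₂ * N + d₂), wgt y z N q with hSW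
  set SW' := ∑ q ∈ (stripPairs 1 N).filter (fun q => a₁ * N + d₁ ≤ ((bottomVisits₀ q.1 q.2 N + topVisits₀ 1 q.1 q.2 N : ℕ) : ℝ) ∧
            ((bottomVisits₀ q.1 q.2 N + topVisits₀ 1 q.1 q.2 N : ℕ) : ℝ) ≤ a₂ * N + d₂), wgt (y * u) (z * u) N q with hSW'
  have hchange : Real.exp (-(M * N + D)) * SW' ≤ SW := exp_mul_windowSumT_le hy hz hu a₁ a₂ d₁ d₂ N
  have hED : 0 < Real.exp D := Real.exp_pos D
  -- `C_{1,N}(yu,zu)/2 ≥ exp(log μ_1(yu,zu) N) · exp(−ε N/2) · exp(D)` (constants absorbed)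
  have hZY' : Real.exp (Real.log (stripMuY₂ 1 (y * u) (z * u)) * N) * Real.exp (-(ε / 2 * N)) * Real.exp D ≤
      stripZ₂ 1 N (y * u) (z * u) / 2 := by
    rw [Real.exp_neg, le_div_iff₀ (by norm_num : (0:ℝ) < 2)]
    have hE := Real.exp_pos (ε / 2 * N)
    calc Real.exp (Real.log (stripMuY₂ 1 (y * u) (z * u)) * N) * (Real.exp (ε / 2 * N))⁻¹ * Real.exp D * 2
        = Real.exp (Real.log (stripMuY₂ 1 (y * u) (z * u)) * N) * (2 * Real.exp D / Real.exp (ε / 2 * N)) := by ring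
      _ ≤ Real.exp (Real.log (stripMuY₂ 1 (y * u) (z * u)) * N) * (1 / K') := by
          refine mul_le_mul_of_nonneg_left ?_ (Real.exp_pos _).le
          rw [div_le_div_iff₀ hE hK'0]; nlinarith
      _ = Real.exp (Real.log (stripMuY₂ 1 (y * u) (z * u)) * N) / K' := by ring
      _ ≤ stripZ₂ 1 N (y * u) (z * u) := by rw [div_le_iff₀ hK'0]; linarith
  have hlow : Real.exp (-(M * N + D)) * (Real.exp (Real.log (stripMuY₂ 1 (y * u) (z * u)) * N) * Real.exp (-(ε / 2 * N)) *
      Real.exp D) ≤ SW :=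
    (mul_le_mul_of_nonneg_left (hZY'.trans hwin) (Real.exp_pos _).le).trans hchange
  rw [le_div_iff₀ hZy0]
  calc Real.exp ((-(M - (Real.log (stripMuY₂ 1 (y * u) (z * u)) - Real.log (stripMuY₂ 1 y z))) - ε) * N) * stripZ₂ 1 N y z
      ≤ Real.exp ((-(M - (Real.log (stripMuY₂ 1 (y * u) (z * u)) - Real.log (stripMuY₂ 1 y z))) - ε) * N) *
          Real.exp ((Real.log (stripMuY₂ 1 y z) + ε / 2) * N) := by gcongr
    _ = Real.exp (-(M * N + D)) * (Real.exp (Real.log (stripMuY₂ 1 (y * u) (z * u)) * N) * Real.exp (-(ε / 2 * N)) *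
          Real.exp D) := by
        rw [← Real.exp_add, ← Real.exp_add, ← Real.exp_add, ← Real.exp_add]; congr 1; ring
    _ ≤ SW := hlow

/-- Continuity at `u₀` of the diagonal window cost `u' ↦ max(a log u', (2(b(yu',yu')+b(yu',yu')) − a) log u') − log(μ_1(yu',yu')/μ_1(y,y))`.
[cite: DemboZeitouni2010, §2.2 (lane plumbing)] -/
theorem continuousAt_windowCostT (hy : 0 < y) {u₀ : ℝ} (hu₀ : 0 < u₀) (a : ℝ) :
    ContinuousAt (fun u' => max (a * Real.log u') ((2 * (contactB (y * u') (y * u') + contactB (y * u') (y * u')) - a) *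
      Real.log u') - Real.log (stripMuY₂ 1 (y * u') (y * u') / stripMuY₂ 1 y y)) u₀ := by
  have hyu : 0 < y * u₀ := mul_pos hy hu₀
  have hlog : ContinuousAt (fun u' : ℝ => Real.log u') u₀ := Real.continuousAt_log hu₀.ne'
  have hlin : ContinuousAt (fun u' : ℝ => (y * u', y * u')) u₀ :=
    (continuousAt_const.mul continuousAt_id).prodMk (continuousAt_const.mul continuousAt_id)
  have hb' := ContinuousAt.comp_of_eq (continuousAt_contactB₂ hyu hyu) hlin rfl
  simp only [Function.comp_def] at hb'
  have hb : ContinuousAt (fun u' => contactB (y * u') (y * u')) u₀ := hb'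
  have hμc : ContinuousAt (fun p : ℝ × ℝ => stripMuY₂ 1 p.1 p.2) (y * u₀, y * u₀) :=
    (continuousOn_stripMuY₂ 1).continuousAt ((isOpen_Ioi.prod isOpen_Ioi).mem_nhds ⟨hyu, hyu⟩)
  have hμ' := ContinuousAt.comp_of_eq hμc hlin rfl
  simp only [Function.comp_def] at hμ'
  have hμ'' : ContinuousAt (fun u' => stripMuY₂ 1 (y * u') (y * u')) u₀ := hμ'
  have hμ : ContinuousAt (fun u' => Real.log (stripMuY₂ 1 (y * u') (y * u') / stripMuY₂ 1 y y)) u₀ :=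
    (hμ''.div_const _).log (div_pos (stripMuY₂_pos 1 hyu hyu) (stripMuY₂_pos 1 hy hy)).ne'
  have hA : ContinuousAt (fun u' : ℝ => a * Real.log u') u₀ := continuousAt_const.mul hlog
  have hB : ContinuousAt (fun u' : ℝ => (2 * (contactB (y * u') (y * u') + contactB (y * u') (y * u')) - a) *
      Real.log u') u₀ := ((continuousAt_const.mul (hb.add hb)).sub continuousAt_const).mul hlog
  have hAB : ContinuousAt (fun u' : ℝ => max (a * Real.log u') ((2 * (contactB (y * u') (y * u') +
      contactB (y * u') (y * u')) - a) * Real.log u')) u₀ := hA.max hB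
  exact hAB.sub hμ

open Classical in
/-- ★★★ **LARGE DEVIATIONS OF THE TOTAL SURFACE CONTACTS on the diagonal `y = z` — upper tail, two-sided exponential bounds**:
for `y > 0`, `Y ≥ y`, every real shift `d` and `ε > 0`, eventually
`exp(−N(I₂ + ε)) ≤ P_{N,y,y}(bc + tc ≥ 2b(Y,Y)·N + d) ≤ exp(−N(I₂ − ε))`, `I₂ = diagRate y Y`.
[cite: DemboZeitouni2010, §2.2 Theorem 2.2.3 (Cramér); JansevanRensburg2015, §3.2 Theorems 3.17–3.19] -/
theorem totalContacts_ge_exp_bounds (hy : 0 < y) {Y : ℝ} (hyY : y ≤ Y) (d : ℝ) {ε : ℝ} (hε : 0 < ε) :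
    (∀ᶠ N : ℕ in atTop, Real.exp ((-diagRate y Y - ε) * N) ≤
        (∑ q ∈ (stripPairs 1 N).filter
          (fun q => 2 * contactB Y Y * N + d ≤ ((bottomVisits₀ q.1 q.2 N + topVisits₀ 1 q.1 q.2 N : ℕ) : ℝ)), wgt y y N q) /
            stripZ₂ 1 N y y) ∧
    (∀ᶠ N : ℕ in atTop,
        (∑ q ∈ (stripPairs 1 N).filter
          (fun q => 2 * contactB Y Y * N + d ≤ ((bottomVisits₀ q.1 q.2 N + topVisits₀ 1 q.1 q.2 N : ℕ) : ℝ)), wgt y y N q) /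
            stripZ₂ 1 N y y ≤ Real.exp ((-diagRate y Y + ε) * N)) := by
  have hY : 0 < Y := hy.trans_le hyY
  have hu₀ : 0 < Y / y := div_pos hY hy
  have hyu₀ : y * (Y / y) = Y := mul_div_cancel₀ _ hy.ne'
  constructor
  · -- lower bound: change of measure to `u' ↓ Y/y`
    have hε2 : 0 < ε / 2 := by linarith
    have hval : max (2 * contactB Y Y * Real.log (Y / y)) ((2 * (contactB (y * (Y / y)) (y * (Y / y)) +
        contactB (y * (Y / y)) (y * (Y / y))) - 2 * contactB Y Y) * Real.log (Y / y)) -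
        Real.log (stripMuY₂ 1 (y * (Y / y)) (y * (Y / y)) / stripMuY₂ 1 y y) = diagRate y Y := by
      rw [hyu₀, show 2 * (contactB Y Y + contactB Y Y) - 2 * contactB Y Y = 2 * contactB Y Y by ring, max_self]; rfl
    have hev : ∀ᶠ u' in 𝓝 (Y / y), max (2 * contactB Y Y * Real.log u') ((2 * (contactB (y * u') (y * u') +
        contactB (y * u') (y * u')) - 2 * contactB Y Y) * Real.log u') -
        Real.log (stripMuY₂ 1 (y * u') (y * u') / stripMuY₂ 1 y y) < diagRate y Y + ε / 2 :=
      (continuousAt_windowCostT hy hu₀ (2 * contactB Y Y)).eventually (gt_mem_nhds (by simp only [hval]; linarith))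
    obtain ⟨u', hu'c, huu'⟩ := ((hev.filter_mono nhdsWithin_le_nhds).and
      (self_mem_nhdsWithin : Set.Ioi (Y / y) ∈ 𝓝[>] (Y / y))).exists
    have huu' : Y / y < u' := huu'
    have hu' : 0 < u' := hu₀.trans huu'
    have hYu : Y < y * u' := by
      calc Y = y * (Y / y) := hyu₀.symm
        _ < y * u' := mul_lt_mul_of_pos_left huu' hy
    have hb1 : 2 * contactB Y Y < contactB (y * u') (y * u') + contactB (y * u') (y * u') := by
      have := contactB_diag_strictMono hY hYu; linarith
    have hb2 : contactB (y * u') (y * u') + contactB (y * u') (y * u') <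
        2 * (contactB (y * u') (y * u') + contactB (y * u') (y * u')) - 2 * contactB Y Y := by linarith
    filter_upwards [exp_le_windowFractionT hy hy hu' hb1 hb2 d 0 hε2] with N hN
    refine le_trans ?_ (hN.trans ?_)
    · exact Real.exp_le_exp.2 (mul_le_mul_of_nonneg_right (by linarith) (Nat.cast_nonneg N))
    · refine div_le_div_of_nonneg_right ?_ (stripZ₂_pos 1 N hy hy).le
      refine Finset.sum_le_sum_of_subset_of_nonneg (fun q hq => ?_) fun q _ _ => wgt_nonneg hy.le hy.le N q
      rw [Finset.mem_filter] at hq ⊢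
      exact ⟨hq.1, hq.2.1⟩
  · -- upper bound: Chernoff along the ray at `u = Y/y ≥ 1`
    have hu1 : 1 ≤ Y / y := (one_le_div hy).2 hyY
    have h := fraction_le_exp_of_chernoff₂ hy hy hY hY hu₀ (2 * contactB Y Y) d
      (fun N => ∑ q ∈ (stripPairs 1 N).filter
        (fun q => 2 * contactB Y Y * N + d ≤ ((bottomVisits₀ q.1 q.2 N + topVisits₀ 1 q.1 q.2 N : ℕ) : ℝ)), wgt y y N q)
      (fun N => by
        have := sum_total_ge_mul_rpow_le hy.le hy.le hu1 N (2 * contactB Y Y) d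
        rwa [hyu₀] at this) hε
    filter_upwards [h] with N hN
    have e : -diagRate y Y + ε = -(2 * contactB Y Y * Real.log (Y / y) - Real.log (stripMuY₂ 1 Y Y / stripMuY₂ 1 y y)) + ε := rfl
    rw [e]; exact hN

open Classical in
/-- ★★★ **… lower tail**: for `0 < Y ≤ y`, eventually `exp(−N(I₂ + ε)) ≤ P_{N,y,y}(bc + tc ≤ 2b(Y,Y)·N + d) ≤ exp(−N(I₂ − ε))`.
[cite: DemboZeitouni2010, §2.2 Theorem 2.2.3 (Cramér); JansevanRensburg2015, §3.2 Theorems 3.17–3.19] -/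
theorem totalContacts_le_exp_bounds (hy : 0 < y) {Y : ℝ} (hY : 0 < Y) (hYy : Y ≤ y) (d : ℝ) {ε : ℝ} (hε : 0 < ε) :
    (∀ᶠ N : ℕ in atTop, Real.exp ((-diagRate y Y - ε) * N) ≤
        (∑ q ∈ (stripPairs 1 N).filter
          (fun q => ((bottomVisits₀ q.1 q.2 N + topVisits₀ 1 q.1 q.2 N : ℕ) : ℝ) ≤ 2 * contactB Y Y * N + d), wgt y y N q) /
            stripZ₂ 1 N y y) ∧
    (∀ᶠ N : ℕ in atTop,
        (∑ q ∈ (stripPairs 1 N).filter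
          (fun q => ((bottomVisits₀ q.1 q.2 N + topVisits₀ 1 q.1 q.2 N : ℕ) : ℝ) ≤ 2 * contactB Y Y * N + d), wgt y y N q) /
            stripZ₂ 1 N y y ≤ Real.exp ((-diagRate y Y + ε) * N)) := by
  have hu₀ : 0 < Y / y := div_pos hY hy
  have hyu₀ : y * (Y / y) = Y := mul_div_cancel₀ _ hy.ne'
  constructor
  · have hε2 : 0 < ε / 2 := by linarith
    have hval : max (2 * contactB Y Y * Real.log (Y / y)) ((2 * (contactB (y * (Y / y)) (y * (Y / y)) +
        contactB (y * (Y / y)) (y * (Y / y))) - 2 * contactB Y Y) * Real.log (Y / y)) -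
        Real.log (stripMuY₂ 1 (y * (Y / y)) (y * (Y / y)) / stripMuY₂ 1 y y) = diagRate y Y := by
      rw [hyu₀, show 2 * (contactB Y Y + contactB Y Y) - 2 * contactB Y Y = 2 * contactB Y Y by ring, max_self]; rfl
    have hev : ∀ᶠ u' in 𝓝 (Y / y), max (2 * contactB Y Y * Real.log u') ((2 * (contactB (y * u') (y * u') +
        contactB (y * u') (y * u')) - 2 * contactB Y Y) * Real.log u') -
        Real.log (stripMuY₂ 1 (y * u') (y * u') / stripMuY₂ 1 y y) < diagRate y Y + ε / 2 :=
      (continuousAt_windowCostT hy hu₀ (2 * contactB Y Y)).eventually (gt_mem_nhds (by simp only [hval]; linarith))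
    obtain ⟨u', hu'c, huu'⟩ := ((hev.filter_mono nhdsWithin_le_nhds).and (Ioo_mem_nhdsLT hu₀)).exists
    have hu' : 0 < u' := huu'.1
    have hYu : y * u' < Y := by
      calc y * u' < y * (Y / y) := mul_lt_mul_of_pos_left huu'.2 hy
        _ = Y := hyu₀
    have hb2 : contactB (y * u') (y * u') + contactB (y * u') (y * u') < 2 * contactB Y Y := by
      have := contactB_diag_strictMono (mul_pos hy hu') hYu; linarith
    have hb1 : 2 * (contactB (y * u') (y * u') + contactB (y * u') (y * u')) - 2 * contactB Y Y <
        contactB (y * u') (y * u') + contactB (y * u') (y * u') := by linarith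
    filter_upwards [exp_le_windowFractionT hy hy hu' hb1 hb2 0 d hε2] with N hN
    rw [max_comm] at hN
    refine le_trans ?_ (hN.trans ?_)
    · exact Real.exp_le_exp.2 (mul_le_mul_of_nonneg_right (by linarith) (Nat.cast_nonneg N))
    · refine div_le_div_of_nonneg_right ?_ (stripZ₂_pos 1 N hy hy).le
      refine Finset.sum_le_sum_of_subset_of_nonneg (fun q hq => ?_) fun q _ _ => wgt_nonneg hy.le hy.le N q
      rw [Finset.mem_filter] at hq ⊢
      exact ⟨hq.1, hq.2.2⟩
  · have hu1 : Y / y ≤ 1 := (div_le_one hy).2 hYy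
    have h := fraction_le_exp_of_chernoff₂ hy hy hY hY hu₀ (2 * contactB Y Y) d
      (fun N => ∑ q ∈ (stripPairs 1 N).filter
        (fun q => ((bottomVisits₀ q.1 q.2 N + topVisits₀ 1 q.1 q.2 N : ℕ) : ℝ) ≤ 2 * contactB Y Y * N + d), wgt y y N q)
      (fun N => by
        have := sum_total_le_mul_rpow_le hy.le hy.le hu₀ hu1 N (2 * contactB Y Y) d
        rwa [hyu₀] at this) hε
    filter_upwards [h] with N hN
    have e : -diagRate y Y + ε = -(2 * contactB Y Y * Real.log (Y / y) - Real.log (stripMuY₂ 1 Y Y / stripMuY₂ 1 y y)) + ε := rfl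
    rw [e]; exact hN

open Classical in
/-- ★★★ **LDP OF THE TOTAL SURFACE-CONTACT FRACTION on the diagonal** (`y = z`): for `Y ≥ y > 0` and any fixed shift `d`,
`(1/N) log P_{N,y,y}(bc + tc ≥ 2b(Y,Y)·N + d) → −I₂(y;Y)`; for `0 < Y ≤ y`, `(1/N) log P_{N,y,y}(bc + tc ≤ 2b(Y,Y)·N + d) → −I₂(y;Y)`.
[cite: DemboZeitouni2010, §2.2 Theorem 2.2.3 (Cramér); JansevanRensburg2015, §3.2 Theorems 3.17–3.19] -/
theorem tendsto_log_totalContacts_ge_le_div (hy : 0 < y) {Y : ℝ} (hY : 0 < Y) (d : ℝ) :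
    (y ≤ Y → Tendsto (fun N : ℕ => Real.log ((∑ q ∈ (stripPairs 1 N).filter
        (fun q => 2 * contactB Y Y * N + d ≤ ((bottomVisits₀ q.1 q.2 N + topVisits₀ 1 q.1 q.2 N : ℕ) : ℝ)), wgt y y N q) /
          stripZ₂ 1 N y y) / N) atTop (𝓝 (-diagRate y Y))) ∧
    (Y ≤ y → Tendsto (fun N : ℕ => Real.log ((∑ q ∈ (stripPairs 1 N).filter
        (fun q => ((bottomVisits₀ q.1 q.2 N + topVisits₀ 1 q.1 q.2 N : ℕ) : ℝ) ≤ 2 * contactB Y Y * N + d), wgt y y N q) /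
          stripZ₂ 1 N y y) / N) atTop (𝓝 (-diagRate y Y))) := by
  constructor
  · intro hyY
    exact tendsto_log_div_of_exp_bounds (fun ε hε => (totalContacts_ge_exp_bounds hy hyY d hε).1)
      (fun ε hε => (totalContacts_ge_exp_bounds hy hyY d hε).2)
  · intro hYy
    exact tendsto_log_div_of_exp_bounds (fun ε hε => (totalContacts_le_exp_bounds hy hY hYy d hε).1)
      (fun ε hε => (totalContacts_le_exp_bounds hy hY hYy d hε).2)

/-! ## §17 (ed.3) LARGE DEVIATIONS OF THE RUNG DENSITY `V(ω)/N` (via the parity identity of §14) -/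

/-- `4·b(Y,Y) = 1 − 1/(2μ_1(Y,Y) + 3)`: twice the typical total surface-contact density is one minus the typical rung density
`ρ(Y,Y) = 1/(2μ_1(Y,Y)+3)` (tree: `contactB_add_contactB_swap`, `twoWallSpeed_self`). [cite: BeatonBousquetMelouDeGierDuminilCopinGuttmann2014, §3.2 Proposition 6 (arXiv v5 p. 10)] -/
theorem four_mul_contactB_diag {Y : ℝ} (hY : 0 < Y) : 4 * contactB Y Y = 1 - 1 / (2 * stripMuY₂ 1 Y Y + 3) := by
  have h := contactB_add_contactB_swap hY hY
  rw [twoWallSpeed_self hY] at h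
  linarith

/-- The two inclusions between rung events and total-contact events (from `2(bc+tc) + V = N + [x_N odd] + [x_0 odd]`):
`bc+tc ≥ 2b(Y,Y)N + 1 ⇒ V ≤ N/(2μ_1(Y,Y)+3) ⇒ bc+tc ≥ 2b(Y,Y)N` and `bc+tc ≤ 2b(Y,Y)N ⇒ V ≥ N/(2μ_1(Y,Y)+3) ⇒ bc+tc ≤ 2b(Y,Y)N + 1`.
[cite: EntingJensen2009, §7.4.2, Fig. 7.10 (lane plumbing)] -/
theorem rung_event_sandwich {Y : ℝ} (hY : 0 < Y) {N : ℕ} {q : Site 2 × (ℕ → Site 2)} (hq : q ∈ stripPairs 1 N) :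
    ((2 * contactB Y Y * N + 1 ≤ ((bottomVisits₀ q.1 q.2 N + topVisits₀ 1 q.1 q.2 N : ℕ) : ℝ) →
        (LadderPot.nV q N : ℝ) ≤ N / (2 * stripMuY₂ 1 Y Y + 3)) ∧
      ((LadderPot.nV q N : ℝ) ≤ N / (2 * stripMuY₂ 1 Y Y + 3) →
        2 * contactB Y Y * N ≤ ((bottomVisits₀ q.1 q.2 N + topVisits₀ 1 q.1 q.2 N : ℕ) : ℝ))) ∧
    ((((bottomVisits₀ q.1 q.2 N + topVisits₀ 1 q.1 q.2 N : ℕ) : ℝ) ≤ 2 * contactB Y Y * N →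
        (N : ℝ) / (2 * stripMuY₂ 1 Y Y + 3) ≤ LadderPot.nV q N) ∧
      ((N : ℝ) / (2 * stripMuY₂ 1 Y Y + 3) ≤ LadderPot.nV q N →
        ((bottomVisits₀ q.1 q.2 N + topVisits₀ 1 q.1 q.2 N : ℕ) : ℝ) ≤ 2 * contactB Y Y * N + 1)) := by
  have hμ := stripMuY₂_pos 1 hY hY
  have h3 : 0 < 2 * stripMuY₂ 1 Y Y + 3 := by linarith
  have h4 := four_mul_contactB_diag hY
  -- the parity identity, cast to `ℝ`, with `0 ≤ e ≤ 2`
  have hid := two_mul_totalVisits_add_nV hq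
  have he0 : 0 ≤ WallPot.siteAt q N 0 % 2 := Int.emod_nonneg _ two_ne_zero
  have he1 : WallPot.siteAt q N 0 % 2 < 2 := Int.emod_lt_of_pos _ two_pos
  have hf0 : 0 ≤ WallPot.siteAt q 0 0 % 2 := Int.emod_nonneg _ two_ne_zero
  have hf1 : WallPot.siteAt q 0 0 % 2 < 2 := Int.emod_lt_of_pos _ two_pos
  set T : ℝ := ((bottomVisits₀ q.1 q.2 N + topVisits₀ 1 q.1 q.2 N : ℕ) : ℝ) with hT
  set V : ℝ := (LadderPot.nV q N : ℝ) with hV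
  have hidR : ∃ e : ℝ, 0 ≤ e ∧ e ≤ 2 ∧ 2 * T + V = N + e := by
    refine ⟨((WallPot.siteAt q N 0 % 2 + WallPot.siteAt q 0 0 % 2 : ℤ) : ℝ), by exact_mod_cast (by omega),
      by exact_mod_cast (by omega), ?_⟩
    rw [hT, hV]
    have := congrArg (fun t : ℤ => (t : ℝ)) hid
    push_cast at this ⊢
    linarith
  obtain ⟨e, he0', he2', hide⟩ := hidR
  -- `ρN = N/(2μ+3) = N − 4bN`
  have hρ : (N : ℝ) / (2 * stripMuY₂ 1 Y Y + 3) = N - 4 * contactB Y Y * N := by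
    rw [h4]; field_simp; ring
  rw [hρ]
  refine ⟨⟨fun h => by linarith, fun h => by linarith⟩, ⟨fun h => by linarith, fun h => by linarith⟩⟩

open Classical in
/-- ★★★ **LARGE DEVIATIONS OF THE RUNG DENSITY — few rungs.**  For `y > 0` and `Y ≥ y`:
`(1/N) log P_{N,y,y}(V(ω) ≤ N/(2μ_1(Y,Y)+3)) → −I₂(y;Y)` (`V` = number of vertical steps; `1/(2μ_1(Y,Y)+3) = ρ(Y,Y)` is the
typical rung density at fugacity `Y` on both walls; `I₂ = diagRate`).  Sandwiched between the total-contact events of §16 with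
shifts `d = 1` and `d = 0`. [cite: DemboZeitouni2010, §2.2 Theorem 2.2.3 (Cramér); MadrasSlade1993, §1.1 eq. (1.1.5); JansevanRensburg2015, §3.2 Theorems 3.17–3.19] -/
theorem tendsto_log_rungs_le_div (hy : 0 < y) {Y : ℝ} (hyY : y ≤ Y) :
    Tendsto (fun N : ℕ => Real.log ((∑ q ∈ (stripPairs 1 N).filter
        (fun q => (LadderPot.nV q N : ℝ) ≤ N / (2 * stripMuY₂ 1 Y Y + 3)), wgt y y N q) / stripZ₂ 1 N y y) / N)
      atTop (𝓝 (-diagRate y Y)) := by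
  have hY : 0 < Y := hy.trans_le hyY
  refine tendsto_log_div_of_exp_bounds (fun ε hε => ?_) (fun ε hε => ?_)
  · filter_upwards [(totalContacts_ge_exp_bounds hy hyY 1 hε).1] with N hN
    refine hN.trans (div_le_div_of_nonneg_right ?_ (stripZ₂_pos 1 N hy hy).le)
    refine Finset.sum_le_sum_of_subset_of_nonneg (fun q hq => ?_) fun q _ _ => wgt_nonneg hy.le hy.le N q
    rw [Finset.mem_filter] at hq ⊢
    exact ⟨hq.1, (rung_event_sandwich hY hq.1).1.1 hq.2⟩
  · filter_upwards [(totalContacts_ge_exp_bounds hy hyY 0 hε).2] with N hN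
    refine le_trans (div_le_div_of_nonneg_right ?_ (stripZ₂_pos 1 N hy hy).le) hN
    refine Finset.sum_le_sum_of_subset_of_nonneg (fun q hq => ?_) fun q _ _ => wgt_nonneg hy.le hy.le N q
    rw [Finset.mem_filter] at hq ⊢
    have h := (rung_event_sandwich hY hq.1).1.2 hq.2
    exact ⟨hq.1, by simpa using h⟩

open Classical in
/-- ★★★ **LARGE DEVIATIONS OF THE RUNG DENSITY — many rungs.**  For `0 < Y ≤ y`:
`(1/N) log P_{N,y,y}(V(ω) ≥ N/(2μ_1(Y,Y)+3)) → −I₂(y;Y)`.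
[cite: DemboZeitouni2010, §2.2 Theorem 2.2.3 (Cramér); MadrasSlade1993, §1.1 eq. (1.1.5); JansevanRensburg2015, §3.2 Theorems 3.17–3.19] -/
theorem tendsto_log_rungs_ge_div (hy : 0 < y) {Y : ℝ} (hY : 0 < Y) (hYy : Y ≤ y) :
    Tendsto (fun N : ℕ => Real.log ((∑ q ∈ (stripPairs 1 N).filter
        (fun q => (N : ℝ) / (2 * stripMuY₂ 1 Y Y + 3) ≤ LadderPot.nV q N), wgt y y N q) / stripZ₂ 1 N y y) / N)
      atTop (𝓝 (-diagRate y Y)) := by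
  refine tendsto_log_div_of_exp_bounds (fun ε hε => ?_) (fun ε hε => ?_)
  · filter_upwards [(totalContacts_le_exp_bounds hy hY hYy 0 hε).1] with N hN
    refine hN.trans (div_le_div_of_nonneg_right ?_ (stripZ₂_pos 1 N hy hy).le)
    refine Finset.sum_le_sum_of_subset_of_nonneg (fun q hq => ?_) fun q _ _ => wgt_nonneg hy.le hy.le N q
    rw [Finset.mem_filter] at hq ⊢
    have h2 : ((bottomVisits₀ q.1 q.2 N + topVisits₀ 1 q.1 q.2 N : ℕ) : ℝ) ≤ 2 * contactB Y Y * N := by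
      have := hq.2; simpa using this
    exact ⟨hq.1, (rung_event_sandwich hY hq.1).2.1 h2⟩
  · filter_upwards [(totalContacts_le_exp_bounds hy hY hYy 1 hε).2] with N hN
    refine le_trans (div_le_div_of_nonneg_right ?_ (stripZ₂_pos 1 N hy hy).le) hN
    refine Finset.sum_le_sum_of_subset_of_nonneg (fun q hq => ?_) fun q _ _ => wgt_nonneg hy.le hy.le N q
    rw [Finset.mem_filter] at hq ⊢
    exact ⟨hq.1, (rung_event_sandwich hY hq.1).2.2 hq.2⟩

/-- At `y = z = 1` the partition function is the walk count: `C_{1,N}(1,1) = c_N(S_1)`. [cite: BeatonBousquetMelouDeGierDuminilCopinGuttmann2014, §3.2 (arXiv v5 p. 10)] -/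
theorem stripZ₂_one_one_one_eq_stripCount (N : ℕ) : stripZ₂ 1 N 1 1 = (stripCount 1 N : ℝ) := by
  simp [stripZ₂_one_eq_sum_wgt, wgt, stripCount]

open Classical in
/-- ★★★ **THE RUNG-DENSITY LDP FOR THE UNIFORM SELF-AVOIDING WALK OF THE ONE-CELL STRIP.**  Under the uniform measure on
`S_N(S_1)` (typical rung density `1/(2μ+3)`, `μ = μ(S_1)` the plastic number — tree `tendsto_rungDevFraction`), for every `Y ≥ 1`:
`(1/N) log ( #{ω : V(ω) ≤ N/(2μ_1(Y,Y)+3)} / c_N(S_1) ) → −I₂(1;Y)`, and for every `0 < Y ≤ 1` the same for `V(ω) ≥ N/(2μ_1(Y,Y)+3)`,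
with `I₂(1;Y) = 2b(Y,Y) log Y − log(μ_1(Y,Y)/μ(S_1)) > 0` for `Y ≠ 1` (`μ_1(Y,Y)³ = Yμ_1(Y,Y) + Y`, `4b(Y,Y) = 1 − 1/(2μ_1(Y,Y)+3)`).
[cite: DemboZeitouni2010, §2.2 Theorem 2.2.3 (Cramér); MadrasSlade1993, §1.1 eq. (1.1.5) and §8.5 pp. 278–279; JansevanRensburg2015, §3.2 Theorems 3.17–3.19] -/
theorem tendsto_log_card_rungs_div {Y : ℝ} (hY : 0 < Y) :
    (1 ≤ Y → Tendsto (fun N : ℕ => Real.log ((((stripPairs 1 N).filter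
        (fun q => (LadderPot.nV q N : ℝ) ≤ N / (2 * stripMuY₂ 1 Y Y + 3))).card : ℝ) / stripCount 1 N) / N)
        atTop (𝓝 (-diagRate 1 Y))) ∧
    (Y ≤ 1 → Tendsto (fun N : ℕ => Real.log ((((stripPairs 1 N).filter
        (fun q => (N : ℝ) / (2 * stripMuY₂ 1 Y Y + 3) ≤ LadderPot.nV q N)).card : ℝ) / stripCount 1 N) / N)
        atTop (𝓝 (-diagRate 1 Y))) := by
  constructor
  · intro h1Y
    have h := tendsto_log_rungs_le_div one_pos h1Y
    simp only [sum_wgt_one_one_eq_card, stripZ₂_one_one_one_eq_stripCount] at h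
    exact h
  · intro hY1
    have h := tendsto_log_rungs_ge_div one_pos hY hY1
    simp only [sum_wgt_one_one_eq_card, stripZ₂_one_one_one_eq_stripCount] at h
    exact h

open Classical in
/-- ★★★ **THE RUNG ENTROPY OF THE ONE-CELL STRIP**: for `Y ≥ 1`, `(1/N) log #{ω ∈ S_N(S_1) : V(ω) ≤ N/(2μ_1(Y,Y)+3)} →
log μ_1(Y,Y) − 2b(Y,Y)·log Y`, and for `0 < Y ≤ 1` the same for `V(ω) ≥ N/(2μ_1(Y,Y)+3)` — the number of `N`-step self-avoiding
walks of `S_1` with rung density at most (resp. at least) `ρ = 1/(2m+3)`, `m = μ_1(Y,Y)`, grows like `exp(N·[log m − 2b(Y,Y) log Y])`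
(`< log μ(S_1)` off `Y = 1`, where `μ_1(1,1) = μ(S_1)`: `stripMuY₂_one_one_one`).
[cite: JansevanRensburg2015, §3.1 Theorem 3.4, §3.2 Theorems 3.17–3.19 (density functions); MadrasSlade1993, §8.2, §8.5 pp. 278–279] -/
theorem tendsto_log_card_rungs_count_div {Y : ℝ} (hY : 0 < Y) :
    (1 ≤ Y → Tendsto (fun N : ℕ => Real.log (((stripPairs 1 N).filter
        (fun q => (LadderPot.nV q N : ℝ) ≤ N / (2 * stripMuY₂ 1 Y Y + 3))).card : ℝ) / N)
        atTop (𝓝 (Real.log (stripMuY₂ 1 Y Y) - 2 * contactB Y Y * Real.log Y))) ∧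
    (Y ≤ 1 → Tendsto (fun N : ℕ => Real.log (((stripPairs 1 N).filter
        (fun q => (N : ℝ) / (2 * stripMuY₂ 1 Y Y + 3) ≤ LadderPot.nV q N)).card : ℝ) / N)
        atTop (𝓝 (Real.log (stripMuY₂ 1 Y Y) - 2 * contactB Y Y * Real.log Y))) := by
  have hZ := tendsto_log_stripZ₂_one_div one_pos one_pos
  simp only [stripZ₂_one_one_one_eq_stripCount] at hZ
  have e : -diagRate 1 Y + Real.log (stripMuY₂ 1 1 1) = Real.log (stripMuY₂ 1 Y Y) - 2 * contactB Y Y * Real.log Y := by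
    rw [diagRate, div_one, Real.log_div (stripMuY₂_pos 1 hY hY).ne' (stripMuY₂_pos 1 one_pos one_pos).ne']; ring
  -- positivity of the counts (eventually): from the exponential lower bounds
  constructor
  · intro h1Y
    have hlim := ((tendsto_log_card_rungs_div hY).1 h1Y).add hZ
    rw [e] at hlim
    refine hlim.congr' ?_
    filter_upwards [(totalContacts_ge_exp_bounds one_pos h1Y 1 one_pos).1, Filter.eventually_gt_atTop 0] with N hN hN0
    have hc : 0 < (stripCount 1 N : ℝ) := by
      rw [← stripZ₂_one_one_one_eq_stripCount]; exact stripZ₂_pos 1 N one_pos one_pos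
    have hpos : 0 < (((stripPairs 1 N).filter
        (fun q => (LadderPot.nV q N : ℝ) ≤ N / (2 * stripMuY₂ 1 Y Y + 3))).card : ℝ) := by
      have h := (Real.exp_pos _).trans_le hN
      rw [sum_wgt_one_one_eq_card, stripZ₂_one_one_one_eq_stripCount] at h
      have h' := (div_pos_iff_of_pos_right hc).1 h
      refine h'.trans_le ?_
      exact_mod_cast Finset.card_le_card (fun q hq => by
        rw [Finset.mem_filter] at hq ⊢
        exact ⟨hq.1, (rung_event_sandwich hY hq.1).1.1 hq.2⟩)
    rw [← add_div, Real.log_div hpos.ne' hc.ne']; ring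
  · intro hY1
    have hlim := ((tendsto_log_card_rungs_div hY).2 hY1).add hZ
    rw [e] at hlim
    refine hlim.congr' ?_
    filter_upwards [(totalContacts_le_exp_bounds one_pos hY hY1 0 one_pos).1, Filter.eventually_gt_atTop 0] with N hN hN0
    have hc : 0 < (stripCount 1 N : ℝ) := by
      rw [← stripZ₂_one_one_one_eq_stripCount]; exact stripZ₂_pos 1 N one_pos one_pos
    have hpos : 0 < (((stripPairs 1 N).filter
        (fun q => (N : ℝ) / (2 * stripMuY₂ 1 Y Y + 3) ≤ LadderPot.nV q N)).card : ℝ) := by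
      have h := (Real.exp_pos _).trans_le hN
      rw [sum_wgt_one_one_eq_card, stripZ₂_one_one_one_eq_stripCount] at h
      have h' := (div_pos_iff_of_pos_right hc).1 h
      refine h'.trans_le ?_
      exact_mod_cast Finset.card_le_card (fun q hq => by
        rw [Finset.mem_filter] at hq ⊢
        have h2 : ((bottomVisits₀ q.1 q.2 N + topVisits₀ 1 q.1 q.2 N : ℕ) : ℝ) ≤ 2 * contactB Y Y * N := by
          have := hq.2; simpa using this
        exact ⟨hq.1, (rung_event_sandwich hY hq.1).2.1 h2⟩)
    rw [← add_div, Real.log_div hpos.ne' hc.ne']; ring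

/-! ## §18 (ed.3) THE RUNG ENTROPY IN CLOSED FORM: `s_V(ρ) = log m − ((1−ρ)/2)·log(m³/(m+1))`, `m = (1−3ρ)/(2ρ)` -/

/-- The growth parameter of a rung density: `m(ρ) = (1 − 3ρ)/(2ρ)` — the value of `μ_1(Y,Y)` whose typical rung density `1/(2m+3)`
is `ρ` (`ρ ∈ (0, 1/3)`). [cite: BeatonBousquetMelouDeGierDuminilCopinGuttmann2014, §3.2 Proposition 6 (arXiv v5 p. 10: μ_1(y,y))] -/
def rungM (ρ : ℝ) : ℝ := (1 - 3 * ρ) / (2 * ρ)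

/-- The fugacity of a rung density: `Y(ρ) = m³/(m+1)`, `m = rungM ρ` — the equal two-wall fugacity at which the typical rung density is
`ρ` (by the tree's cubic law `μ_1(Y,Y)³ = Yμ_1(Y,Y) + Y`). [cite: BeatonBousquetMelouDeGierDuminilCopinGuttmann2014, §3.2 Proposition 6 (arXiv v5 p. 10)] -/
def rungY (ρ : ℝ) : ℝ := rungM ρ ^ 3 / (rungM ρ + 1)

/-- ★ **THE RUNG ENTROPY OF THE ONE-CELL STRIP, in closed form**:
`s_V(ρ) = log m − ((1 − ρ)/2)·log(m³/(m+1))`, `m = (1 − 3ρ)/(2ρ)`, `ρ ∈ (0, 1/3)` — an explicit elementary function of the rung density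
(no implicit inverse is needed on the diagonal: the cubic law solves for the fugacity, `Y = m³/(m+1)`).
[cite: JansevanRensburg2015, §3.1 Theorem 3.4 and §3.2 Theorem 3.19 (density functions); MadrasSlade1993, §8.2] -/
def rungEntropy (ρ : ℝ) : ℝ := Real.log (rungM ρ) - (1 - ρ) / 2 * Real.log (rungY ρ)

/-- For `ρ ∈ (0,1/3)`: `m(ρ) > 0`, `Y(ρ) > 0`, `μ_1(Y(ρ),Y(ρ)) = m(ρ)`, `1/(2μ_1(Y,Y)+3) = ρ` and `2b(Y,Y) = (1−ρ)/2` at `Y = Y(ρ)`.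
[cite: BeatonBousquetMelouDeGierDuminilCopinGuttmann2014, §3.2 Proposition 6 (arXiv v5 p. 10)] -/
theorem rungY_spec {ρ : ℝ} (hρ0 : 0 < ρ) (hρ : ρ < 1 / 3) :
    0 < rungM ρ ∧ 0 < rungY ρ ∧ stripMuY₂ 1 (rungY ρ) (rungY ρ) = rungM ρ ∧
      1 / (2 * stripMuY₂ 1 (rungY ρ) (rungY ρ) + 3) = ρ ∧ 2 * contactB (rungY ρ) (rungY ρ) = (1 - ρ) / 2 := by
  have hm : 0 < rungM ρ := by unfold rungM; exact div_pos (by linarith) (by linarith)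
  have hY : 0 < rungY ρ := by unfold rungY; positivity
  have hμ : stripMuY₂ 1 (rungY ρ) (rungY ρ) = rungM ρ := by
    refine stripMuY₂_one_self_eq_of_pow_three_eq hY hm ?_
    unfold rungY; field_simp
  have hρ' : 1 / (2 * stripMuY₂ 1 (rungY ρ) (rungY ρ) + 3) = ρ := by
    rw [hμ]; unfold rungM; field_simp; ring
  refine ⟨hm, hY, hμ, hρ', ?_⟩
  have h4 := four_mul_contactB_diag hY
  rw [hρ'] at h4
  linarith

/-- `Y(ρ) ≥ 1` iff `ρ ≤ 1/(2μ(S_1)+3)` and `Y(ρ) ≤ 1` iff `ρ ≥ 1/(2μ(S_1)+3)` (`ρ ∈ (0,1/3)`; `μ(S_1) = μ_1(1,1)` the plastic number):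
the typical rung density splits the two tails. [cite: MadrasSlade1993, §8.2 (μ(S_1)); BeatonBousquetMelouDeGierDuminilCopinGuttmann2014, §3.2 Proposition 6 (arXiv v5 p. 10)] -/
theorem one_le_rungY_iff {ρ : ℝ} (hρ0 : 0 < ρ) (hρ : ρ < 1 / 3) :
    (1 ≤ rungY ρ ↔ ρ ≤ 1 / (2 * stripMuY₂ 1 1 1 + 3)) ∧ (rungY ρ ≤ 1 ↔ 1 / (2 * stripMuY₂ 1 1 1 + 3) ≤ ρ) := by
  obtain ⟨hm, hY, hμ, hρ', -⟩ := rungY_spec hρ0 hρ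
  have hμ1 := stripMuY₂_pos 1 one_pos one_pos
  have h3 : 0 < 2 * stripMuY₂ 1 1 1 + 3 := by linarith
  have h3' : 0 < 2 * stripMuY₂ 1 (rungY ρ) (rungY ρ) + 3 := by rw [hμ]; linarith
  -- `ρ ≤ ρ* ⟺ μ_1(1,1) ≤ μ_1(Y,Y) ⟺ 1 ≤ Y` by the strict monotonicity of `Y ↦ μ_1(Y,Y)`
  have hmono : ∀ {a b : ℝ}, 0 < a → a < b → stripMuY₂ 1 a a < stripMuY₂ 1 b b := fun ha hab =>
    (stripMuY₂_one_strictMono_left ha ha hab).trans (stripMuY₂_one_strictMono_right (ha.trans hab) ha hab)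
  constructor
  · constructor
    · intro h1
      rw [← hρ']
      apply one_div_le_one_div_of_le h3
      rcases eq_or_lt_of_le h1 with h | h
      · rw [← h]
      · linarith [hmono one_pos h]
    · intro h
      by_contra hlt
      rw [not_le] at hlt
      have := hmono hY hlt
      rw [← hρ'] at h
      have := (one_div_le_one_div h3' h3).1 h
      linarith
  · constructor
    · intro h1
      rw [← hρ']
      apply one_div_le_one_div_of_le h3'
      rcases eq_or_lt_of_le h1 with h | h
      · rw [h]
      · linarith [hmono hY h]
    · intro h
      by_contra hlt
      rw [not_le] at hlt
      have := hmono one_pos hlt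
      rw [← hρ'] at h
      have := (one_div_le_one_div h3 h3').1 h
      linarith

open Classical in
/-- ★★★ **THE RUNG ENTROPY OF SELF-AVOIDING WALKS IN THE ONE-CELL HONEYCOMB STRIP, IN CLOSED FORM.**  Let `ρ* = 1/(2μ(S_1)+3)`
(`μ(S_1)³ = μ(S_1) + 1`) be the typical rung density.  For `ρ ∈ (0, ρ*]` the number of `N`-step self-avoiding walks of `S_1` (up to
translation) with AT MOST `ρN` vertical steps is `exp(N(s_V(ρ) + o(1)))`, and for `ρ ∈ [ρ*, 1/3)` the number with AT LEAST `ρN`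
vertical steps is `exp(N(s_V(ρ) + o(1)))`, where `s_V(ρ) = log m − ((1−ρ)/2) log(m³/(m+1))`, `m = (1−3ρ)/(2ρ)` (`rungEntropy`):
an explicit arch with `s_V(ρ*) = log μ(S_1)`.
[cite: JansevanRensburg2015, §3.1 Theorem 3.4, §3.2 Theorems 3.17–3.19 (density functions); MadrasSlade1993, §8.2, §8.5 pp. 278–279; DemboZeitouni2010, §2.2 Theorem 2.2.3] -/
theorem tendsto_log_card_rungs_div_closedForm {ρ : ℝ} (hρ0 : 0 < ρ) (hρ : ρ < 1 / 3) :
    (ρ ≤ 1 / (2 * stripMuY₂ 1 1 1 + 3) → Tendsto (fun N : ℕ => Real.log (((stripPairs 1 N).filter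
        (fun q => (LadderPot.nV q N : ℝ) ≤ ρ * N)).card : ℝ) / N) atTop (𝓝 (rungEntropy ρ))) ∧
    (1 / (2 * stripMuY₂ 1 1 1 + 3) ≤ ρ → Tendsto (fun N : ℕ => Real.log (((stripPairs 1 N).filter
        (fun q => ρ * N ≤ (LadderPot.nV q N : ℝ))).card : ℝ) / N) atTop (𝓝 (rungEntropy ρ))) := by
  obtain ⟨hm, hY, hμ, hρ', hb⟩ := rungY_spec hρ0 hρ
  obtain ⟨h1, h2⟩ := tendsto_log_card_rungs_count_div hY
  have hval : Real.log (stripMuY₂ 1 (rungY ρ) (rungY ρ)) - 2 * contactB (rungY ρ) (rungY ρ) * Real.log (rungY ρ) =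
      rungEntropy ρ := by rw [hμ, hb, rungEntropy]
  have hev : ∀ N : ℕ, (N : ℝ) / (2 * stripMuY₂ 1 (rungY ρ) (rungY ρ) + 3) = ρ * N := by
    intro N; rw [div_eq_mul_one_div, hρ', mul_comm]
  constructor
  · intro hle
    have h := h1 (((one_le_rungY_iff hρ0 hρ).1).2 hle)
    rw [hval] at h
    simp only [hev] at h
    exact h
  · intro hge
    have h := h2 (((one_le_rungY_iff hρ0 hρ).2).2 hge)
    rw [hval] at h
    simp only [hev] at h
    exact h

/-- ★★ `s_V(ρ*) = log μ(S_1)` at the typical density `ρ* = 1/(2μ(S_1)+3)` (`Y(ρ*) = 1`), and `s_V(ρ) < log μ(S_1)` for every other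
`ρ ∈ (0,1/3)`. [cite: JansevanRensburg2015, §3.2 Theorem 3.17 (𝓕 = sup {log 𝒫 + ε log z}); MadrasSlade1993, §8.2] -/
theorem rungEntropy_le {ρ : ℝ} (hρ0 : 0 < ρ) (hρ : ρ < 1 / 3) :
    rungEntropy ρ ≤ Real.log (stripConnectiveConstant 1) ∧
      (rungEntropy ρ = Real.log (stripConnectiveConstant 1) ↔ ρ = 1 / (2 * stripConnectiveConstant 1 + 3)) := by
  obtain ⟨hm, hY, hμ, hρ', hb⟩ := rungY_spec hρ0 hρ
  rw [← stripMuY₂_one_one_one 1]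
  have hval : rungEntropy ρ = Real.log (stripMuY₂ 1 1 1) - diagRate 1 (rungY ρ) := by
    rw [rungEntropy, diagRate, div_one, Real.log_div (stripMuY₂_pos 1 hY hY).ne' (stripMuY₂_pos 1 one_pos one_pos).ne', hμ, hb]
    ring
  rw [hval]
  have hmono : ∀ {a b : ℝ}, 0 < a → a < b → stripMuY₂ 1 a a < stripMuY₂ 1 b b := fun ha hab =>
    (stripMuY₂_one_strictMono_left ha ha hab).trans (stripMuY₂_one_strictMono_right (ha.trans hab) ha hab)
  constructor
  · rcases eq_or_ne (rungY ρ) 1 with h | h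
    · rw [h, diagRate_self one_pos]; simp
    · linarith [diagRate_pos one_pos hY h]
  · constructor
    · intro h
      have h0 : diagRate 1 (rungY ρ) = 0 := by linarith
      have hY1 : rungY ρ = 1 := by
        by_contra hne; linarith [diagRate_pos one_pos hY hne]
      rw [← hρ', hY1]
    · intro h
      have hY1 : rungY ρ = 1 := by
        -- `1/(2μ_1(Y,Y)+3) = 1/(2μ_1(1,1)+3)` forces `μ_1(Y,Y) = μ_1(1,1)`, hence `Y = 1` by strict monotonicity
        have h3 : 0 < 2 * stripMuY₂ 1 1 1 + 3 := by linarith [stripMuY₂_pos 1 one_pos one_pos]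
        have h3' : 0 < 2 * stripMuY₂ 1 (rungY ρ) (rungY ρ) + 3 := by rw [hμ]; linarith
        have e := hρ'.trans h
        rw [div_eq_div_iff h3'.ne' h3.ne', one_mul, one_mul] at e
        rcases lt_trichotomy (rungY ρ) 1 with hlt | heq1 | hgt
        · have := hmono hY hlt; linarith
        · exact heq1
        · have := hmono one_pos hgt; linarith
      rw [hY1, diagRate_self one_pos]; simp

/-! ## §19 (ed.4) THE CONTACT ENTROPY IN PARAMETRIC CLOSED FORM (parameter `s = μ_1(Y,z)² ∈ (z, ∞)`) -/

/-- The fugacity with growth parameter `s` at top fugacity `z`: `Y(s) = s²(s−z)/(s² − sz + z)` — the sextic law `s(s−Y)(s−z) = Yz` solved for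
`Y` (linear in `Y`). [cite: BeatonBousquetMelouDeGierDuminilCopinGuttmann2014, §3.2 Proposition 6 (arXiv v5 p. 10)] -/
def paramY (z s : ℝ) : ℝ := s ^ 2 * (s - z) / (s ^ 2 - s * z + z)

/-- The adsorbed fraction as an explicit rational function of `(s, z)`: `a(s) = (s−z)(s²−sz+z)/(2[z(2s−z) + (s−z)(s²−sz+z)])`.
[cite: BeatonBousquetMelouDeGierDuminilCopinGuttmann2014, §3.2 Proposition 6 (arXiv v5 p. 10)] -/
def paramB (z s : ℝ) : ℝ := (s - z) * (s ^ 2 - s * z + z) / (2 * (z * (2 * s - z) + (s - z) * (s ^ 2 - s * z + z)))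

/-- For `s > z > 0`: `Y(s) > 0`, `s² − sz + z > 0`, `s − Y(s) = sz/(s²−sz+z)`, and **`μ_1(Y(s), z)² = s`** (uniqueness of the root of the sextic
above `max(Y,z)`, tree `stripMuY₂_one_sq_eq_of_root`): every `s > z` is the growth parameter of exactly one bottom fugacity.
[cite: BeatonBousquetMelouDeGierDuminilCopinGuttmann2014, §3.2 Proposition 6 (arXiv v5 p. 10)] -/
theorem paramY_spec (hz : 0 < z) {s : ℝ} (hzs : z < s) :
    0 < paramY z s ∧ 0 < s ^ 2 - s * z + z ∧ s - paramY z s = s * z / (s ^ 2 - s * z + z) ∧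
      stripMuY₂ 1 (paramY z s) z ^ 2 = s := by
  have hs : 0 < s := hz.trans hzs
  have hD : 0 < s ^ 2 - s * z + z := by nlinarith [mul_pos hs (sub_pos.2 hzs)]
  have hD' : s ^ 2 - s * z + z ≠ 0 := hD.ne'
  have hY : 0 < paramY z s := by unfold paramY; exact div_pos (by nlinarith [mul_pos (pow_pos hs 2) (sub_pos.2 hzs)]) hD
  have hsub : s - paramY z s = s * z / (s ^ 2 - s * z + z) := by
    unfold paramY
    rw [eq_div_iff hD', sub_mul, div_mul_cancel₀ _ hD']
    ring
  refine ⟨hY, hD, hsub, ?_⟩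
  refine stripMuY₂_one_sq_eq_of_root hY hz (max_le ?_ hzs.le) ?_
  · have : 0 < s - paramY z s := by rw [hsub]; positivity
    linarith
  · rw [hsub]; unfold paramY; ring

/-- ★★ **The adsorbed fraction in closed form along the parametrisation**: `b(Y(s), z) = paramB z s` for `s > z > 0`.
[cite: BeatonBousquetMelouDeGierDuminilCopinGuttmann2014, §3.2 Proposition 6 (arXiv v5 p. 10)] -/
theorem contactB_paramY (hz : 0 < z) {s : ℝ} (hzs : z < s) : contactB (paramY z s) z = paramB z s := by
  obtain ⟨hY, hD, hsub, hμ⟩ := paramY_spec hz hzs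
  have hD' : s ^ 2 - s * z + z ≠ 0 := hD.ne'
  have hs : 0 < s := hz.trans hzs
  unfold contactB
  rw [hμ]
  unfold sexticDeriv paramB
  rw [hsub]
  have hden : 0 < z * (2 * s - z) + (s - z) * (s ^ 2 - s * z + z) := by
    nlinarith [mul_pos hz (by linarith : 0 < 2 * s - z), mul_pos (sub_pos.2 hzs) hD]
  have hDD : (s ^ 2 - s * z + z) * (s ^ 2 - s * z + z)⁻¹ = 1 := mul_inv_cancel₀ hD'
  have e : 2 * (s * z / (s ^ 2 - s * z + z) * (s - z) + s * (s - z) + s * (s * z / (s ^ 2 - s * z + z))) =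
      2 * s * (z * (2 * s - z) + (s - z) * (s ^ 2 - s * z + z)) / (s ^ 2 - s * z + z) := by
    rw [div_eq_mul_inv, div_eq_mul_inv]
    linear_combination (-(2 * s * (s - z))) * hDD
  rw [e, div_div_eq_mul_div, div_eq_div_iff (by positivity) (by positivity)]
  ring

/-- ★★★ **THE CONTACT ENTROPY IN PARAMETRIC CLOSED FORM**: for every top fugacity `z > 0` and parameter `s > z`,
`σ_z(a(s)) = ½·log s − a(s)·log Y(s)` with `a(s) = paramB z s`, `Y(s) = paramY z s` — both rational in `(s,z)`; as `s` runs through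
`(z, ∞)`, `Y(s)` runs through all fugacities `(0,∞)` and `a(s) = b(Y(s),z)` through all levels `(0, 1/2)`.  At `z = 1`:
`σ(a) = ½ log s − a log(s²(s−1)/(s²−s+1))` with `a = (s−1)(s²−s+1)/(2(s³ − 2s² + 4s − 2))`, `s > 1` — the contact entropy of the uniform
self-avoiding walk of `S_1` as an explicit parametric curve (the level `a` solves the cubic `(2a−1)s³ + (2−4a)s² + (8a−2)s + 1 − 4a = 0`).
[cite: JansevanRensburg2015, §3.2 Theorem 3.19 (density function = Legendre transform of the free energy); BeatonBousquetMelouDeGierDuminilCopinGuttmann2014, §3.2 Proposition 6 (arXiv v5 p. 10)] -/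
theorem contactEntropy_param (hz : 0 < z) {s : ℝ} (hzs : z < s) :
    contactEntropy z (paramB z s) = Real.log s / 2 - paramB z s * Real.log (paramY z s) := by
  obtain ⟨hY, -, -, hμ⟩ := paramY_spec hz hzs
  have hb := contactB_paramY hz hzs
  rw [← hb, contactEntropy, levelY_contactB hz hY]
  have hμpos := stripMuY₂_pos 1 hY hz
  have e : Real.log (stripMuY₂ 1 (paramY z s) z) = Real.log s / 2 := by
    have : Real.log s = Real.log (stripMuY₂ 1 (paramY z s) z ^ 2) := by rw [hμ]
    rw [this, Real.log_pow]; push_cast; ring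
  rw [e]

/-- ★★ **Cramér's rate in parametric closed form**: for `y, z > 0` and `s > z`,
`I*(a(s)) = a(s)·log(Y(s)/y) − ½·log(s / μ_1(y,z)²)` (`levelRate y z (paramB z s)`).
[cite: DemboZeitouni2010, §2.2 Theorem 2.2.3 (Cramér); BeatonBousquetMelouDeGierDuminilCopinGuttmann2014, §3.2 Proposition 6 (arXiv v5 p. 10)] -/
theorem levelRate_param (hy : 0 < y) (hz : 0 < z) {s : ℝ} (hzs : z < s) :
    levelRate y z (paramB z s) = paramB z s * Real.log (paramY z s / y) - Real.log (s / stripMuY₂ 1 y z ^ 2) / 2 := by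
  obtain ⟨hY, -, -, hμ⟩ := paramY_spec hz hzs
  have hs : 0 < s := hz.trans hzs
  have hb := contactB_paramY hz hzs
  rw [← hb, levelRate, levelY_contactB hz hY, contactRate]
  have hμY := stripMuY₂_pos 1 hY hz
  have hμy := stripMuY₂_pos 1 hy hz
  have e : Real.log (stripMuY₂ 1 (paramY z s) z / stripMuY₂ 1 y z) = Real.log (s / stripMuY₂ 1 y z ^ 2) / 2 := by
    have : Real.log s = Real.log (stripMuY₂ 1 (paramY z s) z ^ 2) := by rw [hμ]
    rw [Real.log_div hμY.ne' hμy.ne', Real.log_div hs.ne' (pow_pos hμy 2).ne', this, Real.log_pow, Real.log_pow]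
    push_cast; ring
  rw [e]

end Literature.Probability.RandomPlanarGeometry.SAW.HexBW
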